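import Mathlib
import Literature.NumberTheory.Sieve.ShnirelmanGoldbachExplicit
import HarnessLib

/-!
# An explicit Shnirel'man–Goldbach theorem, continued: every integer `> 1` is a sum of at most `77` primes (`379` → `113` → `77`)

Topic `Literature/NumberTheory/Sieve`; namespace `Literature.NumberTheory.Sieve.ShnirelmanGoldbachExplicit` (continued —
these are §13–§15 of the story of `ShnirelmanGoldbachExplicit.lean` (§1–§12, best constant there `501`), kept in
their own module because that file is at the gate's size cap).  Cell `parity-ideate` seat p5, ROUND-28 «FLATTEN»,
ROUND-29 «HÖLDER» (`round23/SchnirelmannExplicit.lean` 91a2c6cd4ba76121, l.3184–4204 and l.4205–5244) and ROUND-30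
«SHIFT» (`round23/SchnirelmannExplicit.lean` dd8ae57b988fc01d, l.5257–5875), landed with
statements and proofs verbatim (helpers `private`, one-line docstrings added where the source had none; the
`private` helpers of §1–§12 they call are re-proved here as verbatim `private` copies).  No named facts; the only
definitions are the staircase bookkeeping `stairT`, `stairL`, `stairM`, `stairMf`, `stairC`, `stairW`, the level-sum
constants `gFlat`, `gHol`, and the eighth-moment local factor `g8Factor` (no instances, no notation).

## References
* [Nathanson1996] M. B. Nathanson, *Additive Number Theory: The Classical Bases*, GTM 164 (1996), §7.3 Lemma 7.6,
  Lemma 7.7, Theorem 7.8, Theorem 7.9 (Goldbach–Shnirel'man).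
* [RosserSchoenfeld1962] J. B. Rosser, L. Schoenfeld, Illinois J. Math. 6 (1962), Theorem 2, eq. (3.3).
* [BatemanDiamond2004] P. T. Bateman, H. G. Diamond, *Analytic Number Theory: An Introductory Course* (2004), §13.4
  (13.13)–(13.14), Theorem 13.8: the explicit large-sieve/Selberg step behind `explicit_of_largeSieve_kappa`.

## Content

* §13 flattening: Cauchy–Schwarz with the STAIRCASE weight `m(N) = Σ_{j<909} c_j·1_{N ≤ x/1.01^j}` (plateaux
  `M_k = ℓ_{k+1}²/t_k`): blockwise `r(N)·m(N) ≤ A·f(N)` (`stair_rm_le_main`, bottom segment `stair_rm_le_bottom`),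
  so `Σ_{even} (r·m)² ≤ (1.329·A² + 0.048)·x` with no `κ = (L/(L−2))⁴` and no `∫t²`-vs-`∫t⁴` loss, while the swap
  `Σ_N r·m = Σ_j c_j·S₁^{ev}(⌊t_j⌋)` (`sum_mul_stairW`) and the telescoped level sum (`stair_lower_sum_ge`) give
  `Σ r·m ≥ (c₁ − 10⁻⁴)·(gFlat(Λ₀)·x − 21)`, `gFlat(174) = 1.9775`; packaged as `goldbach_even_count_ge_flat`,
  instantiated at `Λ₀ = 174`, `A = 14.14` (`e^164.9`): `x/378` even Goldbach numbers (`goldbach_even_count_ge_378`),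
  glue `174 ≤ 0.9212·189`, `σ(B) ≥ 1/189` and `schnirelmann_goldbach_le_379`: every `N ≥ 2` is a sum of at most
  `379` primes (conditional column `289`, `Λ₀ = 132`, `A = 14.48`, `σ(B) ≥ 1/144`).
* §14 Hölder: the staircase of §13 cut to `J = 200` levels with the LOW thresholds `e^44` (sieve, `A = 17.34`;
  first moment from `e^41`, `Σ_{odd} r ≤ 2(x+1) ≤ 10⁻⁴x²/log²x`) and `e^51.5` (count), the small `N < e^44`
  discarded trivially (`r ≤ N + 1`, `m ≤ ℓ_200²/t_199 ≤ 2450.25·e^{−49.5}`: total `≤ 0.0056x`), so that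
  `(0.4242·gHol(Λ₀) − 0.0057)·x ≤ A·Σ_T f(N)` over the set `T` of even Goldbach numbers in `(e^44, x]`
  (`gHol(51.5) = 1.8136`); then HÖLDER with exponent `8` (three Cauchy–Schwarz steps, `pow8_sum_le`:
  `(Σ_T f)⁸ ≤ |T|⁷·Σ_T f⁸`) against the explicit EIGHTH moment `Σ_{even N ≤ x} f(N)⁸ ≤ 259.55·x`
  (`sum_even_oddSingularFactor_pow8_le`: `f⁸ = Σ_T ∏ g₈`, head `∏_{2<p≤100}(1 + g₈(p)/p) ≤ 496.07`, tail
  `g₈(p)/p ≤ 8.76/p²`, `Σ_{odd p > 100} 1/p² ≤ 1/198`) converts f-MASS into COUNT with the loss `|T| ≥ x/78`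
  instead of Cauchy–Schwarz's `x/369` (`goldbach_even_count_ge_holder`); the count is then GLUE-limited
  (`half_count_ge_allN_gen` needs `h ≥ 56`, `Λ₀ ≤ 0.9212h`): `x/112` even Goldbach numbers above `e^51.5`
  (`goldbach_even_count_ge_112`), `σ(B) ≥ 1/56` and the best unconditional constant of the series
  **`schnirelmann_goldbach_le_113`**: every `N ≥ 2` is a sum of at most `113` primes (conditional column `105`:
  `x/104` above `e^51.5`, RS glue `half_count_ge_allN_gen_RS` with `h ≥ 52`, `σ(B) ≥ 1/52`).
* §15 the shifted embedding: `p ↦ (p+3)/2` (`2m = p + 3`; `2 ↦ 2`) is injective on the primes `p ≤ 2y − 3` with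
  values in `(0, y] ∩ B`, so `B(y) ≥ π(2y − 3) + 1` (`primeCounting_shift_le_half_count`) — twice the density used by
  §11–§14; the all-`y` glue then needs only `h ≥ 28` and `Λ₀ ≤ 1.8424·h` (`half_count_ge_allN_shift`; under (3.3)
  `Λ₀ ≤ 2h`, `half_count_ge_allN_shift_RS`) and the constant becomes COUNT-limited; §14's Hölder count with the
  threshold gap made generic (`goldbach_even_count_ge_holder_gap`: `2Λs ≤ Λ₀ + 36.5` in place of `Λs ≤ 44`) run at
  `e^53` (sieve, `A = 16.5`) and `e^70` (count, `70 ≤ 1.8424·38`) gives `x/76` even Goldbach numbers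
  (`goldbach_even_count_ge_76`), `σ(B) ≥ 1/38` and the file's best unconditional constant
  **`schnirelmann_goldbach_le_77`**: every `N ≥ 2` is a sum of at most `77` primes (conditional column `65`:
  `e^50`, `A = 16.75`, `e^64 ≤ e^{2·32}`, `x/64`, `σ(B) ≥ 1/32`).

Table of the series (K unconditional / under Rosser–Schoenfeld (3.3)): §9 4329/3121 → §10 1581/1141 → §11 791/571 →
§12 501/379 → §13 379/289 → §14 113/105 → §15 77/65.  Print calibration (NOT formalised, not used): Klimov–Pil'tjaĭ–Šeptickaja
1972 (`115`), Vaughan 1977 (`27`), Riesel–Vaughan 1983 (`19`), Ramaré 1995 (even `n`: `≤ 6` primes), Helfgott 2013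
(`K ≤ 4`) — the constants here are those of the ELEMENTARY method with kernel-checked inputs, not a record in print.
-/

namespace Literature.NumberTheory.Sieve.ShnirelmanGoldbachExplicit

open Finset Real
open scoped Classical Pointwise
open Literature.NumberTheory.Sieve Literature.Combinatorics.Additive
open Literature.NumberTheory.Sieve.GoldbachLinnik (oddSingularFactor oddSingularFactor_nonneg)
open Literature.NumberTheory.Sieve.RomanoffExplicit (PrimeCountingLowerMul primeCountingLowerMul_09212)

/-! ### Private copies (verbatim) of the helpers of §1–§12 used below -/

/-- `f(n) ≥ 1`. [folklore] -/
private theorem one_le_oddSingularFactor' (n : ℕ) : 1 ≤ oddSingularFactor n := by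
  unfold oddSingularFactor
  have h : ∏ _p ∈ n.primeFactors.filter (2 < ·), (1 : ℝ)
      ≤ ∏ p ∈ n.primeFactors.filter (2 < ·), (((p : ℝ) - 1) / ((p : ℝ) - 2)) := by
    refine Finset.prod_le_prod (fun _ _ => zero_le_one) fun p hp => ?_
    rw [Finset.mem_filter] at hp
    have hp3 : (3 : ℝ) ≤ p := by exact_mod_cast hp.2
    rw [le_div_iff₀ (by linarith)]
    linarith
  simpa using h

/-- `t/log²t` is increasing on `[e², ∞)`. [folklore] -/
private theorem div_log_sq_mono {a b : ℝ} (ha : Real.exp 2 ≤ a) (hab : a ≤ b) :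
    a / Real.log a ^ 2 ≤ b / Real.log b ^ 2 := by
  have ha0 : 0 < a := lt_of_lt_of_le (Real.exp_pos 2) ha
  have hb0 : 0 < b := lt_of_lt_of_le ha0 hab
  have hu2 : 2 ≤ Real.log a := by
    have := Real.log_le_log (Real.exp_pos 2) ha
    rwa [Real.log_exp] at this
  have huv : Real.log a ≤ Real.log b := Real.log_le_log ha0 hab
  have hexp : b = a * Real.exp (Real.log b - Real.log a) := by
    rw [Real.exp_sub, Real.exp_log hb0, Real.exp_log ha0]
    field_simp
  set u := Real.log a with hu_def
  set v := Real.log b with hv_def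
  set d := v - u with hd
  have hd0 : 0 ≤ d := by rw [hd]; linarith
  have hq := Real.quadratic_le_exp_of_nonneg hd0
  have hu0 : (0 : ℝ) < u := by linarith
  have hv0 : (0 : ℝ) < v := by linarith
  rw [div_le_div_iff₀ (pow_pos hu0 2) (pow_pos hv0 2)]
  have hv : v = u + d := by rw [hd]; ring
  rw [hv, hexp]
  have hin : (u + d) ^ 2 ≤ (1 + d + d ^ 2 / 2) * u ^ 2 := by
    nlinarith [mul_nonneg hd0 (by nlinarith : (0 : ℝ) ≤ u ^ 2 - 2 * u),
      mul_nonneg (sq_nonneg d) (by nlinarith : (0 : ℝ) ≤ u ^ 2 / 2 - 1)]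
  calc a * (u + d) ^ 2 ≤ a * ((1 + d + d ^ 2 / 2) * u ^ 2) := mul_le_mul_of_nonneg_left hin ha0.le
    _ ≤ a * (Real.exp d * u ^ 2) :=
        mul_le_mul_of_nonneg_left (mul_le_mul_of_nonneg_right hq (sq_nonneg u)) ha0.le
    _ = a * Real.exp d * u ^ 2 := by ring

/-- `log⁴x ≤ 4096·√x` for `x ≥ 1` (`log x = 8 log x^{1/8} ≤ 8 x^{1/8}`). [folklore] -/
private theorem log_pow_four_le_sqrt {x : ℝ} (hx : 1 ≤ x) : Real.log x ^ 4 ≤ 4096 * Real.sqrt x := by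
  set t := Real.sqrt (Real.sqrt (Real.sqrt x)) with ht
  have hx0 : 0 ≤ x := by linarith
  have ht1 : 1 ≤ t := Real.one_le_sqrt.mpr (Real.one_le_sqrt.mpr (Real.one_le_sqrt.mpr hx))
  have ht0 : 0 < t := by linarith
  have ht2 : t ^ 2 = Real.sqrt (Real.sqrt x) := by rw [ht, Real.sq_sqrt (Real.sqrt_nonneg _)]
  have ht4 : t ^ 4 = Real.sqrt x := by
    rw [show t ^ 4 = (t ^ 2) ^ 2 by ring, ht2, Real.sq_sqrt (Real.sqrt_nonneg _)]
  have ht8 : t ^ 8 = x := by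
    rw [show t ^ 8 = (t ^ 4) ^ 2 by ring, ht4, Real.sq_sqrt hx0]
  have hlog : Real.log x = 8 * Real.log t := by
    rw [← ht8, Real.log_pow]; norm_num
  have hlt : Real.log t ≤ t := by linarith [Real.log_le_sub_one_of_pos ht0]
  have hl0 : 0 ≤ Real.log t := Real.log_nonneg ht1
  rw [hlog, ← ht4, show (8 * Real.log t) ^ 4 = 4096 * Real.log t ^ 4 by ring]
  exact mul_le_mul_of_nonneg_left (pow_le_pow_left₀ hl0 hlt 4) (by norm_num)

/-- `r(N) ≤ N + 1`. [folklore] -/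
private theorem goldbachCount_le_succ (N : ℕ) : SingularSeries.goldbachCount N ≤ N + 1 := by
  unfold SingularSeries.goldbachCount
  exact (card_filter_le _ _).trans (by rw [Finset.Nat.card_antidiagonal])

/-- For odd `N`, `r(N) ≤ 2` (one of `p, q` is even, hence `= 2`). [folklore] -/
private theorem goldbachCount_le_two_of_odd {N : ℕ} (hN : Odd N) : SingularSeries.goldbachCount N ≤ 2 := by
  unfold SingularSeries.goldbachCount
  calc #{pq ∈ antidiagonal N | pq.1.Prime ∧ pq.2.Prime}
      ≤ #({(2, N - 2), (N - 2, 2)} : Finset (ℕ × ℕ)) := by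
        refine card_le_card fun pq hpq => ?_
        rw [mem_filter, Finset.HasAntidiagonal.mem_antidiagonal] at hpq
        obtain ⟨hsum, hp, hq⟩ := hpq
        rw [mem_insert, mem_singleton]
        rcases Nat.even_or_odd pq.1 with h1 | h1
        · have h2 : pq.1 = 2 := (Nat.Prime.even_iff hp).mp h1
          left
          exact Prod.ext h2 (by simp only; omega)
        · have h2 : Even pq.2 := by
            rw [← hsum] at hN
            exact (Nat.odd_add.mp hN).mp h1
          have h3 : pq.2 = 2 := (Nat.Prime.even_iff hq).mp h2
          right
          exact Prod.ext (by simp only; omega) h3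
    _ ≤ 2 := card_le_two

/-- **Odd `N` are negligible in the first moment**: `Σ_{odd N ≤ x} r(N) ≤ 2(x + 1)`. [folklore] -/
private theorem sum_goldbachCount_odd_le (x : ℕ) :
    ∑ N ∈ (range (x + 1)).filter (fun N => ¬Even N), (SingularSeries.goldbachCount N : ℝ) ≤ 2 * ((x : ℝ) + 1) := by
  calc ∑ N ∈ (range (x + 1)).filter (fun N => ¬Even N), (SingularSeries.goldbachCount N : ℝ)
      ≤ ∑ N ∈ (range (x + 1)).filter (fun N => ¬Even N), (2 : ℝ) := sum_le_sum fun N hN => by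
        rw [mem_filter] at hN
        exact_mod_cast goldbachCount_le_two_of_odd (Nat.not_even_iff_odd.mp hN.2)
    _ = #((range (x + 1)).filter (fun N => ¬Even N)) * 2 := by rw [sum_const, nsmul_eq_mul]
    _ ≤ ((x : ℝ) + 1) * 2 := by
        apply mul_le_mul_of_nonneg_right _ (by norm_num)
        have : #((range (x + 1)).filter (fun N => ¬Even N)) ≤ x + 1 :=
          (card_filter_le _ _).trans (by rw [card_range])
        exact_mod_cast this
    _ = 2 * ((x : ℝ) + 1) := by ring

/-- `2^100 ≤ e^100`. [folklore] -/
private theorem two_pow_100_le_exp_100 : (2 : ℝ) ^ 100 ≤ Real.exp 100 := by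
  have he : (2 : ℝ) ≤ Real.exp 1 := by have := Real.exp_one_gt_d9; linarith
  have h := pow_le_pow_left₀ (by norm_num) he 100
  rwa [← Real.exp_nat_mul, show ((100 : ℕ) : ℝ) * 1 = 100 by norm_num] at h

/-- `2(x + 1) ≤ 10⁻⁴·x²/log²x` for `x ≥ e^100` (`log²x ≤ 0.41√x`, `√x ≥ 2^30`). [folklore] -/
private theorem two_mul_succ_le_small {x : ℕ} (hx : Real.exp 100 ≤ (x : ℝ)) :
    2 * ((x : ℝ) + 1) ≤ 0.0001 * ((x : ℝ) ^ 2 / Real.log x ^ 2) := by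
  have hx1 : (1 : ℝ) < x := lt_of_lt_of_le (by have := Real.add_one_le_exp (100 : ℝ); linarith) hx
  have hx0 : (0 : ℝ) < x := by linarith
  set L := Real.log x with hL
  have hL100 : 100 ≤ L := by
    have := Real.log_le_log (Real.exp_pos 100) hx
    rwa [Real.log_exp] at this
  have hLpos : 0 < L ^ 2 := by positivity
  have hL4 : L ^ 4 ≤ 4096 * Real.sqrt x := log_pow_four_le_sqrt hx1.le
  have hLsq : (10000 : ℝ) ≤ L ^ 2 := by nlinarith
  have hL2 : L ^ 2 ≤ 0.4096 * Real.sqrt x := by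
    have e : L ^ 4 = L ^ 2 * L ^ 2 := by ring
    nlinarith
  have hbig : (2 : ℝ) ^ 60 ≤ x := le_trans (le_trans (by norm_num) two_pow_100_le_exp_100) hx
  have hsx : (2 : ℝ) ^ 30 ≤ Real.sqrt x :=
    Real.le_sqrt_of_sq_le (by rw [show ((2 : ℝ) ^ 30) ^ 2 = (2 : ℝ) ^ 60 by norm_num]; exact hbig)
  have hxx : Real.sqrt x * Real.sqrt x = x := Real.mul_self_sqrt hx0.le
  have key : 2 * ((x : ℝ) + 1) * L ^ 2 ≤ 0.0001 * (x : ℝ) ^ 2 := by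
    have h1 : 2 * ((x : ℝ) + 1) * L ^ 2 ≤ 4 * x * (0.4096 * Real.sqrt x) := by
      have : 2 * ((x : ℝ) + 1) ≤ 4 * x := by linarith
      exact mul_le_mul this hL2 (by positivity) (by positivity)
    have h2 : (1 : ℝ) ≤ Real.sqrt x / 2 ^ 30 := by
      rw [le_div_iff₀ (by positivity)]; linarith
    calc 2 * ((x : ℝ) + 1) * L ^ 2 ≤ 4 * x * (0.4096 * Real.sqrt x) := h1
      _ ≤ 4 * x * (0.4096 * Real.sqrt x) * (Real.sqrt x / 2 ^ 30) :=
          le_mul_of_one_le_right (by positivity) h2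
      _ = (1.6384 / 2 ^ 30) * (x * (Real.sqrt x * Real.sqrt x)) := by ring
      _ = (1.6384 / 2 ^ 30) * (x : ℝ) ^ 2 := by rw [hxx]; ring
      _ ≤ 0.0001 * (x : ℝ) ^ 2 := mul_le_mul_of_nonneg_right (by norm_num) (by positivity)
  calc 2 * ((x : ℝ) + 1) = 2 * ((x : ℝ) + 1) * L ^ 2 / L ^ 2 := by field_simp
    _ ≤ 0.0001 * (x : ℝ) ^ 2 / L ^ 2 := div_le_div_of_nonneg_right key hLpos.le
    _ = _ := by ring

/-- `σ(S) ≥ 1/K` from `S(N) ≥ N/K` (`N ≥ 1`), for any set `S`. [folklore] -/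
private theorem schnirelmannDensity_ge_of_count' {S : Set ℕ} [DecidablePred (· ∈ S)] {K : ℕ}
    (h : ∀ N : ℕ, 1 ≤ N → (N : ℝ) / K ≤ #{a ∈ Ioc 0 N | a ∈ S}) :
    (1 : ℝ) / K ≤ schnirelmannDensity S := by
  rw [le_schnirelmannDensity_iff]
  intro n hn
  have hn' : (0 : ℝ) < n := by exact_mod_cast hn
  rw [le_div_iff₀ hn']
  have := h n hn
  calc (1 : ℝ) / K * n = (n : ℝ) / K := by ring
    _ ≤ _ := by convert this using 2

/-- `Σ_{p ∈ T} 1/p² ≤ 1/198` for any finite set `T` of odd integers `≥ 101`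
(`1/p² ≤ ½(1/(p−2) − 1/p)`, telescoping over the odd numbers). [folklore] -/
private theorem sum_inv_sq_le_of_odd (T : Finset ℕ) (hT : ∀ p ∈ T, Odd p ∧ 101 ≤ p) :
    ∑ p ∈ T, 1 / (p : ℝ) ^ 2 ≤ 1 / 198 := by
  have htel : ∀ M : ℕ, 49 ≤ M →
      ∑ m ∈ Icc 50 M, (1 / (2 * (m : ℝ) - 1) - 1 / (2 * (m : ℝ) + 1)) = 1 / 99 - 1 / (2 * (M : ℝ) + 1) := by
    intro M hM
    induction M with
    | zero => omega
    | succ M ih =>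
        rcases Nat.lt_or_ge M 49 with h | h
        · have hM' : M = 48 := by omega
          subst hM'
          rw [Finset.Icc_eq_empty (by norm_num), sum_empty]
          norm_num
        · rw [sum_Icc_succ_top (by omega), ih h]
          push_cast
          ring
  by_cases hTe : T = ∅
  · rw [hTe, sum_empty]; norm_num
  obtain ⟨p₀, hp₀⟩ := Finset.nonempty_iff_ne_empty.mpr hTe
  obtain ⟨M, hM⟩ : ∃ M : ℕ, T.sup (fun p => (p - 1) / 2) = M := ⟨_, rfl⟩
  have hM49 : 49 ≤ M := by
    have h1 := Finset.le_sup (f := fun p => (p - 1) / 2) hp₀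
    simp only [hM] at h1
    have h2 := (hT p₀ hp₀).2
    omega
  have hsub : T ⊆ (Icc 50 M).image (fun m => 2 * m + 1) := by
    intro p hp
    obtain ⟨⟨k, hk⟩, hp101⟩ := hT p hp
    rw [mem_image]
    refine ⟨k, ?_, hk.symm⟩
    rw [mem_Icc]
    have h1 := Finset.le_sup (f := fun p => (p - 1) / 2) hp
    simp only [hM] at h1
    constructor <;> omega
  have hterm : ∀ p ∈ T, 1 / (p : ℝ) ^ 2 ≤ (1 / 2 : ℝ) * (1 / ((p : ℝ) - 2) - 1 / p) := by
    intro p hp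
    have hp101 : (101 : ℝ) ≤ p := by exact_mod_cast (hT p hp).2
    have hp2 : (p : ℝ) - 2 ≠ 0 := by
      have : (0 : ℝ) < (p : ℝ) - 2 := by linarith
      exact ne_of_gt this
    have hp0 : (p : ℝ) ≠ 0 := by
      have : (0 : ℝ) < (p : ℝ) := by linarith
      exact ne_of_gt this
    have heq : (1 / 2 : ℝ) * (1 / ((p : ℝ) - 2) - 1 / p) = 1 / (((p : ℝ) - 2) * p) := by
      field_simp; ring
    rw [heq]
    exact one_div_le_one_div_of_le (by nlinarith) (by nlinarith)
  have hnonneg : ∀ q : ℕ, q ∈ (Icc 50 M).image (fun m => 2 * m + 1) →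
      0 ≤ (1 / 2 : ℝ) * (1 / ((q : ℝ) - 2) - 1 / q) := by
    intro q hq
    rw [mem_image] at hq
    obtain ⟨m, hm, rfl⟩ := hq
    rw [mem_Icc] at hm
    have hm50 : (50 : ℝ) ≤ m := by exact_mod_cast hm.1
    push_cast
    have h1 : 1 / (2 * (m : ℝ) + 1) ≤ 1 / (2 * (m : ℝ) + 1 - 2) :=
      one_div_le_one_div_of_le (by linarith) (by linarith)
    linarith
  calc ∑ p ∈ T, 1 / (p : ℝ) ^ 2 ≤ ∑ p ∈ T, (1 / 2 : ℝ) * (1 / ((p : ℝ) - 2) - 1 / p) := sum_le_sum hterm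
    _ ≤ ∑ q ∈ (Icc 50 M).image (fun m => (2 * m + 1 : ℕ)), (1 / 2 : ℝ) * (1 / ((q : ℝ) - 2) - 1 / q) :=
        sum_le_sum_of_subset_of_nonneg hsub fun q hq _ => hnonneg q hq
    _ = ∑ m ∈ Icc 50 M, (1 / 2 : ℝ) * (1 / (2 * (m : ℝ) - 1) - 1 / (2 * (m : ℝ) + 1)) := by
        rw [sum_image (fun a _ b _ h => by omega)]
        refine sum_congr rfl fun m _ => ?_
        push_cast
        ring
    _ = (1 / 2 : ℝ) * (1 / 99 - 1 / (2 * (M : ℝ) + 1)) := by rw [← mul_sum, htel M hM49]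
    _ ≤ 1 / 198 := by
        have : (0 : ℝ) ≤ 1 / (2 * (M : ℝ) + 1) := by positivity
        linarith

/-- The halving map: `#{even N ∈ (0, 2y] : N = p + q} ≤ #{b ∈ (0, y] : b ∈ B}`, `B = {0, 1} ∪ {m : 2m = p + q}`
(`N ↦ N/2`). [folklore] -/
private theorem even_goldbach_card_le_half (y : ℕ) :
    #{N ∈ Ioc 0 (2 * y) | Even N ∧ ∃ p q : ℕ, p.Prime ∧ q.Prime ∧ p + q = N}
      ≤ #{b ∈ Ioc 0 y | b ∈ (({0, 1} : Set ℕ) ∪ {m | ∃ p q : ℕ, p.Prime ∧ q.Prime ∧ p + q = 2 * m})} := by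
  refine card_le_card_of_injOn (fun N => N / 2) ?_ ?_
  · intro N hN
    rw [mem_coe, mem_filter, mem_Ioc] at hN
    obtain ⟨⟨hN0, hNy⟩, ⟨k, hk⟩, p, q, hp, hq, hpq⟩ := hN
    rw [mem_coe, mem_filter, mem_Ioc]
    dsimp only
    exact ⟨⟨by omega, by omega⟩, Or.inr ⟨p, q, hp, hq, by omega⟩⟩
  · intro N hN N' hN' h
    rw [mem_coe, mem_filter] at hN hN'
    obtain ⟨k, hk⟩ := hN.2.1
    obtain ⟨k', hk'⟩ := hN'.2.1
    simp only at h
    omega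

/-- `#{p ≤ y : p prime} = π(y)`. [folklore] -/
private theorem card_filter_prime_range (y : ℕ) : #{p ∈ range (y + 1) | p.Prime} = Nat.primeCounting y := by
  rw [Nat.primeCounting, ← Nat.primesBelow_card_eq_primeCounting']
  rfl

/-! ## §13 Flattening (ROUND-28): Cauchy–Schwarz with staircase weights — `σ(B) ≥ 1/189`, every `N ≥ 2` is a sum
of at most `379` primes unconditionally (RS (3.3): `289`)

MEASURED DEFICIT of §10–§12: in `#G ≥ S₁²/S₂` the first moment grows like `∫t dt/log²` and the second like
`∫t² dt/log⁴`; Cauchy–Schwarz with the constant weight loses the factor `(1/2)²/(1/3) = 3/4` against the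
pointwise ratio, plus `κ = (L/(L−2))⁴` and the `1/3`-vs-`x²·Σf²` bookkeeping.  ONE INPUT VARIED: the weight in
Cauchy–Schwarz.  With the staircase `m(N) = Σ_{j<J} c_j·1_{N ≤ t_j}` (`t_j = x/1.01^j`, plateaux
`M_k = ℓ_{k+1}²/t_k`, `ℓ_i = log x − i·log 1.01`, `J = 909`) one has `r(N)·m(N) ≤ A·f(N)` EXACTLY on every block
`t_{k+1} < N ≤ t_k` (upper side `Σ (r·m)² ≤ (1.329·A² + 0.05)·x`, no `κ`), while the lower side is the swap
`Σ_N r(N)m(N) = Σ_j c_j·S₁^{ev}(⌊t_j⌋) ≥ (c₁ − 10⁻⁴)·(1.9775·x − 20)`.  Hence `#G_ev(x) ≥ x/377.7` above `e^174`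
(`A = 14.14` at `e^164.9`), the glue `174 ≤ 0.9212·189`, `σ(B) ≥ 1/189`, `K = 2·189 + 1 = 379`. -/

/-! #### §13.1 The staircase -/

/-- The levels `t_j = x/1.01^j`. [folklore] -/
noncomputable def stairT (x : ℕ) (j : ℕ) : ℝ := (x : ℝ) / ((101 : ℝ) / 100) ^ j

/-- Their logarithms `ℓ_j = log x − j·log 1.01`. [folklore] -/
noncomputable def stairL (x : ℕ) (j : ℕ) : ℝ := Real.log (x : ℝ) - (j : ℝ) * Real.log ((101 : ℝ) / 100)

/-- The plateaux `M_k = ℓ_{k+1}²/t_k`. [folklore] -/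
noncomputable def stairM (x : ℕ) (k : ℕ) : ℝ := stairL x (k + 1) ^ 2 / stairT x k

/-- `Mf 0 = 0`, `Mf (k+1) = M_k`. [folklore] -/
noncomputable def stairMf (x : ℕ) : ℕ → ℝ
  | 0 => 0
  | k + 1 => stairM x k

/-- The increments `c_j = Mf(j+1) − Mf(j)` (`c_0 = M_0`, `c_{j+1} = M_{j+1} − M_j`). [folklore] -/
noncomputable def stairC (x : ℕ) (j : ℕ) : ℝ := stairMf x (j + 1) - stairMf x j

/-- The staircase weight `m(N) = Σ_{j<J, N ≤ t_j} c_j`. [folklore] -/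
noncomputable def stairW (x J : ℕ) (N : ℕ) : ℝ :=
  ∑ j ∈ (range J).filter (fun j => (N : ℝ) ≤ stairT x j), stairC x j

/-- `0 < log 1.01`. [folklore] -/
private theorem log_101_pos : 0 < Real.log ((101 : ℝ) / 100) := Real.log_pos (by norm_num)

/-- `log 1.01 ≤ 0.01`. [folklore] -/
private theorem log_101_le : Real.log ((101 : ℝ) / 100) ≤ 0.01 := by
  have h := Real.log_le_sub_one_of_pos (show (0 : ℝ) < 101 / 100 by norm_num)
  have e : (101 : ℝ) / 100 - 1 = 0.01 := by norm_num
  rw [e] at h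
  exact h

/-- `1/101 ≤ log 1.01`. [folklore] -/
private theorem log_101_ge : 1 / 101 ≤ Real.log ((101 : ℝ) / 100) := by
  have h := Real.one_sub_inv_le_log_of_pos (show (0 : ℝ) < 101 / 100 by norm_num)
  have e : (1 : ℝ) - ((101 : ℝ) / 100)⁻¹ = 1 / 101 := by norm_num
  rw [e] at h
  exact h

/-- `t_0 = x`. [folklore] -/
private theorem stairT_zero (x : ℕ) : stairT x 0 = x := by simp [stairT]

/-- `t_j = 1.01 · t_{j+1}`. [folklore] -/
private theorem stairT_succ (x j : ℕ) : stairT x j = (101 / 100) * stairT x (j + 1) := by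
  unfold stairT
  rw [pow_succ]
  field_simp

/-- `t_j = x · (100/101)^j`. [folklore] -/
private theorem stairT_eq_mul_pow (x j : ℕ) : stairT x j = (x : ℝ) * ((100 : ℝ) / 101) ^ j := by
  unfold stairT
  rw [div_eq_mul_inv, ← inv_pow]
  norm_num

/-- `t_j ≥ 0`. [folklore] -/
private theorem stairT_nonneg (x j : ℕ) : 0 ≤ stairT x j := by unfold stairT; positivity

/-- `t_j > 0` for `x > 0`. [folklore] -/
private theorem stairT_pos {x : ℕ} (hx : 0 < x) (j : ℕ) : 0 < stairT x j := by
  unfold stairT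
  have : (0 : ℝ) < x := by exact_mod_cast hx
  positivity

/-- `t_j` is non-increasing in `j`. [folklore] -/
private theorem stairT_le_of_le (x : ℕ) {i j : ℕ} (hij : i ≤ j) : stairT x j ≤ stairT x i := by
  unfold stairT
  apply div_le_div_of_nonneg_left (Nat.cast_nonneg x) (by positivity)
  exact pow_le_pow_right₀ (by norm_num) hij

/-- `t_j ≤ x`. [folklore] -/
private theorem stairT_le_self (x j : ℕ) : stairT x j ≤ x := by
  have := stairT_le_of_le x (Nat.zero_le j)
  rwa [stairT_zero] at this

/-- `log t_j = ℓ_j`. [folklore] -/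
private theorem log_stairT {x : ℕ} (hx : 0 < x) (j : ℕ) : Real.log (stairT x j) = stairL x j := by
  unfold stairT stairL
  have hx' : (0 : ℝ) < x := by exact_mod_cast hx
  rw [Real.log_div (ne_of_gt hx') (by positivity), Real.log_pow]

/-- `t_j = x·e^{−j·log 1.01}`. [folklore] -/
private theorem stairT_eq_mul_exp {x : ℕ} (hx : 0 < x) (j : ℕ) :
    stairT x j = (x : ℝ) * Real.exp (-((j : ℝ) * Real.log ((101 : ℝ) / 100))) := by
  have h := log_stairT hx j
  have ht := stairT_pos hx j
  have hx' : (0 : ℝ) < x := by exact_mod_cast hx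
  calc stairT x j = Real.exp (Real.log (stairT x j)) := (Real.exp_log ht).symm
    _ = Real.exp (stairL x j) := by rw [h]
    _ = _ := by
        unfold stairL
        rw [sub_eq_add_neg, Real.exp_add, Real.exp_log hx']

/-- `ℓ_j = ℓ_{j+1} + log 1.01`. [folklore] -/
private theorem stairL_succ (x j : ℕ) : stairL x j = stairL x (j + 1) + Real.log ((101 : ℝ) / 100) := by
  unfold stairL; push_cast; ring

/-- `ℓ_j` is non-increasing in `j`. [folklore] -/
private theorem stairL_le_of_le (x : ℕ) {i j : ℕ} (hij : i ≤ j) : stairL x j ≤ stairL x i := by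
  unfold stairL
  have : (i : ℝ) ≤ j := by exact_mod_cast hij
  nlinarith [log_101_pos]

/-- `ℓ_j ≥ log x − 0.01·j`. [folklore] -/
private theorem stairL_ge (x j : ℕ) : Real.log (x : ℝ) - 0.01 * j ≤ stairL x j := by
  unfold stairL
  have hj : (0 : ℝ) ≤ j := Nat.cast_nonneg j
  nlinarith [log_101_le]

/-- A downward-closed subset of `range J` is an initial segment. [folklore] -/
private theorem filter_range_eq_range_card {p : ℕ → Prop} [DecidablePred p]
    (hp : ∀ i j, i ≤ j → p j → p i) (J : ℕ) :
    (range J).filter p = range #((range J).filter p) := by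
  set S := (range J).filter p with hS
  ext j
  rw [mem_range]
  constructor
  · intro hj
    have hsub : range (j + 1) ⊆ S := by
      intro i hi
      rw [mem_range] at hi
      rw [hS, mem_filter, mem_range] at hj ⊢
      exact ⟨by omega, hp i j (by omega) hj.2⟩
    have := card_le_card hsub
    rw [card_range] at this
    omega
  · intro hj
    by_contra hjS
    have hsub : S ⊆ range j := by
      intro i hi
      rw [mem_range]
      by_contra hij
      rw [not_lt] at hij
      apply hjS
      rw [hS, mem_filter, mem_range] at hi ⊢
      exact ⟨by omega, hp j i hij hi.2⟩
    have := card_le_card hsub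
    rw [card_range] at this
    omega

/-- Telescoping: `Σ_{j<s} c_j = Mf(s)`. [folklore] -/
private theorem sum_range_stairC (x s : ℕ) : ∑ j ∈ range s, stairC x j = stairMf x s := by
  unfold stairC
  rw [Finset.sum_range_sub]
  simp [stairMf]

/-- **The staircase identification**: for `N ≤ x` there is a block index `k < J` with `m(N) = M_k`,
`N ≤ t_k`, and `t_{k+1} < N` unless `k + 1 = J`. [folklore] -/
private theorem stairW_eq {x J N : ℕ} (hJ : 0 < J) (hNx : (N : ℝ) ≤ x) :
    ∃ k, k < J ∧ stairW x J N = stairM x k ∧ (N : ℝ) ≤ stairT x k ∧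
      (k + 1 < J → stairT x (k + 1) < N) := by
  set S := (range J).filter (fun j => (N : ℝ) ≤ stairT x j) with hS
  have hSeq : S = range #S :=
    filter_range_eq_range_card (fun i j hij hj => hj.trans (stairT_le_of_le x hij)) J
  have h0 : 0 ∈ S := by
    rw [hS, mem_filter, mem_range, stairT_zero]
    exact ⟨hJ, hNx⟩
  obtain ⟨k, hk⟩ : ∃ k, #S = k + 1 := ⟨#S - 1, by have := card_pos.mpr ⟨0, h0⟩; omega⟩
  rw [hk] at hSeq
  have hmem : ∀ j, j ∈ S ↔ j < k + 1 := fun j => by rw [hSeq, mem_range]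
  have hkS : k ∈ S := (hmem k).mpr (by omega)
  have hkS' := hkS
  rw [hS, mem_filter, mem_range] at hkS'
  refine ⟨k, hkS'.1, ?_, hkS'.2, fun hk1 => ?_⟩
  · unfold stairW
    rw [← hS, hSeq, sum_range_stairC]
    rfl
  · by_contra hle
    rw [not_lt] at hle
    have h1 : k + 1 ∈ S := by
      rw [hS, mem_filter, mem_range]
      exact ⟨hk1, hle⟩
    have := (hmem _).mp h1
    omega

/-- `c_0 = M_0`. [folklore] -/
private theorem stairC_zero (x : ℕ) : stairC x 0 = stairM x 0 := by simp [stairC, stairMf]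

/-- `c_{j+1} = M_{j+1} − M_j`. [folklore] -/
private theorem stairC_succ (x j : ℕ) : stairC x (j + 1) = stairM x (j + 1) - stairM x j := by
  simp [stairC, stairMf]

/-- `M_j ≤ M_{j+1}` as soon as `ℓ_{j+2} ≥ 3`. [folklore] -/
private theorem stairM_mono {x : ℕ} (hx : 0 < x) {j : ℕ} (hℓ : 3 ≤ stairL x (j + 1 + 1)) :
    stairM x j ≤ stairM x (j + 1) := by
  unfold stairM
  have ht := stairT_pos hx (j + 1)
  rw [stairT_succ x j, div_le_div_iff₀ (by positivity) ht, stairL_succ x (j + 1)]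
  set l := stairL x (j + 1 + 1)
  set lam := Real.log ((101 : ℝ) / 100)
  have hlam := log_101_le
  have hlam0 := log_101_pos
  have h : (l + lam) ^ 2 ≤ 101 / 100 * l ^ 2 := by nlinarith
  nlinarith [mul_le_mul_of_nonneg_left h ht.le]

/-- `c_j ≥ 0` for `j < J` as soon as `ℓ_J ≥ 3`. [folklore] -/
private theorem stairC_nonneg {x : ℕ} (hx : 0 < x) {J j : ℕ} (hj : j < J) (hℓ : 3 ≤ stairL x J) :
    0 ≤ stairC x j := by
  cases j with
  | zero =>
      rw [stairC_zero]
      unfold stairM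
      exact div_nonneg (sq_nonneg _) (stairT_nonneg x 0)
  | succ i =>
      rw [stairC_succ, sub_nonneg]
      exact stairM_mono hx (hℓ.trans (stairL_le_of_le x (by omega)))

/-- **The swap**: `Σ_N r(N)·m(N) = Σ_j c_j·Σ_{N ≤ t_j} r(N)`. [folklore] -/
private theorem sum_mul_stairW (x J : ℕ) (E : Finset ℕ) (r : ℕ → ℝ) :
    ∑ N ∈ E, r N * stairW x J N
      = ∑ j ∈ range J, stairC x j * ∑ N ∈ E.filter (fun N : ℕ => (N : ℝ) ≤ stairT x j), r N := by
  unfold stairW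
  simp_rw [Finset.sum_filter, Finset.mul_sum]
  rw [Finset.sum_comm]
  refine sum_congr rfl fun j _ => sum_congr rfl fun N _ => ?_
  split_ifs <;> ring

/-- `{even N ≤ x : N ≤ t} = {even N ≤ ⌊t⌋}` for `0 ≤ t ≤ x`. [folklore] -/
private theorem filter_even_le_eq {x : ℕ} {t : ℝ} (ht0 : 0 ≤ t) (htx : t ≤ x) :
    ((range (x + 1)).filter Even).filter (fun N : ℕ => (N : ℝ) ≤ t) = (range (⌊t⌋₊ + 1)).filter Even := by
  ext N
  simp only [mem_filter, mem_range]
  constructor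
  · rintro ⟨⟨_, he⟩, hNt⟩
    exact ⟨by have := Nat.le_floor hNt; omega, he⟩
  · rintro ⟨hN, he⟩
    have hN' : N ≤ ⌊t⌋₊ := by omega
    have hNt : (N : ℝ) ≤ t := (Nat.le_floor_iff ht0).mp hN'
    have hNx : (N : ℝ) ≤ x := hNt.trans htx
    have hNx' : N ≤ x := by exact_mod_cast hNx
    exact ⟨⟨by omega, he⟩, hNt⟩

/-- **First moment over even `N`**: `S₁^{ev}(x) ≥ (c₁ − 10⁻⁴)·x²/log²x` from `S₁(x) ≥ c₁·x²/log²x`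
(`x ≥ e^100`; odd `N` contribute `≤ 2(x+1)`). [cite: Nathanson1996, Theorem 7.8 (proof, first moment restricted to even N; explicit form proved here)] -/
theorem sum_even_goldbachCount_ge {c₁ : ℝ} {x : ℕ} (hx : Real.exp 100 ≤ (x : ℝ))
    (hS₁ : c₁ * ((x : ℝ) ^ 2 / Real.log x ^ 2) ≤ ∑ N ∈ range (x + 1), (SingularSeries.goldbachCount N : ℝ)) :
    (c₁ - 0.0001) * ((x : ℝ) ^ 2 / Real.log x ^ 2)
      ≤ ∑ N ∈ (range (x + 1)).filter Even, (SingularSeries.goldbachCount N : ℝ) := by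
  have hsplit := sum_filter_add_sum_filter_not (range (x + 1)) Even
    (fun N => (SingularSeries.goldbachCount N : ℝ))
  have hodd := sum_goldbachCount_odd_le x
  have hsmall := two_mul_succ_le_small hx
  have e : (c₁ - 0.0001) * ((x : ℝ) ^ 2 / Real.log x ^ 2)
      = c₁ * ((x : ℝ) ^ 2 / Real.log x ^ 2) - 0.0001 * ((x : ℝ) ^ 2 / Real.log x ^ 2) := by ring
  rw [e]
  linarith

/-- **One level of the lower side**: `Σ_{even N ≤ t_j} r(N) ≥ (c₁ − 10⁻⁴)·(t_j − 1)²/ℓ_j²` when `t_j ≥ e^100 + 1`. [folklore] -/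
private theorem level_lower {c₁ : ℝ}
    (hS₁ : ∀ y : ℕ, Real.exp 100 ≤ (y : ℝ) →
      c₁ * ((y : ℝ) ^ 2 / Real.log y ^ 2) ≤ ∑ N ∈ range (y + 1), (SingularSeries.goldbachCount N : ℝ))
    (hc₁ : 0.0001 ≤ c₁) {x j : ℕ} (hx : 0 < x) (ht : Real.exp 100 + 1 ≤ stairT x j) :
    (c₁ - 0.0001) * ((stairT x j - 1) ^ 2 / stairL x j ^ 2)
      ≤ ∑ N ∈ ((range (x + 1)).filter Even).filter (fun N : ℕ => (N : ℝ) ≤ stairT x j),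
          (SingularSeries.goldbachCount N : ℝ) := by
  set t := stairT x j with ht_def
  have he100 : (1 : ℝ) < Real.exp 100 := by have := Real.add_one_le_exp (100 : ℝ); linarith
  have ht0 : 0 ≤ t := by linarith
  set y := ⌊t⌋₊ with hy_def
  have hy1 : t - 1 ≤ y := (Nat.sub_one_lt_floor t).le
  have hyt : (y : ℝ) ≤ t := Nat.floor_le ht0
  have hy : Real.exp 100 ≤ (y : ℝ) := by linarith
  have hy0 : (1 : ℝ) < y := by linarith
  rw [filter_even_le_eq ht0 (stairT_le_self x j)]
  have h := sum_even_goldbachCount_ge hy (hS₁ y hy)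
  refine le_trans ?_ h
  apply mul_le_mul_of_nonneg_left _ (by linarith)
  have hlogy : 0 < Real.log y := Real.log_pos hy0
  have hlogle : Real.log y ≤ stairL x j := by
    rw [← log_stairT hx]
    exact Real.log_le_log (by linarith) hyt
  calc (t - 1) ^ 2 / stairL x j ^ 2 ≤ (y : ℝ) ^ 2 / stairL x j ^ 2 :=
        div_le_div_of_nonneg_right (pow_le_pow_left₀ (by linarith) hy1 2) (by positivity)
    _ ≤ (y : ℝ) ^ 2 / Real.log y ^ 2 :=
        div_le_div_of_nonneg_left (by positivity) (by positivity) (pow_le_pow_left₀ hlogy.le hlogle 2)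

/-- **The level-`0` term**: `c_0·(x−1)²/ℓ_0² ≥ (1 − 0.01/Λ₀)²·(x − 2)` for `log x ≥ Λ₀ ≥ 1`. [folklore] -/
private theorem stair_term_zero_ge {x : ℕ} (hx : 0 < x) {Λ₀ : ℝ} (hΛ₀ : 1 ≤ Λ₀) (hL : Λ₀ ≤ Real.log (x : ℝ)) :
    (1 - 0.01 / Λ₀) ^ 2 * ((x : ℝ) - 2)
      ≤ stairC x 0 * ((stairT x 0 - 1) ^ 2 / stairL x 0 ^ 2) := by
  rw [stairC_zero, stairT_zero]
  unfold stairM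
  rw [stairT_zero]
  have hx' : (0 : ℝ) < x := by exact_mod_cast hx
  set L := Real.log (x : ℝ) with hL_def
  set lam := Real.log ((101 : ℝ) / 100)
  have hlam := log_101_le
  have hlam0 := log_101_pos
  have hL0 : 0 < L := by linarith
  have hl0 : stairL x 0 = L := by simp [stairL, hL_def]
  have hl1 : stairL x (0 + 1) = L - lam := by simp [stairL, hL_def, lam]
  rw [hl0, hl1]
  -- `(L - lam)^2/x * ((x-1)^2/L^2) = ((L-lam)/L)^2 * ((x-1)^2/x) ≥ (1 - 0.01/Λ₀)^2 * (x - 2)`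
  have h1 : 1 - 0.01 / Λ₀ ≤ (L - lam) / L := by
    rw [le_div_iff₀ hL0]
    have : lam ≤ 0.01 / Λ₀ * L := by
      have h2 : 0.01 / Λ₀ * Λ₀ = 0.01 := by field_simp
      nlinarith [div_nonneg (by norm_num : (0:ℝ) ≤ 0.01) (by linarith : (0:ℝ) ≤ Λ₀)]
    nlinarith
  have h0 : 0 ≤ 1 - 0.01 / Λ₀ := by
    have : 0.01 / Λ₀ ≤ 0.01 / 1 := div_le_div_of_nonneg_left (by norm_num) (by norm_num) hΛ₀
    linarith
  have h2 : (1 - 0.01 / Λ₀) ^ 2 ≤ ((L - lam) / L) ^ 2 := pow_le_pow_left₀ h0 h1 2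
  have h3 : (x : ℝ) - 2 ≤ ((x : ℝ) - 1) ^ 2 / x := by
    rw [le_div_iff₀ hx']
    nlinarith
  have e : (L - lam) ^ 2 / (x : ℝ) * (((x : ℝ) - 1) ^ 2 / L ^ 2) = ((L - lam) / L) ^ 2 * (((x : ℝ) - 1) ^ 2 / x) := by
    rw [div_pow]
    field_simp
  rw [e]
  by_cases hx2 : (x : ℝ) - 2 ≤ 0
  · have : 0 ≤ ((L - lam) / L) ^ 2 * (((x : ℝ) - 1) ^ 2 / x) := by positivity
    nlinarith [sq_nonneg (1 - 0.01 / Λ₀)]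
  · rw [not_le] at hx2
    exact mul_le_mul h2 h3 hx2.le (by positivity)

/-- **The level-`(k+1)` terms**: `c_{k+1}·(t_{k+1} − 1)²/ℓ_{k+1}² ≥ ((1 − 0.01/ℓ*)² − 100/101)·(t_{k+1} − 2)`
whenever `3 ≤ ℓ* ≤ ℓ_{k+1}` and `t_{k+1} ≥ 2`. [folklore] -/
private theorem stair_term_succ_ge {x : ℕ} {ls : ℝ} (hls : 3 ≤ ls) {k : ℕ}
    (hℓ : ls ≤ stairL x (k + 1)) (ht2 : 2 ≤ stairT x (k + 1)) :
    ((1 - 0.01 / ls) ^ 2 - 100 / 101) * (stairT x (k + 1) - 2)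
      ≤ stairC x (k + 1) * ((stairT x (k + 1) - 1) ^ 2 / stairL x (k + 1) ^ 2) := by
  rw [stairC_succ]
  unfold stairM
  rw [stairT_succ x k]
  set t := stairT x (k + 1) with ht_def
  set l1 := stairL x (k + 1) with hl1_def
  set l2 := stairL x (k + 1 + 1) with hl2_def
  set lam := Real.log ((101 : ℝ) / 100)
  set β := (1 - 0.01 / ls) ^ 2 with hβ
  have hlam := log_101_le
  have hlam0 := log_101_pos
  have ht0 : 0 < t := by linarith
  have hls0 : 0 < ls := by linarith
  have hl10 : 0 < l1 := by linarith
  have hl12 : l1 = l2 + lam := stairL_succ x (k + 1)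
  -- `(1 - 0.01/ls) * l1 ≤ l2`
  have hq : 0 ≤ 1 - 0.01 / ls := by
    have : 0.01 / ls ≤ 0.01 / 3 := div_le_div_of_nonneg_left (by norm_num) (by norm_num) hls
    linarith
  have hge : (1 - 0.01 / ls) * l1 ≤ l2 := by
    have e1 : (1 - 0.01 / ls) * l1 = l1 - 0.01 * (l1 / ls) := by ring
    have h2 : 1 ≤ l1 / ls := by rw [le_div_iff₀ hls0]; linarith
    rw [e1]
    nlinarith
  have hsq : β * l1 ^ 2 ≤ l2 ^ 2 := by
    have h0 : 0 ≤ (1 - 0.01 / ls) * l1 := mul_nonneg hq hl10.le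
    calc β * l1 ^ 2 = ((1 - 0.01 / ls) * l1) ^ 2 := by rw [hβ]; ring
      _ ≤ l2 ^ 2 := pow_le_pow_left₀ h0 hge 2
  have hδ0 : 0 ≤ β - 100 / 101 := by
    have : 0.01 / ls ≤ 0.01 / 3 := div_le_div_of_nonneg_left (by norm_num) (by norm_num) hls
    rw [hβ]
    nlinarith
  -- the algebra
  have e1 : (l2 ^ 2 / t - l1 ^ 2 / (101 / 100 * t)) * ((t - 1) ^ 2 / l1 ^ 2)
      = (l2 ^ 2 - 100 / 101 * l1 ^ 2) * (t - 1) ^ 2 / (t * l1 ^ 2) := by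
    field_simp
  have h2 : (β * l1 ^ 2 - 100 / 101 * l1 ^ 2) * (t - 1) ^ 2 / (t * l1 ^ 2)
      ≤ (l2 ^ 2 - 100 / 101 * l1 ^ 2) * (t - 1) ^ 2 / (t * l1 ^ 2) := by
    apply div_le_div_of_nonneg_right _ (by positivity)
    exact mul_le_mul_of_nonneg_right (by linarith) (sq_nonneg _)
  have e3 : (β * l1 ^ 2 - 100 / 101 * l1 ^ 2) * (t - 1) ^ 2 / (t * l1 ^ 2) = (β - 100 / 101) * ((t - 1) ^ 2 / t) := by
    field_simp
  have h4 : (β - 100 / 101) * (t - 2) ≤ (β - 100 / 101) * ((t - 1) ^ 2 / t) := by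
    apply mul_le_mul_of_nonneg_left _ hδ0
    rw [le_div_iff₀ ht0]
    nlinarith
  rw [e1]
  linarith [h2, e3, h4]

/-- The geometric sum `Σ_{k<n} (100/101)^{k+1} = 100·(1 − (100/101)^n)`. [folklore] -/
private theorem geom_sum_101 (n : ℕ) :
    ∑ k ∈ range n, ((100 : ℝ) / 101) ^ (k + 1) = 100 * (1 - ((100 : ℝ) / 101) ^ n) := by
  induction n with
  | zero => simp
  | succ n ih => rw [sum_range_succ, ih, pow_succ]; ring

/-- `(100/101)^{808} ≤ 1/2978` (`= e^{−808·log 1.01} ≤ e^{−8}`). [folklore] -/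
private theorem q_pow_808_le : ((100 : ℝ) / 101) ^ 808 ≤ 1 / 2978 := by
  have hq : ((100 : ℝ) / 101) = Real.exp (-Real.log ((101 : ℝ) / 100)) := by
    rw [Real.exp_neg, Real.exp_log (by norm_num)]; norm_num
  rw [hq, ← Real.exp_nat_mul]
  have h8 : ((808 : ℕ) : ℝ) * -Real.log ((101 : ℝ) / 100) ≤ -8 := by
    have := log_101_ge
    push_cast
    nlinarith
  refine (Real.exp_le_exp.mpr h8).trans ?_
  have he : (2.718 : ℝ) ≤ Real.exp 1 := by have := Real.exp_one_gt_d9; linarith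
  have h1 : (2978 : ℝ) ≤ Real.exp 8 := by
    have h2 := pow_le_pow_left₀ (by norm_num) he 8
    rw [← Real.exp_nat_mul] at h2
    norm_num at h2
    exact le_trans (by norm_num) h2
  rw [Real.exp_neg, one_div]
  exact inv_anti₀ (by norm_num) h1

/-- `Λ₀`-dependent lower constant of the flattened first moment. [folklore] -/
noncomputable def gFlat (Λ₀ : ℝ) : ℝ :=
  (1 - 0.01 / Λ₀) ^ 2 + 99.966 * ((1 - 0.01 / (Λ₀ - 9.09)) ^ 2 - 100 / 101)

/-- **The lower side, summed** (`J = 909` levels): `Σ_{j<909} c_j·(t_j − 1)²/ℓ_j² ≥ gFlat(Λ₀)·x − 21`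
for `log x ≥ Λ₀ ≥ 130`. [folklore] -/
private theorem stair_lower_sum_ge {x : ℕ} (hx : 0 < x) {Λ₀ : ℝ} (hΛ₀ : 130 ≤ Λ₀) (hL : Λ₀ ≤ Real.log (x : ℝ))
    (hx2 : (2 : ℝ) ≤ stairT x 909) :
    gFlat Λ₀ * (x : ℝ) - 21 ≤ ∑ j ∈ range 909, stairC x j * ((stairT x j - 1) ^ 2 / stairL x j ^ 2) := by
  rw [sum_range_succ']
  set ls := Λ₀ - 9.09 with hls_def
  have hls3 : 3 ≤ ls := by linarith
  set δ := (1 - 0.01 / ls) ^ 2 - 100 / 101 with hδ_def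
  have hδ0 : 0 ≤ δ := by
    have : 0.01 / ls ≤ 0.01 / 3 := div_le_div_of_nonneg_left (by norm_num) (by norm_num) hls3
    rw [hδ_def]
    nlinarith
  have hδ1 : δ ≤ 0.01 := by
    have h0 : 0 ≤ 0.01 / ls := by positivity
    have : 0.01 / ls ≤ 0.01 / 3 := div_le_div_of_nonneg_left (by norm_num) (by norm_num) hls3
    rw [hδ_def]
    nlinarith
  -- the terms `k+1`, `k < 908`
  have hterm : ∀ k ∈ range 908, δ * (stairT x (k + 1) - 2)
      ≤ stairC x (k + 1) * ((stairT x (k + 1) - 1) ^ 2 / stairL x (k + 1) ^ 2) := by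
    intro k hk
    rw [mem_range] at hk
    apply stair_term_succ_ge hls3
    · have h1 := stairL_le_of_le x (show k + 1 ≤ 909 by omega)
      have h2 := stairL_ge x 909
      have : ls ≤ Real.log (x : ℝ) - 0.01 * ((909 : ℕ) : ℝ) := by push_cast; linarith
      linarith
    · exact hx2.trans (stairT_le_of_le x (by omega))
  have hsum1 : δ * ((x : ℝ) * (100 * (1 - ((100 : ℝ) / 101) ^ 908)) - 2 * 908)
      ≤ ∑ k ∈ range 908, stairC x (k + 1) * ((stairT x (k + 1) - 1) ^ 2 / stairL x (k + 1) ^ 2) := by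
    have h := sum_le_sum hterm
    have e : ∑ k ∈ range 908, δ * (stairT x (k + 1) - 2)
        = δ * ((x : ℝ) * (100 * (1 - ((100 : ℝ) / 101) ^ 908)) - 2 * 908) := by
      rw [← mul_sum, sum_sub_distrib, sum_const, card_range, ← geom_sum_101, mul_sum]
      simp only [stairT_eq_mul_pow, nsmul_eq_mul]
      push_cast
      ring
    rw [← e]
    exact h
  have hterm0 := stair_term_zero_ge hx (by linarith : (1 : ℝ) ≤ Λ₀) hL
  -- numerics: `(100/101)^908 ≤ (100/101)^808 ≤ 1/2978`
  have hq908 : ((100 : ℝ) / 101) ^ 908 ≤ 1 / 2978 :=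
    (pow_le_pow_of_le_one (by norm_num) (by norm_num) (by norm_num : 808 ≤ 908)).trans q_pow_808_le
  have hx' : (0 : ℝ) < x := by exact_mod_cast hx
  -- keep the large power opaque for `linarith`
  generalize hQ : ((100 : ℝ) / 101) ^ 908 = Q at hq908 hsum1
  clear hQ
  have hmain : gFlat Λ₀ * (x : ℝ) - 21
      ≤ (1 - 0.01 / Λ₀) ^ 2 * ((x : ℝ) - 2)
        + δ * ((x : ℝ) * (100 * (1 - Q)) - 2 * 908) := by
    have hS : 99.966 ≤ 100 * (1 - Q) := by linarith [hq908]
    have h1 : 99.966 * (x : ℝ) ≤ (x : ℝ) * (100 * (1 - Q)) := by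
      nlinarith [mul_le_mul_of_nonneg_left hS hx'.le]
    have h2 : (1 - 0.01 / Λ₀) ^ 2 ≤ 1 := by
      have h0 : 0 ≤ 0.01 / Λ₀ := by positivity
      have : 0.01 / Λ₀ ≤ 0.01 / 130 := div_le_div_of_nonneg_left (by norm_num) (by norm_num) hΛ₀
      nlinarith
    have hA : (1 - 0.01 / Λ₀) ^ 2 * (x : ℝ) - 2 ≤ (1 - 0.01 / Λ₀) ^ 2 * ((x : ℝ) - 2) := by
      nlinarith [sq_nonneg (1 - 0.01 / Λ₀)]
    have hB : 99.966 * δ * (x : ℝ) - 19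
        ≤ δ * ((x : ℝ) * (100 * (1 - Q)) - 2 * 908) := by
      have h3 := mul_le_mul_of_nonneg_left h1 hδ0
      nlinarith [hδ1]
    have e : gFlat Λ₀ * (x : ℝ) = (1 - 0.01 / Λ₀) ^ 2 * (x : ℝ) + 99.966 * δ * (x : ℝ) := by
      unfold gFlat
      rw [← hls_def, ← hδ_def]
      ring
    linarith [hA, hB, e]
  linarith [hmain, hterm0, hsum1]

/-! #### §13.2 The upper side: `r(N)·m(N) ≤ A·f(N)` blockwise -/

/-- The staircase weight is non-negative. [folklore] -/
private theorem stairW_nonneg {x : ℕ} (hx : 0 < x) {J : ℕ} (hℓ : 3 ≤ stairL x J) (N : ℕ) : 0 ≤ stairW x J N := by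
  unfold stairW
  refine sum_nonneg fun j hj => ?_
  rw [mem_filter, mem_range] at hj
  exact stairC_nonneg hx hj.1 hℓ

/-- **Main blocks**: for even `N` with `t_{909} < N ≤ x`, `r(N)·m(N) ≤ A·f(N)` (block `t_{k+1} < N ≤ t_k`:
`m(N) = ℓ_{k+1}²/t_k ≤ log²N/N`). [folklore] -/
private theorem stair_rm_le_main {x : ℕ} (hx : 0 < x) {Λ A : ℝ} (hΛ0 : 0 < Λ) (hA : 0 ≤ A)
    (hpt : ∀ N : ℕ, Real.exp Λ ≤ (N : ℝ) → Even N →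
      (SingularSeries.goldbachCount N : ℝ) ≤ A * oddSingularFactor N * (N : ℝ) / Real.log (N : ℝ) ^ 2)
    (hbot : Real.exp Λ ≤ stairT x 909) {N : ℕ} (heven : Even N) (hNx : (N : ℝ) ≤ x)
    (hNt : stairT x 909 < N) :
    (SingularSeries.goldbachCount N : ℝ) * stairW x 909 N ≤ A * oddSingularFactor N := by
  obtain ⟨k, hk, hW, hNk, hnext⟩ := stairW_eq (x := x) (J := 909) (N := N) (by norm_num) hNx
  have htk1 : stairT x (k + 1) < N := by
    by_cases h : k + 1 < 909
    · exact hnext h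
    · have : k + 1 = 909 := by omega
      rw [this]; exact hNt
  have hNΛ : Real.exp Λ ≤ (N : ℝ) := hbot.trans hNt.le
  have hN1 : (1 : ℝ) < N := lt_of_lt_of_le (by have := Real.add_one_le_exp Λ; linarith) hNΛ
  have hlogN : 0 < Real.log (N : ℝ) := Real.log_pos hN1
  have hr := hpt N hNΛ heven
  have hf := oddSingularFactor_nonneg N
  have hΛℓ : Λ ≤ stairL x 909 := by
    rw [← log_stairT hx]
    have := Real.log_le_log (Real.exp_pos Λ) hbot
    rwa [Real.log_exp] at this
  have hl0 : 0 ≤ stairL x (k + 1) := (hΛ0.le.trans hΛℓ).trans (stairL_le_of_le x (by omega))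
  have hl : stairL x (k + 1) ≤ Real.log (N : ℝ) := by
    rw [← log_stairT hx]
    exact Real.log_le_log (stairT_pos hx _) htk1.le
  have h1 : stairL x (k + 1) ^ 2 ≤ Real.log (N : ℝ) ^ 2 := pow_le_pow_left₀ hl0 hl 2
  have htk : 0 < stairT x k := stairT_pos hx k
  have hN0 : (0 : ℝ) < N := by linarith
  rw [hW]
  unfold stairM
  calc (SingularSeries.goldbachCount N : ℝ) * (stairL x (k + 1) ^ 2 / stairT x k)
      ≤ A * oddSingularFactor N * (N : ℝ) / Real.log (N : ℝ) ^ 2 * (stairL x (k + 1) ^ 2 / stairT x k) :=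
        mul_le_mul_of_nonneg_right hr (div_nonneg (sq_nonneg _) htk.le)
    _ = A * oddSingularFactor N * (((N : ℝ) / stairT x k) * (stairL x (k + 1) ^ 2 / Real.log (N : ℝ) ^ 2)) := by
        field_simp
    _ ≤ A * oddSingularFactor N * 1 := by
        apply mul_le_mul_of_nonneg_left _ (mul_nonneg hA hf)
        exact mul_le_one₀ ((div_le_one htk).mpr hNk) (div_nonneg (sq_nonneg _) (sq_nonneg _))
          ((div_le_one (pow_pos hlogN 2)).mpr h1)
    _ = A * oddSingularFactor N := mul_one _

/-- **The bottom segment**: for even `0 < N ≤ t_{909}`, `r(N)·m(N) ≤ 17.1·f(N)` (`m(N) = ℓ_{909}²/t_{908}`; the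
tree's `17.1` above `e^47`, `r ≤ N + 1` and `(e^47 + 1)·log²x ≤ t_{908}` below). [folklore] -/
private theorem stair_rm_le_bottom {x : ℕ} (hx : 0 < x) (hbot : Real.exp 47 ≤ stairT x 909)
    (hsmall : (Real.exp 47 + 1) * Real.log (x : ℝ) ^ 2 ≤ stairT x 908)
    {N : ℕ} (heven : Even N) (hN0 : 0 < N) (hNt : (N : ℝ) ≤ stairT x 909) :
    (SingularSeries.goldbachCount N : ℝ) * stairW x 909 N ≤ 17.1 * oddSingularFactor N := by
  have hNx : (N : ℝ) ≤ x := hNt.trans (stairT_le_self x 909)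
  obtain ⟨k, hk, hW, hNk, hnext⟩ := stairW_eq (x := x) (J := 909) (N := N) (by norm_num) hNx
  have hk908 : k = 908 := by
    by_contra hne
    have hlt : k + 1 < 909 := by omega
    have h1 := hnext hlt
    have h2 := stairT_le_of_le x (show k + 1 ≤ 909 by omega)
    linarith
  subst hk908
  rw [hW]
  unfold stairM
  have hf1 := one_le_oddSingularFactor' N
  have ht908 := stairT_pos hx 908
  have ht909 := stairT_pos hx 909
  have hℓ : Real.log (stairT x 909) = stairL x (908 + 1) := log_stairT hx 909
  have hℓ47 : 47 ≤ stairL x (908 + 1) := by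
    rw [← hℓ]
    have := Real.log_le_log (Real.exp_pos 47) hbot
    rwa [Real.log_exp] at this
  have hℓ0 : 0 < stairL x (908 + 1) := by linarith
  by_cases h47 : Real.exp 47 ≤ (N : ℝ)
  · have hr := TwoResidueSelbergExplicit.goldbachCount_le_kappa h47 heven
    have he2 : Real.exp 2 ≤ (N : ℝ) := le_trans (Real.exp_le_exp.mpr (by norm_num)) h47
    have hmono := div_log_sq_mono he2 hNt
    rw [hℓ] at hmono
    have hN0' : (0 : ℝ) < N := by exact_mod_cast hN0
    have hlogN : 0 < Real.log (N : ℝ) := by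
      have h1 : (1 : ℝ) < Real.exp 2 := by have := Real.add_one_le_exp (2 : ℝ); linarith
      exact Real.log_pos (lt_of_lt_of_le h1 he2)
    have hf := oddSingularFactor_nonneg N
    calc (SingularSeries.goldbachCount N : ℝ) * (stairL x (908 + 1) ^ 2 / stairT x 908)
        ≤ 17.1 * oddSingularFactor N * (N : ℝ) / Real.log (N : ℝ) ^ 2 * (stairL x (908 + 1) ^ 2 / stairT x 908) :=
          mul_le_mul_of_nonneg_right hr (div_nonneg (sq_nonneg _) ht908.le)
      _ = 17.1 * oddSingularFactor N * ((N : ℝ) / Real.log (N : ℝ) ^ 2) * (stairL x (908 + 1) ^ 2 / stairT x 908) := by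
          ring
      _ ≤ 17.1 * oddSingularFactor N * (stairT x 909 / stairL x (908 + 1) ^ 2)
            * (stairL x (908 + 1) ^ 2 / stairT x 908) :=
          mul_le_mul_of_nonneg_right (mul_le_mul_of_nonneg_left hmono (mul_nonneg (by norm_num) hf))
            (div_nonneg (sq_nonneg _) ht908.le)
      _ = 17.1 * oddSingularFactor N * (stairT x 909 / stairT x 908) := by
          field_simp
      _ ≤ 17.1 * oddSingularFactor N * 1 := by
          apply mul_le_mul_of_nonneg_left _ (mul_nonneg (by norm_num) hf)
          exact (div_le_one ht908).mpr (stairT_le_of_le x (by norm_num))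
      _ = 17.1 * oddSingularFactor N := mul_one _
  · rw [not_le] at h47
    have hr : (SingularSeries.goldbachCount N : ℝ) ≤ Real.exp 47 + 1 := by
      have h1 : (SingularSeries.goldbachCount N : ℝ) ≤ N + 1 := by exact_mod_cast goldbachCount_le_succ N
      linarith
    have hLℓ : stairL x (908 + 1) ≤ Real.log (x : ℝ) := by
      have := stairL_le_of_le x (Nat.zero_le (908 + 1))
      simpa [stairL] using this
    have hℓL : stairL x (908 + 1) ^ 2 ≤ Real.log (x : ℝ) ^ 2 := pow_le_pow_left₀ hℓ0.le hLℓ 2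
    have hr0 : (0 : ℝ) ≤ SingularSeries.goldbachCount N := Nat.cast_nonneg _
    calc (SingularSeries.goldbachCount N : ℝ) * (stairL x (908 + 1) ^ 2 / stairT x 908)
        ≤ (Real.exp 47 + 1) * (Real.log (x : ℝ) ^ 2 / stairT x 908) :=
          mul_le_mul hr (div_le_div_of_nonneg_right hℓL ht908.le) (div_nonneg (sq_nonneg _) ht908.le)
            (by positivity)
      _ = (Real.exp 47 + 1) * Real.log (x : ℝ) ^ 2 / stairT x 908 := by ring
      _ ≤ 1 := by rw [div_le_one ht908]; exact hsmall
      _ ≤ 17.1 * oddSingularFactor N := by linarith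

/-! #### §13.3 The flattened count -/

set_option maxHeartbeats 1600000 in
/-- **Cauchy–Schwarz with the staircase weight**: for `x ≥ e^{Λ₀}` (`Λ₀ ≥ 130`, `Λ₀ ≥ Λ + 9.09`, `Λ ≥ 101`),
if `r(N) ≤ A·f(N)·N/log²N` for even `N ≥ e^Λ` (`A ≥ 10`) and `S₁(y) ≥ c₁·y²/log²y` for `y ≥ e^100`, then
`#{even N ∈ (0,x] : N = p+q} ≥ ((c₁ − 10⁻⁴)·gFlat(Λ₀))²/(1.329·A² + 0.048)·x − 1`.
[cite: Nathanson1996, Thm 7.8 (weighted variant proved here)] -/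
theorem goldbach_even_count_ge_flat {Λ₀ Λ A c₁ : ℝ} (hΛ₀ : 130 ≤ Λ₀) (hΛ : 101 ≤ Λ) (hΛΛ₀ : Λ + 9.09 ≤ Λ₀)
    (hA : 10 ≤ A)
    (hpt : ∀ N : ℕ, Real.exp Λ ≤ (N : ℝ) → Even N →
      (SingularSeries.goldbachCount N : ℝ) ≤ A * oddSingularFactor N * (N : ℝ) / Real.log (N : ℝ) ^ 2)
    (hc₁ : 0.0001 ≤ c₁) (hc₁1 : c₁ ≤ 1)
    (hS₁ : ∀ y : ℕ, Real.exp 100 ≤ (y : ℝ) →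
      c₁ * ((y : ℝ) ^ 2 / Real.log y ^ 2) ≤ ∑ N ∈ range (y + 1), (SingularSeries.goldbachCount N : ℝ))
    {x : ℕ} (hx : Real.exp Λ₀ ≤ (x : ℝ)) :
    ((c₁ - 0.0001) * gFlat Λ₀) ^ 2 / (1.329 * A ^ 2 + 0.048) * (x : ℝ) - 1
      ≤ #{N ∈ Ioc 0 x | Even N ∧ ∃ p q : ℕ, p.Prime ∧ q.Prime ∧ p + q = N} := by
  -- basics
  have hx130 : Real.exp 130 ≤ (x : ℝ) := (Real.exp_le_exp.mpr hΛ₀).trans hx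
  have hx1 : (1 : ℝ) < x := lt_of_lt_of_le (by have := Real.add_one_le_exp (130 : ℝ); linarith) hx130
  have hx0 : (0 : ℝ) < x := by linarith
  have hxN : 0 < x := by exact_mod_cast hx0
  set L := Real.log (x : ℝ) with hL_def
  have hLΛ₀ : Λ₀ ≤ L := by
    have := Real.log_le_log (Real.exp_pos Λ₀) hx
    rwa [Real.log_exp] at this
  have hL130 : 130 ≤ L := hΛ₀.trans hLΛ₀
  have hlam := log_101_le
  have hlam0 := log_101_pos
  have hlamge := log_101_ge
  -- the bottom level
  have hℓ909 : Λ₀ - 9.09 ≤ stairL x 909 := by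
    have := stairL_ge x 909
    push_cast at this
    linarith
  have hℓ3 : 3 ≤ stairL x 909 := by linarith
  have ht909 : stairT x 909 = Real.exp (stairL x 909) := by
    rw [← log_stairT hxN 909, Real.exp_log (stairT_pos hxN 909)]
  have hbotΛ : Real.exp Λ ≤ stairT x 909 := by rw [ht909]; exact Real.exp_le_exp.mpr (by linarith)
  have hbot47 : Real.exp 47 ≤ stairT x 909 := le_trans (Real.exp_le_exp.mpr (by linarith)) hbotΛ
  have hbot100 : Real.exp 100 + 1 ≤ stairT x 909 := by
    have h1 : Real.exp 101 ≤ stairT x 909 := le_trans (Real.exp_le_exp.mpr (by linarith)) hbotΛ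
    have h2 : Real.exp 101 = Real.exp 1 * Real.exp 100 := by rw [← Real.exp_add]; norm_num
    have h3 : (2 : ℝ) ≤ Real.exp 1 := by have := Real.add_one_le_exp (1 : ℝ); linarith
    have h4 : (1 : ℝ) ≤ Real.exp 100 := by have := Real.add_one_le_exp (100 : ℝ); linarith
    nlinarith
  have hbot2 : (2 : ℝ) ≤ stairT x 909 := by
    have h4 : (1 : ℝ) ≤ Real.exp 100 := by have := Real.add_one_le_exp (100 : ℝ); linarith
    linarith
  -- `t_909 ≤ x·e^{-9} ≤ x/8100` and `t_908 ≥ t_909 ≥ x·e^{-9.09}`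
  have ht909le : stairT x 909 ≤ (x : ℝ) / 8100 := by
    rw [stairT_eq_mul_exp hxN 909]
    have h1 : Real.exp (-(((909 : ℕ) : ℝ) * Real.log ((101 : ℝ) / 100))) ≤ Real.exp (-9) := by
      apply Real.exp_le_exp.mpr
      push_cast
      nlinarith
    have he : (2.7182818283 : ℝ) ≤ Real.exp 1 := Real.exp_one_gt_d9.le
    have h9 : (8100 : ℝ) ≤ Real.exp 9 := by
      have h2 := pow_le_pow_left₀ (by norm_num) he 9
      rw [← Real.exp_nat_mul] at h2
      norm_num at h2
      exact le_trans (by norm_num) h2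
    have h3 : Real.exp (-9) ≤ 1 / 8100 := by
      rw [Real.exp_neg, one_div]
      exact inv_anti₀ (by norm_num) h9
    calc (x : ℝ) * Real.exp (-(((909 : ℕ) : ℝ) * Real.log ((101 : ℝ) / 100))) ≤ (x : ℝ) * (1 / 8100) :=
          mul_le_mul_of_nonneg_left (h1.trans h3) hx0.le
      _ = (x : ℝ) / 8100 := by ring
  have hsmall : (Real.exp 47 + 1) * L ^ 2 ≤ stairT x 908 := by
    have h908 : stairT x 909 ≤ stairT x 908 := stairT_le_of_le x (by norm_num)
    refine le_trans ?_ h908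
    rw [stairT_eq_mul_exp hxN 909]
    have h1 : Real.exp (-10) ≤ Real.exp (-(((909 : ℕ) : ℝ) * Real.log ((101 : ℝ) / 100))) := by
      apply Real.exp_le_exp.mpr
      push_cast
      nlinarith
    have hL4 : L ^ 4 ≤ 4096 * Real.sqrt x := log_pow_four_le_sqrt hx1.le
    have hL2 : 16900 * L ^ 2 ≤ 4096 * Real.sqrt x := by
      have h130 : (130 : ℝ) ^ 2 ≤ L ^ 2 := pow_le_pow_left₀ (by norm_num) hL130 2
      have h4 : L ^ 4 = L ^ 2 * L ^ 2 := by ring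
      nlinarith [mul_le_mul_of_nonneg_right h130 (sq_nonneg L)]
    have hsqrt : Real.exp 65 ≤ Real.sqrt x := by
      apply Real.le_sqrt_of_sq_le
      rw [← Real.exp_nat_mul]
      norm_num
      exact hx130
    have hxx : Real.sqrt x * Real.sqrt x = x := Real.mul_self_sqrt hx0.le
    have he48 : Real.exp 47 + 1 ≤ Real.exp 48 := by
      have h2 : Real.exp 48 = Real.exp 1 * Real.exp 47 := by rw [← Real.exp_add]; norm_num
      have h3 : (2 : ℝ) ≤ Real.exp 1 := by have := Real.add_one_le_exp (1 : ℝ); linarith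
      have h4 : (1 : ℝ) ≤ Real.exp 47 := by have := Real.add_one_le_exp (47 : ℝ); linarith
      nlinarith
    -- `(e^47+1)·L² ≤ e^48 · 4096/16900 · √x ≤ e^{-10} · x`
    have h58 : Real.exp 48 * 4096 ≤ 16900 * Real.exp (-10) * Real.exp 65 := by
      have e1 : Real.exp 65 = Real.exp 48 * Real.exp 17 := by rw [← Real.exp_add]; norm_num
      have e2 : Real.exp (-10) * Real.exp 17 = Real.exp 7 := by rw [← Real.exp_add]; norm_num
      have h7 : (1 : ℝ) ≤ Real.exp 7 := by have := Real.add_one_le_exp (7 : ℝ); linarith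
      have e48 := Real.exp_pos 48
      calc Real.exp 48 * 4096 ≤ Real.exp 48 * (16900 * Real.exp 7) := by nlinarith
        _ = 16900 * Real.exp (-10) * Real.exp 65 := by rw [e1, ← e2]; ring
    have e10 := Real.exp_pos (-10)
    calc (Real.exp 47 + 1) * L ^ 2 ≤ Real.exp 48 * L ^ 2 := mul_le_mul_of_nonneg_right he48 (sq_nonneg L)
      _ ≤ Real.exp 48 * (4096 * Real.sqrt x / 16900) := by
          apply mul_le_mul_of_nonneg_left _ (Real.exp_pos 48).le
          rw [le_div_iff₀ (by norm_num)]
          linarith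
      _ = Real.exp 48 * 4096 / 16900 * Real.sqrt x := by ring
      _ ≤ 16900 * Real.exp (-10) * Real.exp 65 / 16900 * Real.sqrt x := by
          apply mul_le_mul_of_nonneg_right _ (Real.sqrt_nonneg x)
          exact div_le_div_of_nonneg_right h58 (by norm_num)
      _ = Real.exp (-10) * (Real.exp 65 * Real.sqrt x) := by ring
      _ ≤ Real.exp (-10) * (Real.sqrt x * Real.sqrt x) :=
          mul_le_mul_of_nonneg_left (mul_le_mul_of_nonneg_right hsqrt (Real.sqrt_nonneg x)) e10.le
      _ = (x : ℝ) * Real.exp (-10) := by rw [hxx]; ring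
      _ ≤ (x : ℝ) * Real.exp (-(((909 : ℕ) : ℝ) * Real.log ((101 : ℝ) / 100))) :=
          mul_le_mul_of_nonneg_left h1 hx0.le
  -- notation
  set r : ℕ → ℝ := fun N => (SingularSeries.goldbachCount N : ℝ) with hr
  set m : ℕ → ℝ := stairW x 909 with hm
  have hm0 : ∀ N, 0 ≤ m N := fun N => stairW_nonneg hxN hℓ3 N
  set c₁' := c₁ - 0.0001 with hc₁'
  have hc₁'0 : 0 ≤ c₁' := by rw [hc₁']; linarith
  set g := gFlat Λ₀ with hg
  set u := 1.329 * A ^ 2 + 0.048 with hu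
  have hu0 : 0 < u := by rw [hu]; positivity
  set E : Finset ℕ := (range (x + 1)).filter Even with hE
  -- LOWER: `Σ_E r·m ≥ c₁'·(g·x − 21)`
  have hlower : c₁' * (g * x - 21) ≤ ∑ N ∈ E, r N * m N := by
    rw [hm, sum_mul_stairW x 909 E r]
    have hterm : ∀ j ∈ range 909, stairC x j * (c₁' * ((stairT x j - 1) ^ 2 / stairL x j ^ 2))
        ≤ stairC x j * ∑ N ∈ E.filter (fun N : ℕ => (N : ℝ) ≤ stairT x j), r N := by
      intro j hj
      rw [mem_range] at hj
      apply mul_le_mul_of_nonneg_left _ (stairC_nonneg hxN hj hℓ3)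
      rw [hE, hr]
      exact level_lower hS₁ hc₁ hxN (hbot100.trans (stairT_le_of_le x hj.le))
    refine le_trans ?_ (sum_le_sum hterm)
    have e : ∑ j ∈ range 909, stairC x j * (c₁' * ((stairT x j - 1) ^ 2 / stairL x j ^ 2))
        = c₁' * ∑ j ∈ range 909, stairC x j * ((stairT x j - 1) ^ 2 / stairL x j ^ 2) := by
      rw [mul_sum]
      exact sum_congr rfl fun j _ => by ring
    rw [e]
    exact mul_le_mul_of_nonneg_left (stair_lower_sum_ge hxN hΛ₀ hLΛ₀ hbot2) hc₁'0
  -- UPPER: `Σ_{even N ∈ (0,x]} (r·m)² ≤ u·x`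
  set Ep : Finset ℕ := (Ioc 0 x).filter Even with hEp
  have hupper : ∑ N ∈ Ep, (r N * m N) ^ 2 ≤ u * x := by
    set Qp : ℕ → Prop := fun N => stairT x 909 < (N : ℝ) with hQp
    rw [← sum_filter_add_sum_filter_not Ep Qp]
    have hA0 : 0 ≤ A := by linarith
    have h1 : ∑ N ∈ Ep.filter Qp, (r N * m N) ^ 2 ≤ A ^ 2 * (1.329 * x) := by
      have hterm : ∀ N ∈ Ep.filter Qp, (r N * m N) ^ 2 ≤ A ^ 2 * oddSingularFactor N ^ 2 := by
        intro N hN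
        rw [hEp, mem_filter, mem_filter, mem_Ioc] at hN
        obtain ⟨⟨⟨_, hNx⟩, hev⟩, hQN⟩ := hN
        have hNx' : (N : ℝ) ≤ x := by exact_mod_cast hNx
        have h := stair_rm_le_main hxN (by linarith) hA0 hpt hbotΛ hev hNx' hQN
        have h0 : 0 ≤ r N * m N := mul_nonneg (Nat.cast_nonneg _) (hm0 N)
        calc (r N * m N) ^ 2 ≤ (A * oddSingularFactor N) ^ 2 := pow_le_pow_left₀ h0 h 2
          _ = A ^ 2 * oddSingularFactor N ^ 2 := by ring
      calc _ ≤ ∑ N ∈ Ep.filter Qp, A ^ 2 * oddSingularFactor N ^ 2 := sum_le_sum hterm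
        _ ≤ ∑ N ∈ Ep, A ^ 2 * oddSingularFactor N ^ 2 :=
            sum_le_sum_of_subset_of_nonneg (filter_subset _ _) fun N _ _ => by positivity
        _ = A ^ 2 * ∑ N ∈ Ep, oddSingularFactor N ^ 2 := by rw [mul_sum]
        _ ≤ A ^ 2 * (1.329 * x) := mul_le_mul_of_nonneg_left (sum_even_oddSingularFactor_sq_le x) (by positivity)
    have h2 : ∑ N ∈ Ep.filter (fun N => ¬Qp N), (r N * m N) ^ 2 ≤ 292.41 * (1.329 * stairT x 909) := by
      have hterm : ∀ N ∈ Ep.filter (fun N => ¬Qp N), (r N * m N) ^ 2 ≤ 292.41 * oddSingularFactor N ^ 2 := by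
        intro N hN
        rw [hEp, mem_filter, mem_filter, mem_Ioc] at hN
        obtain ⟨⟨⟨hN0, _⟩, hev⟩, hQN⟩ := hN
        have hNt : (N : ℝ) ≤ stairT x 909 := not_lt.mp hQN
        have h := stair_rm_le_bottom hxN hbot47 hsmall hev hN0 hNt
        have h0 : 0 ≤ r N * m N := mul_nonneg (Nat.cast_nonneg _) (hm0 N)
        calc (r N * m N) ^ 2 ≤ (17.1 * oddSingularFactor N) ^ 2 := pow_le_pow_left₀ h0 h 2
          _ = 292.41 * oddSingularFactor N ^ 2 := by ring
      have hsub : Ep.filter (fun N => ¬Qp N) ⊆ (Ioc 0 ⌊stairT x 909⌋₊).filter Even := by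
        intro N hN
        rw [hEp, mem_filter, mem_filter, mem_Ioc] at hN
        obtain ⟨⟨⟨hN0, _⟩, hev⟩, hQN⟩ := hN
        have hNt : (N : ℝ) ≤ stairT x 909 := not_lt.mp hQN
        rw [mem_filter, mem_Ioc]
        exact ⟨⟨hN0, Nat.le_floor hNt⟩, hev⟩
      have ht0 : 0 ≤ stairT x 909 := stairT_nonneg x 909
      calc _ ≤ ∑ N ∈ Ep.filter (fun N => ¬Qp N), 292.41 * oddSingularFactor N ^ 2 := sum_le_sum hterm
        _ ≤ ∑ N ∈ (Ioc 0 ⌊stairT x 909⌋₊).filter Even, 292.41 * oddSingularFactor N ^ 2 :=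
            sum_le_sum_of_subset_of_nonneg hsub fun N _ _ => by positivity
        _ = 292.41 * ∑ N ∈ (Ioc 0 ⌊stairT x 909⌋₊).filter Even, oddSingularFactor N ^ 2 := by rw [mul_sum]
        _ ≤ 292.41 * (1.329 * (⌊stairT x 909⌋₊ : ℝ)) :=
            mul_le_mul_of_nonneg_left (sum_even_oddSingularFactor_sq_le _) (by norm_num)
        _ ≤ 292.41 * (1.329 * stairT x 909) :=
            mul_le_mul_of_nonneg_left (mul_le_mul_of_nonneg_left (Nat.floor_le ht0) (by norm_num)) (by norm_num)
    have h3 : 292.41 * (1.329 * stairT x 909) ≤ 0.048 * x := by nlinarith [ht909le]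
    calc _ ≤ A ^ 2 * (1.329 * x) + 292.41 * (1.329 * stairT x 909) := add_le_add h1 h2
      _ ≤ A ^ 2 * (1.329 * x) + 0.048 * x := by linarith
      _ = u * x := by rw [hu]; ring
  -- Cauchy–Schwarz on `T = {even N ≤ x : r(N) > 0}`
  set T : Finset ℕ := E.filter fun N => 0 < SingularSeries.goldbachCount N with hT
  have hsumT : ∑ N ∈ E, r N * m N = ∑ N ∈ T, (r N * m N) * 1 := by
    have h := Finset.sum_filter_of_ne (s := E) (f := fun N => r N * m N * 1)
      (p := fun N => 0 < SingularSeries.goldbachCount N) (fun N _ hne => by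
        by_contra h0
        apply hne
        simp only [not_lt, Nat.le_zero] at h0
        simp [hr, h0])
    rw [hT, h]
    simp only [mul_one]
  have hCS : (∑ N ∈ T, (r N * m N) * 1) ^ 2 ≤ (∑ N ∈ T, (r N * m N) ^ 2) * ∑ N ∈ T, (1 : ℝ) ^ 2 :=
    sum_mul_sq_le_sq_mul_sq T (fun N => r N * m N) fun _ => 1
  have hT1 : ∑ N ∈ T, (1 : ℝ) ^ 2 = #T := by simp
  have hTA : T ⊆ {N ∈ Ioc 0 x | Even N ∧ ∃ p q : ℕ, p.Prime ∧ q.Prime ∧ p + q = N} := by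
    intro N hN
    rw [hT, hE, mem_filter, mem_filter, mem_range] at hN
    obtain ⟨⟨hNx, he⟩, hpos⟩ := hN
    unfold SingularSeries.goldbachCount at hpos
    obtain ⟨pq, hpq⟩ := card_pos.mp hpos
    rw [mem_filter, Finset.HasAntidiagonal.mem_antidiagonal] at hpq
    have hN2 : 2 ≤ N := by
      have := hpq.2.1.two_le
      omega
    rw [mem_filter, mem_Ioc]
    exact ⟨⟨by omega, by omega⟩, he, pq.1, pq.2, hpq.2.1, hpq.2.2, hpq.1⟩
  have hTEp : T ⊆ Ep := by
    intro N hN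
    have h := hTA hN
    rw [mem_filter] at h
    rw [hEp, mem_filter]
    exact ⟨h.1, h.2.1⟩
  have hTsq : ∑ N ∈ T, (r N * m N) ^ 2 ≤ ∑ N ∈ Ep, (r N * m N) ^ 2 :=
    sum_le_sum_of_subset_of_nonneg hTEp fun N _ _ => sq_nonneg _
  set Ax : ℝ := ((#{N ∈ Ioc 0 x | Even N ∧ ∃ p q : ℕ, p.Prime ∧ q.Prime ∧ p + q = N} : ℕ) : ℝ) with hAx
  have hTcard : (#T : ℝ) ≤ Ax := by rw [hAx]; exact_mod_cast card_le_card hTA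
  have hAx0 : 0 ≤ Ax := by positivity
  have hmain : (∑ N ∈ E, r N * m N) ^ 2 ≤ (u * x) * Ax := by
    rw [hsumT]
    calc (∑ N ∈ T, r N * m N * 1) ^ 2 ≤ (∑ N ∈ T, (r N * m N) ^ 2) * #T := by rw [← hT1]; exact hCS
      _ ≤ (u * x) * Ax :=
          mul_le_mul (hTsq.trans hupper) hTcard (by positivity) (by positivity)
  -- the final algebra
  have hg0 : 0.99 ≤ g := by
    rw [hg]
    unfold gFlat
    have ha : 0.01 / Λ₀ ≤ 0.01 / 130 := div_le_div_of_nonneg_left (by norm_num) (by norm_num) hΛ₀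
    have ha0 : 0 ≤ 0.01 / Λ₀ := by positivity
    have hb : 0.01 / (Λ₀ - 9.09) ≤ 0.01 / 3 :=
      div_le_div_of_nonneg_left (by norm_num) (by norm_num) (by linarith)
    have hb0 : 0 ≤ 0.01 / (Λ₀ - 9.09) := div_nonneg (by norm_num) (by linarith)
    nlinarith
  have hg2 : g ≤ 2 := by
    rw [hg]
    unfold gFlat
    have ha0 : 0 ≤ 0.01 / Λ₀ := by positivity
    have ha : 0.01 / Λ₀ ≤ 0.01 / 130 := div_le_div_of_nonneg_left (by norm_num) (by norm_num) hΛ₀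
    have hb0 : 0 ≤ 0.01 / (Λ₀ - 9.09) := div_nonneg (by norm_num) (by linarith)
    have hb : 0.01 / (Λ₀ - 9.09) ≤ 0.01 / 3 :=
      div_le_div_of_nonneg_left (by norm_num) (by norm_num) (by linarith)
    nlinarith
  have hc₁'1 : c₁' ≤ 1 := by rw [hc₁']; linarith
  have hx21 : (21 : ℝ) ≤ g * x := by
    have : (22 : ℝ) ≤ Real.exp 130 := by have := Real.add_one_le_exp (130 : ℝ); linarith
    nlinarith
  have hl0 : 0 ≤ c₁' * (g * x - 21) := mul_nonneg hc₁'0 (by linarith)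
  have h1 : (c₁' * (g * x - 21)) ^ 2 ≤ (u * x) * Ax :=
    (pow_le_pow_left₀ hl0 hlower 2).trans hmain
  have key : (c₁' * g) ^ 2 * x - 42 * c₁' ^ 2 * g ≤ u * Ax := by
    have e : (c₁' * (g * x - 21)) ^ 2 = x * ((c₁' * g) ^ 2 * x - 42 * c₁' ^ 2 * g) + 441 * c₁' ^ 2 := by ring
    rw [e] at h1
    have h2 : (x : ℝ) * ((c₁' * g) ^ 2 * x - 42 * c₁' ^ 2 * g) ≤ x * (u * Ax) := by nlinarith [sq_nonneg c₁']
    exact le_of_mul_le_mul_left h2 hx0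
  have hsmallterm : 42 * c₁' ^ 2 * g ≤ u := by
    have : c₁' ^ 2 ≤ 1 := by nlinarith
    have hu' : 132.9 ≤ u := by rw [hu]; nlinarith
    nlinarith
  rw [div_mul_eq_mul_div, sub_le_iff_le_add, div_le_iff₀ hu0]
  nlinarith [key, hsmallterm, hAx0]

/-! #### §13.4 Instances, glue, headline -/

/-- Numerics at `Λ = 164.9`: `17L² ≤ 16·14.12·TlowK(L/2 − 1.38632)` for `L ≥ 164.9`. [folklore] -/
private theorem kappa_numeric_1649 {L : ℝ} (hL : 164.9 ≤ L) :
    17 * L ^ 2 ≤ 16 * (14.14 - 0.02) * TwoResidueSelbergExplicit.TlowK (L / 2 - 1.38632) := by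
  unfold TwoResidueSelbergExplicit.TlowK
  nlinarith [hL, mul_self_nonneg (L - 164.9)]

/-- Numerics at `Λ = 122.9`: `17L² ≤ 16·14.46·TlowK(L/2 − 1.38632)` for `L ≥ 122.9`. [folklore] -/
private theorem kappa_numeric_1229 {L : ℝ} (hL : 122.9 ≤ L) :
    17 * L ^ 2 ≤ 16 * (14.48 - 0.02) * TwoResidueSelbergExplicit.TlowK (L / 2 - 1.38632) := by
  unfold TwoResidueSelbergExplicit.TlowK
  nlinarith [hL, mul_self_nonneg (L - 122.9)]

/-- `A = 14.14` above `e^164.9`. [cite: BatemanDiamond2004, §13.4 (13.13)–(13.14)] -/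
theorem goldbachCount_le_1414 {N : ℕ} (hN : Real.exp 164.9 ≤ (N : ℝ)) (heven : Even N) :
    (SingularSeries.goldbachCount N : ℝ) ≤ 14.14 * oddSingularFactor N * (N : ℝ) / Real.log (N : ℝ) ^ 2 :=
  goldbachCount_le_of_numeric (by norm_num) (fun _ hL => kappa_numeric_1649 hL) hN heven

/-- `A = 14.48` above `e^122.9`. [cite: BatemanDiamond2004, §13.4 (13.13)–(13.14)] -/
theorem goldbachCount_le_1448 {N : ℕ} (hN : Real.exp 122.9 ≤ (N : ℝ)) (heven : Even N) :
    (SingularSeries.goldbachCount N : ℝ) ≤ 14.48 * oddSingularFactor N * (N : ℝ) / Real.log (N : ℝ) ^ 2 :=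
  goldbachCount_le_of_numeric (by norm_num) (fun _ hL => kappa_numeric_1229 hL) hN heven

/-- **Unconditional, above `e^174`**: at least `x/378` EVEN Goldbach numbers in `(0, x]`
(`(0.4242·gFlat 174)²/(1.329·14.14² + 0.048) = 1/377.67`). [cite: Nathanson1996, Theorem 7.8 (proof, restricted to even N; explicit form proved here)] -/
theorem goldbach_even_count_ge_378 {x : ℕ} (hx : Real.exp 174 ≤ (x : ℝ)) :
    (x : ℝ) / 378 ≤ #{N ∈ Ioc 0 x | Even N ∧ ∃ p q : ℕ, p.Prime ∧ q.Prime ∧ p + q = N} := by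
  have h := goldbach_even_count_ge_flat (Λ₀ := 174) (Λ := 164.9) (A := 14.14) (c₁ := 0.4243)
    (by norm_num) (by norm_num) (by norm_num) (by norm_num)
    (fun N hN hev => goldbachCount_le_1414 hN hev) (by norm_num) (by norm_num)
    (fun y hy => sum_goldbachCount_ge_04243 hy) hx
  have hc : (1 : ℝ) / 378 + 1 / 500000 ≤ ((0.4243 - 0.0001) * gFlat 174) ^ 2 / (1.329 * 14.14 ^ 2 + 0.048) := by
    unfold gFlat
    norm_num
  have h20 : (500000 : ℝ) ≤ Real.exp 20 := by
    have he : (2.718 : ℝ) ≤ Real.exp 1 := by have := Real.exp_one_gt_d9; linarith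
    have h2 := pow_le_pow_left₀ (by norm_num) he 20
    rw [← Real.exp_nat_mul] at h2
    norm_num at h2
    exact le_trans (by norm_num) h2
  have hx5 : (500000 : ℝ) ≤ x := h20.trans ((Real.exp_le_exp.mpr (by norm_num)).trans hx)
  have hx0 : (0 : ℝ) ≤ x := Nat.cast_nonneg x
  have h2 := mul_le_mul_of_nonneg_right hc hx0
  have e : ((1 : ℝ) / 378 + 1 / 500000) * x = x / 378 + x / 500000 := by ring
  rw [e] at h2
  have h3 : (1 : ℝ) ≤ x / 500000 := by rw [le_div_iff₀ (by norm_num)]; linarith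
  linarith

/-- **Under (3.3), above `e^132`**: at least `x/288` EVEN Goldbach numbers in `(0, x]`
(`(0.4994·gFlat 132)²/(1.329·14.48² + 0.048) = 1/286.97`). [cite: RosserSchoenfeld1962, Theorem 2, eq. (3.3) (as input)] -/
theorem goldbach_even_count_ge_of_RS_288 (hRS : Literature.NumberTheory.LFunctions.RosserSchoenfeld1962_theorem2)
    {x : ℕ} (hx : Real.exp 132 ≤ (x : ℝ)) :
    (x : ℝ) / 288 ≤ #{N ∈ Ioc 0 x | Even N ∧ ∃ p q : ℕ, p.Prime ∧ q.Prime ∧ p + q = N} := by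
  have h := goldbach_even_count_ge_flat (Λ₀ := 132) (Λ := 122.9) (A := 14.48) (c₁ := 0.4995)
    (by norm_num) (by norm_num) (by norm_num) (by norm_num)
    (fun N hN hev => goldbachCount_le_1448 hN hev) (by norm_num) (by norm_num)
    (fun y hy => sum_goldbachCount_ge_of_RS hRS hy) hx
  have hc : (1 : ℝ) / 288 + 1 / 500000 ≤ ((0.4995 - 0.0001) * gFlat 132) ^ 2 / (1.329 * 14.48 ^ 2 + 0.048) := by
    unfold gFlat
    norm_num
  have h20 : (500000 : ℝ) ≤ Real.exp 20 := by
    have he : (2.718 : ℝ) ≤ Real.exp 1 := by have := Real.exp_one_gt_d9; linarith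
    have h2 := pow_le_pow_left₀ (by norm_num) he 20
    rw [← Real.exp_nat_mul] at h2
    norm_num at h2
    exact le_trans (by norm_num) h2
  have hx5 : (500000 : ℝ) ≤ x := h20.trans ((Real.exp_le_exp.mpr (by norm_num)).trans hx)
  have hx0 : (0 : ℝ) ≤ x := Nat.cast_nonneg x
  have h2 := mul_le_mul_of_nonneg_right hc hx0
  have e : ((1 : ℝ) / 288 + 1 / 500000) * x = x / 288 + x / 500000 := by ring
  rw [e] at h2
  have h3 : (1 : ℝ) ≤ x / 500000 := by rw [le_div_iff₀ (by norm_num)]; linarith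
  linarith

/-- **Unconditional count for all `y ≥ 1`**: `B(y) ≥ y/189` (glue `174 ≤ 0.9212·189`). [cite: Nathanson1996, Theorem 7.8 (explicit constant for the halved set proved here)] -/
theorem half_count_ge_allN_189 {y : ℕ} (hy : 1 ≤ y) :
    (y : ℝ) / 189 ≤ #{b ∈ Ioc 0 y | b ∈ (({0, 1} : Set ℕ) ∪ {m | ∃ p q : ℕ, p.Prime ∧ q.Prime ∧ p + q = 2 * m})} := by
  have h := half_count_ge_allN_gen (Λ₀ := 174) (h := 189) (by norm_num) (by norm_num)
    (fun x hx => by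
      have h1 := goldbach_even_count_ge_378 hx
      have e : (x : ℝ) / (2 * ((189 : ℕ) : ℝ)) = (x : ℝ) / 378 := by norm_num
      rw [e]
      exact h1) hy
  exact_mod_cast h

/-- **Under (3.3), all `y ≥ 1`**: `B(y) ≥ y/144` (glue `132 ≤ 0.9212·144`). [cite: RosserSchoenfeld1962, Theorem 2, eq. (3.3) (as input)] -/
theorem half_count_ge_allN_of_RS_144 (hRS : Literature.NumberTheory.LFunctions.RosserSchoenfeld1962_theorem2)
    {y : ℕ} (hy : 1 ≤ y) :
    (y : ℝ) / 144 ≤ #{b ∈ Ioc 0 y | b ∈ (({0, 1} : Set ℕ) ∪ {m | ∃ p q : ℕ, p.Prime ∧ q.Prime ∧ p + q = 2 * m})} := by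
  have h := half_count_ge_allN_gen (Λ₀ := 132) (h := 144) (by norm_num) (by norm_num)
    (fun x hx => by
      have h1 := goldbach_even_count_ge_of_RS_288 hRS hx
      have e : (x : ℝ) / (2 * ((144 : ℕ) : ℝ)) = (x : ℝ) / 288 := by norm_num
      rw [e]
      exact h1) hy
  exact_mod_cast h

/-- **The halved density, `1/189`**: `σ({0, 1} ∪ {m : 2m = p + q}) ≥ 1/189`, unconditionally. [cite: Nathanson1996, Theorem 7.8 (explicit constant for the halved set proved here)] -/
theorem schnirelmannDensity_half_ge_189 :
    (1 : ℝ) / 189 ≤ schnirelmannDensity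
      (({0, 1} : Set ℕ) ∪ {m | ∃ p q : ℕ, p.Prime ∧ q.Prime ∧ p + q = 2 * m}) := by
  have h := schnirelmannDensity_ge_of_count' (K := 189)
    (S := ({0, 1} : Set ℕ) ∪ {m | ∃ p q : ℕ, p.Prime ∧ q.Prime ∧ p + q = 2 * m})
    (fun N hN => by have := half_count_ge_allN_189 hN; exact_mod_cast this)
  exact_mod_cast h

/-- **The halved density under (3.3), `1/144`**. [cite: RosserSchoenfeld1962, Theorem 2, eq. (3.3) (as input)] -/
theorem schnirelmannDensity_half_ge_of_RS_144
    (hRS : Literature.NumberTheory.LFunctions.RosserSchoenfeld1962_theorem2) :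
    (1 : ℝ) / 144 ≤ schnirelmannDensity
      (({0, 1} : Set ℕ) ∪ {m | ∃ p q : ℕ, p.Prime ∧ q.Prime ∧ p + q = 2 * m}) := by
  have h := schnirelmannDensity_ge_of_count' (K := 144)
    (S := ({0, 1} : Set ℕ) ∪ {m | ∃ p q : ℕ, p.Prime ∧ q.Prime ∧ p + q = 2 * m})
    (fun N hN => by have := half_count_ge_allN_of_RS_144 hRS hN; exact_mod_cast this)
  exact_mod_cast h

/-- ★★★★★ **The Shnirel'man–Goldbach theorem, explicit and unconditional — the best constant of this file: every
integer `N ≥ 2` is a sum of at most `379` primes** (Cauchy–Schwarz FLATTENED by the staircase weight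
`m(N) ≈ log²N/N`: `Σ r·m ≥ 0.4242·(1.9775x − 21)`, `Σ (r·m)² ≤ (1.329·14.14² + 0.048)·x`, `A = 14.14` at `e^164.9`,
Chebyshev's `0.9212`, halving, Mann: `189 • B = ℕ`, `2·189 + 1`).  No hypotheses, no named facts.
[cite: Nathanson1996, Thm 7.9 (explicit constant proved here)] -/
theorem schnirelmann_goldbach_le_379 (N : ℕ) (hN : 2 ≤ N) :
    ∃ M : Multiset ℕ, (∀ p ∈ M, p.Prime) ∧ Multiset.card M ≤ 379 ∧ M.sum = N := by
  have hσ : (1 : ℝ) / ((189 : ℕ) : ℝ) ≤ schnirelmannDensity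
      (({0, 1} : Set ℕ) ∪ {m | ∃ p q : ℕ, p.Prime ∧ q.Prime ∧ p + q = 2 * m}) := by
    have := schnirelmannDensity_half_ge_189
    exact_mod_cast this
  exact sum_of_primes_of_half_density_mann (h := 189) (by norm_num) hσ N hN

/-- ★ **Under Rosser–Schoenfeld (3.3): every integer `N ≥ 2` is a sum of at most `289` primes** (`σ(B) ≥ 1/144`).
[cite: RosserSchoenfeld1962, Theorem 2, eq. (3.3) (as input)] -/
theorem schnirelmann_goldbach_of_RS_le_289 (hRS : Literature.NumberTheory.LFunctions.RosserSchoenfeld1962_theorem2)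
    (N : ℕ) (hN : 2 ≤ N) :
    ∃ M : Multiset ℕ, (∀ p ∈ M, p.Prime) ∧ Multiset.card M ≤ 289 ∧ M.sum = N := by
  have hσ : (1 : ℝ) / ((144 : ℕ) : ℝ) ≤ schnirelmannDensity
      (({0, 1} : Set ℕ) ∪ {m | ∃ p q : ℕ, p.Prime ∧ q.Prime ∧ p + q = 2 * m}) := by
    have := schnirelmannDensity_half_ge_of_RS_144 hRS
    exact_mod_cast this
  exact sum_of_primes_of_half_density_mann (h := 144) (by norm_num) hσ N hN

/-! ## §14 ROUND-29 «HÖLDER»: low thresholds, the eighth moment of `f`, Hölder-8 — `K = 113` (RS: `105`)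

The near-miss of §13 is the conversion of the f-MASS `Σ_T f ≥ F·x/A` (T = even Goldbach numbers) into the COUNT
`|T|`: Cauchy–Schwarz `|T| ≥ (Σ_T f)²/Σ f²` loses the factor `(F/A)·(mean f)/1.329 ≈ 1/369`.  Hölder with a high
exponent loses much less, because `f` is bounded on average in every moment: with `Σ_{even N ≤ x} f⁸ ≤ C₈·x`,
`|T| ≥ (Σ_T f)^{8/7}/(C₈x)^{1/7} = x·(F/A)^{8/7}/C₈^{1/7} ≈ x/78` at `F/A ≈ 0.044`.  The count is then limited only
by the all-`y` glue (`h ≥ 56` unconditionally, `h ≥ 52` under Rosser–Schoenfeld), so the thresholds are LOWERED to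
`Λ₀ = 51.5 ≤ 0.9212·56` (count) and `e^44`/`e^41` (sieve / first moment), with a `200`-level staircase and the small
`N < e^44` discarded trivially. -/

/-! #### §14.1 The eighth moment of the singular factor: `Σ_{even N ≤ x} f(N)⁸ ≤ 259.55·x` -/

/-- The local factor `g₈(p) = ((p−1)/(p−2))⁸ − 1`, so that `f(N)⁸ = ∏_{p∣N, p>2}(1 + g₈(p))`. [folklore] -/
noncomputable def g8Factor (p : ℕ) : ℝ := (((p : ℝ) - 1) / ((p : ℝ) - 2)) ^ 8 - 1

/-- `f(N)⁸ = Σ_{T ⊆ {p ∣ N : p > 2}} ∏_{p ∈ T} g₈(p)` (expand `∏ (1 + g₈)`). [folklore] -/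
private theorem oddSingularFactor_pow8_eq (N : ℕ) :
    oddSingularFactor N ^ 8 = ∑ T ∈ (N.primeFactors.filter (2 < ·)).powerset, ∏ p ∈ T, g8Factor p := by
  unfold oddSingularFactor
  rw [← prod_pow, ← prod_one_add]
  exact prod_congr rfl fun p _ => by unfold g8Factor; ring

/-- `g₈(p) ≥ 0` for `p ≥ 3`. [folklore] -/
private theorem g8Factor_nonneg {p : ℕ} (hp : 2 < p) : 0 ≤ g8Factor p := by
  unfold g8Factor
  have hp3 : (3 : ℝ) ≤ p := by exact_mod_cast hp
  have h1 : 1 ≤ ((p : ℝ) - 1) / ((p : ℝ) - 2) := by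
    rw [le_div_iff₀ (by linarith)]; linarith
  have h8 : (1 : ℝ) ≤ (((p : ℝ) - 1) / ((p : ℝ) - 2)) ^ 8 := one_le_pow₀ h1
  linarith

/-- The polynomial inequality behind `g₈(p)/p ≤ 8.76/p²`: `((t+1)⁸ − t⁸)(t+2) ≤ 8.76·t⁸` for `t ≥ 99`. [folklore] -/
private theorem poly8_le {t : ℝ} (ht : 99 ≤ t) : ((t + 1) ^ 8 - t ^ 8) * (t + 2) ≤ 8.76 * t ^ 8 := by
  have ht0 : 0 ≤ t := by linarith
  have h0 : 0 ≤ t - 99 := by linarith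
  have h1 : 99 * t ≤ t ^ 2 := by nlinarith
  have h2 : 99 * t ^ 2 ≤ t ^ 3 := by nlinarith [mul_nonneg (pow_nonneg ht0 2) h0]
  have h3 : 99 * t ^ 3 ≤ t ^ 4 := by nlinarith [mul_nonneg (pow_nonneg ht0 3) h0]
  have h4 : 99 * t ^ 4 ≤ t ^ 5 := by nlinarith [mul_nonneg (pow_nonneg ht0 4) h0]
  have h5 : 99 * t ^ 5 ≤ t ^ 6 := by nlinarith [mul_nonneg (pow_nonneg ht0 5) h0]
  have h6 : 99 * t ^ 6 ≤ t ^ 7 := by nlinarith [mul_nonneg (pow_nonneg ht0 6) h0]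
  have h7 : 99 * t ^ 7 ≤ t ^ 8 := by nlinarith [mul_nonneg (pow_nonneg ht0 7) h0]
  nlinarith [h1, h2, h3, h4, h5, h6, h7, ht0]

/-- For `p ≥ 101`: `g₈(p)/p ≤ 8.76/p²` (`g₈(p) = ((t+1)⁸ − t⁸)/t⁸`, `t = p − 2 ≥ 99`). [folklore] -/
private theorem g8Factor_div_le {p : ℕ} (hp : 101 ≤ p) : g8Factor p / p ≤ 8.76 / (p : ℝ) ^ 2 := by
  unfold g8Factor
  have hp' : (101 : ℝ) ≤ p := by exact_mod_cast hp
  set t : ℝ := (p : ℝ) - 2 with ht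
  have ht99 : 99 ≤ t := by linarith
  have ht0 : 0 < t := by linarith
  have hp1 : (p : ℝ) - 1 = t + 1 := by linarith
  have hpt : (p : ℝ) = t + 2 := by linarith
  rw [hp1, hpt]
  have hg : ((t + 1) / t) ^ 8 - 1 = ((t + 1) ^ 8 - t ^ 8) / t ^ 8 := by
    rw [div_pow]
    field_simp
  rw [hg, div_div, div_le_div_iff₀ (by positivity) (by positivity)]
  have hpoly := poly8_le ht99
  have ht8 : 0 < t ^ 8 := by positivity
  have ht2 : 0 < t + 2 := by linarith
  -- goal: ((t+1)^8 - t^8) * (t+2)^2 ≤ 8.76 * (t^8 * (t+2))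
  nlinarith [mul_le_mul_of_nonneg_right hpoly ht2.le]

set_option maxHeartbeats 1600000 in
/-- The Euler product bound `∏_{p ∈ O}(1 + g₈(p)/p) ≤ 519.1` over any finite set of odd primes: the odd primes
`≤ 100` contribute `≤ 496.07` (`norm_num`), the tail `exp(8.76·Σ_{p ≥ 101 odd} 1/p²) ≤ exp(8.76/198) ≤ 1.0463`. [folklore] -/
private theorem prod_g8Factor_le (O : Finset ℕ) (hO : ∀ p ∈ O, p.Prime ∧ 2 < p) :
    ∏ p ∈ O, (1 + g8Factor p / p) ≤ 519.1 := by
  have hF1 : ∀ p : ℕ, 2 < p → 1 ≤ 1 + g8Factor p / p := fun p hp => by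
    have h1 := g8Factor_nonneg hp
    have h2 : (0 : ℝ) ≤ g8Factor p / p := by positivity
    linarith
  have hF0 : ∀ p ∈ O, 0 ≤ 1 + g8Factor p / p := fun p hp => le_trans zero_le_one (hF1 p (hO p hp).2)
  rw [← prod_filter_mul_prod_filter_not O (fun p => p ≤ 100)]
  -- the head: odd primes `≤ 100`
  have hsub : O.filter (fun p => p ≤ 100) ⊆ (range 101).filter (fun p => p.Prime ∧ 2 < p) := by
    intro p hp
    rw [mem_filter] at hp ⊢
    obtain ⟨hpO, hp100⟩ := hp
    exact ⟨mem_range.mpr (by omega), hO p hpO⟩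
  have hhead : ∏ p ∈ O.filter (fun p => p ≤ 100), (1 + g8Factor p / p) ≤ 496.07 := by
    have hUval : ∏ p ∈ (range 101).filter (fun p => p.Prime ∧ 2 < p), (1 + g8Factor p / p) ≤ 496.07 := by
      rw [prod_filter]
      simp only [prod_range_succ, prod_range_zero, g8Factor]
      norm_num
    refine le_trans ?_ hUval
    rw [← prod_sdiff hsub]
    have h1 : 1 ≤ ∏ p ∈ (range 101).filter (fun p => p.Prime ∧ 2 < p) \ O.filter (fun p => p ≤ 100),
        (1 + g8Factor p / p) := by
      calc (1 : ℝ) = ∏ p ∈ (range 101).filter (fun p => p.Prime ∧ 2 < p) \ O.filter (fun p => p ≤ 100),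
          (1 : ℝ) := prod_const_one.symm
        _ ≤ _ := prod_le_prod (fun _ _ => zero_le_one) fun p hp =>
          hF1 p (mem_filter.mp (sdiff_subset hp)).2.2
    have h0 : 0 ≤ ∏ p ∈ O.filter (fun p => p ≤ 100), (1 + g8Factor p / p) :=
      prod_nonneg fun p hp => hF0 p (mem_filter.mp hp).1
    exact le_mul_of_one_le_left h0 h1
  -- the tail: odd primes `≥ 101`
  have htail : ∏ p ∈ O.filter (fun p => ¬p ≤ 100), (1 + g8Factor p / p) ≤ 1.0463 := by
    set T' := O.filter (fun p => ¬p ≤ 100) with hT'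
    have hT'mem : ∀ p ∈ T', p.Prime ∧ 2 < p ∧ 101 ≤ p := fun p hp => by
      rw [hT', mem_filter] at hp
      exact ⟨(hO p hp.1).1, (hO p hp.1).2, by omega⟩
    have h1 : ∏ p ∈ T', (1 + g8Factor p / p) ≤ Real.exp (∑ p ∈ T', g8Factor p / p) := by
      rw [Real.exp_sum]
      exact prod_le_prod (fun p hp => hF0 p (mem_filter.mp hp).1) fun p _ => by
        have := Real.add_one_le_exp (g8Factor p / p); linarith
    have h2 : ∑ p ∈ T', g8Factor p / p ≤ 8.76 * ∑ p ∈ T', 1 / (p : ℝ) ^ 2 := by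
      rw [mul_sum]
      exact sum_le_sum fun p hp => by
        calc g8Factor p / p ≤ 8.76 / (p : ℝ) ^ 2 := g8Factor_div_le (hT'mem p hp).2.2
          _ = 8.76 * (1 / (p : ℝ) ^ 2) := by ring
    have h3 : ∑ p ∈ T', 1 / (p : ℝ) ^ 2 ≤ 1 / 198 :=
      sum_inv_sq_le_of_odd T' fun p hp =>
        ⟨(hT'mem p hp).1.odd_of_ne_two (by have := (hT'mem p hp).2.1; omega), (hT'mem p hp).2.2⟩
    have h4 : ∑ p ∈ T', g8Factor p / p ≤ 0.04425 := by linarith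
    have h5 : Real.exp (∑ p ∈ T', g8Factor p / p) ≤ Real.exp 0.04425 := Real.exp_le_exp.mpr h4
    have h6 : Real.exp (0.04425 : ℝ) ≤ 1.0463 := by
      have := Real.abs_exp_sub_one_sub_id_le (x := (0.04425 : ℝ)) (by rw [abs_le]; constructor <;> norm_num)
      rw [abs_le] at this
      nlinarith [this.2]
    linarith
  have htail0 : 0 ≤ ∏ p ∈ O.filter (fun p => ¬p ≤ 100), (1 + g8Factor p / p) :=
    prod_nonneg fun p hp => hF0 p (mem_filter.mp hp).1
  calc (∏ p ∈ O.filter (fun p => p ≤ 100), (1 + g8Factor p / p)) *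
        ∏ p ∈ O.filter (fun p => ¬p ≤ 100), (1 + g8Factor p / p) ≤ 496.07 * 1.0463 :=
        mul_le_mul hhead htail htail0 (by norm_num)
    _ ≤ 519.1 := by norm_num

/-- `Σ_{even N ∈ (0, x]} f(N)⁸ ≤ (x/2)·∏_{2<p≤x}(1 + g₈(p)/p)`: expand `f⁸`, swap the sums and count the even
multiples of `∏_{p∈T} p` (exactly as for the mean square, §3). [folklore] -/
private theorem sum_even_oddSingularFactor_pow8_le_prod (x : ℕ) :
    ∑ N ∈ (Ioc 0 x).filter Even, oddSingularFactor N ^ 8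
      ≤ (x : ℝ) / 2 * ∏ p ∈ (range (x + 1)).filter (fun p => p.Prime ∧ 2 < p), (1 + g8Factor p / p) := by
  set E := (Ioc 0 x).filter Even with hE
  set O := (range (x + 1)).filter (fun p => p.Prime ∧ 2 < p) with hO
  have hSO : ∀ N ∈ E, N.primeFactors.filter (2 < ·) ⊆ O := by
    intro N hN p hp
    rw [hE, mem_filter, mem_Ioc] at hN
    rw [mem_filter, Nat.mem_primeFactors] at hp
    obtain ⟨⟨hpr, hpd, hN0⟩, hp2⟩ := hp
    rw [hO, mem_filter, mem_range]
    have := Nat.le_of_dvd (by omega) hpd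
    exact ⟨by omega, hpr, hp2⟩
  have hg0 : ∀ p ∈ O, 0 ≤ g8Factor p := fun p hp => by
    rw [hO, mem_filter] at hp
    exact g8Factor_nonneg hp.2.2
  have hw0 : ∀ T ∈ O.powerset, 0 ≤ ∏ p ∈ T, g8Factor p := fun T hT =>
    prod_nonneg fun p hp => hg0 p (mem_powerset.mp hT hp)
  -- Step 1: expand `f(N)²` over subsets of `O`
  have hexp : ∀ N ∈ E, oddSingularFactor N ^ 8
      = ∑ T ∈ O.powerset, if T ⊆ N.primeFactors.filter (2 < ·) then ∏ p ∈ T, g8Factor p else 0 := by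
    intro N hN
    rw [oddSingularFactor_pow8_eq, ← sum_filter]
    apply sum_congr _ (fun _ _ => rfl)
    ext T
    simp only [mem_powerset, mem_filter]
    exact ⟨fun h => ⟨h.trans (hSO N hN), h⟩, fun h => h.2⟩
  -- Step 2: swap the sums
  have hswap : ∑ N ∈ E, oddSingularFactor N ^ 8
      = ∑ T ∈ O.powerset, (∏ p ∈ T, g8Factor p) * #{N ∈ E | T ⊆ N.primeFactors.filter (2 < ·)} := by
    rw [sum_congr rfl hexp, sum_comm]
    refine sum_congr rfl fun T _ => ?_
    rw [← sum_filter, sum_const, nsmul_eq_mul, mul_comm]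
  -- Step 3: count the even multiples of `∏ T`
  have hcount : ∀ T ∈ O.powerset,
      (#{N ∈ E | T ⊆ N.primeFactors.filter (2 < ·)} : ℝ) ≤ (x : ℝ) / (2 * ∏ p ∈ T, (p : ℝ)) := by
    intro T hT
    rw [mem_powerset] at hT
    have hTprime : ∀ p ∈ T, p.Prime ∧ 2 < p := fun p hp => by
      have := hT hp
      rw [hO, mem_filter] at this
      exact this.2
    set d := ∏ p ∈ T, p with hd
    have h2d : Nat.Coprime 2 d := Nat.Coprime.prod_right fun p hp =>
      (Nat.coprime_primes Nat.prime_two (hTprime p hp).1).mpr (by have := (hTprime p hp).2; omega)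
    have hsub : {N ∈ E | T ⊆ N.primeFactors.filter (2 < ·)} ⊆ {N ∈ Ioc 0 x | 2 * d ∣ N} := by
      intro N hN
      rw [mem_filter, hE, mem_filter] at hN
      obtain ⟨⟨hNx, hNeven⟩, hTS⟩ := hN
      rw [mem_filter]
      refine ⟨hNx, Nat.Coprime.mul_dvd_of_dvd_of_dvd h2d (even_iff_two_dvd.mp hNeven) ?_⟩
      rw [hd]
      exact Finset.prod_primes_dvd N (fun p hp => (hTprime p hp).1.prime) fun p hp => by
        have := hTS hp
        rw [mem_filter, Nat.mem_primeFactors] at this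
        exact this.1.2.1
    have hcard := card_le_card hsub
    rw [Nat.Ioc_filter_dvd_card_eq_div] at hcard
    have hdiv : ((x / (2 * d) : ℕ) : ℝ) ≤ (x : ℝ) / ((2 * d : ℕ) : ℝ) := Nat.cast_div_le
    calc (#{N ∈ E | T ⊆ N.primeFactors.filter (2 < ·)} : ℝ) ≤ ((x / (2 * d) : ℕ) : ℝ) := by
          exact_mod_cast hcard
      _ ≤ (x : ℝ) / ((2 * d : ℕ) : ℝ) := hdiv
      _ = (x : ℝ) / (2 * ∏ p ∈ T, (p : ℝ)) := by rw [hd]; push_cast; rfl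
  -- Step 4: resum the Euler product
  calc ∑ N ∈ E, oddSingularFactor N ^ 8
      = ∑ T ∈ O.powerset, (∏ p ∈ T, g8Factor p) * #{N ∈ E | T ⊆ N.primeFactors.filter (2 < ·)} := hswap
    _ ≤ ∑ T ∈ O.powerset, (∏ p ∈ T, g8Factor p) * ((x : ℝ) / (2 * ∏ p ∈ T, (p : ℝ))) :=
        sum_le_sum fun T hT => mul_le_mul_of_nonneg_left (hcount T hT) (hw0 T hT)
    _ = (x : ℝ) / 2 * ∑ T ∈ O.powerset, ∏ p ∈ T, (g8Factor p / p) := by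
        rw [mul_sum]
        refine sum_congr rfl fun T hT => ?_
        rw [prod_div_distrib]
        have hTpos : (0 : ℝ) < ∏ p ∈ T, (p : ℝ) := prod_pos fun p hp => by
          have := (mem_powerset.mp hT) hp
          rw [hO, mem_filter] at this
          exact_mod_cast this.2.1.pos
        field_simp
    _ = (x : ℝ) / 2 * ∏ p ∈ O, (1 + g8Factor p / p) := by rw [prod_one_add]

/-- **Eighth moment of the singular factor**: `Σ_{even N ∈ (0, x]} f(N)⁸ ≤ 259.55·x`. [cite: Nathanson1996, Lemma 7.7 (explicit eighth-moment analogue for the odd singular factor, proved here)] -/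
theorem sum_even_oddSingularFactor_pow8_le (x : ℕ) :
    ∑ N ∈ (Ioc 0 x).filter Even, oddSingularFactor N ^ 8 ≤ 259.55 * (x : ℝ) := by
  have h1 := sum_even_oddSingularFactor_pow8_le_prod x
  have h2 := prod_g8Factor_le ((range (x + 1)).filter (fun p => p.Prime ∧ 2 < p))
    (fun p hp => (mem_filter.mp hp).2)
  have hx : (0 : ℝ) ≤ (x : ℝ) / 2 := by positivity
  calc _ ≤ _ := h1
    _ ≤ (x : ℝ) / 2 * 519.1 := mul_le_mul_of_nonneg_left h2 hx
    _ = 259.55 * (x : ℝ) := by ring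


/-! #### §14.2 Hölder with exponent `8` by three Cauchy–Schwarz steps -/

/-- `(Σ_T u)² ≤ |T|·Σ_T u²`. [folklore] -/
private theorem sq_sum_le_card_mul_sum_sq' (T : Finset ℕ) (u : ℕ → ℝ) :
    (∑ N ∈ T, u N) ^ 2 ≤ (#T : ℝ) * ∑ N ∈ T, u N ^ 2 := by
  have h := sum_mul_sq_le_sq_mul_sq T u (fun _ => (1 : ℝ))
  simp only [mul_one, one_pow, sum_const, nsmul_eq_mul] at h
  linarith

/-- **Hölder, exponent 8**: `(Σ_T u)⁸ ≤ |T|⁷·Σ_T u⁸` for `u ≥ 0` on `T`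
(`(Σu)² ≤ n·Σu²`, `(Σu²)² ≤ n·Σu⁴`, `(Σu⁴)² ≤ n·Σu⁸`). [folklore] -/
private theorem pow8_sum_le (T : Finset ℕ) (u : ℕ → ℝ) (hu : ∀ N ∈ T, 0 ≤ u N) :
    (∑ N ∈ T, u N) ^ 8 ≤ (#T : ℝ) ^ 7 * ∑ N ∈ T, u N ^ 8 := by
  set n : ℝ := (#T : ℝ) with hn
  have hn0 : 0 ≤ n := by positivity
  have hS1 : 0 ≤ ∑ N ∈ T, u N := sum_nonneg hu
  have hS2 : 0 ≤ ∑ N ∈ T, u N ^ 2 := sum_nonneg fun N _ => by positivity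
  have hS4 : 0 ≤ ∑ N ∈ T, u N ^ 4 := sum_nonneg fun N _ => by positivity
  have h1 : (∑ N ∈ T, u N) ^ 2 ≤ n * ∑ N ∈ T, u N ^ 2 := sq_sum_le_card_mul_sum_sq' T u
  have h2 : (∑ N ∈ T, u N ^ 2) ^ 2 ≤ n * ∑ N ∈ T, u N ^ 4 := by
    have h := sq_sum_le_card_mul_sum_sq' T (fun N => u N ^ 2)
    have e : ∑ N ∈ T, (u N ^ 2) ^ 2 = ∑ N ∈ T, u N ^ 4 := sum_congr rfl fun N _ => by ring
    rw [e] at h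
    exact h
  have h3 : (∑ N ∈ T, u N ^ 4) ^ 2 ≤ n * ∑ N ∈ T, u N ^ 8 := by
    have h := sq_sum_le_card_mul_sum_sq' T (fun N => u N ^ 4)
    have e : ∑ N ∈ T, (u N ^ 4) ^ 2 = ∑ N ∈ T, u N ^ 8 := sum_congr rfl fun N _ => by ring
    rw [e] at h
    exact h
  have h1' : ((∑ N ∈ T, u N) ^ 2) ^ 4 ≤ (n * ∑ N ∈ T, u N ^ 2) ^ 4 :=
    pow_le_pow_left₀ (sq_nonneg _) h1 4
  have h2' : (∑ N ∈ T, u N ^ 2) ^ 4 ≤ (n * ∑ N ∈ T, u N ^ 4) ^ 2 := by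
    have := pow_le_pow_left₀ (sq_nonneg _) h2 2
    calc (∑ N ∈ T, u N ^ 2) ^ 4 = ((∑ N ∈ T, u N ^ 2) ^ 2) ^ 2 := by ring
      _ ≤ _ := this
  calc (∑ N ∈ T, u N) ^ 8 = ((∑ N ∈ T, u N) ^ 2) ^ 4 := by ring
    _ ≤ (n * ∑ N ∈ T, u N ^ 2) ^ 4 := h1'
    _ = n ^ 4 * (∑ N ∈ T, u N ^ 2) ^ 4 := by ring
    _ ≤ n ^ 4 * (n * ∑ N ∈ T, u N ^ 4) ^ 2 := mul_le_mul_of_nonneg_left h2' (by positivity)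
    _ = n ^ 6 * (∑ N ∈ T, u N ^ 4) ^ 2 := by ring
    _ ≤ n ^ 6 * (n * ∑ N ∈ T, u N ^ 8) := mul_le_mul_of_nonneg_left h3 (by positivity)
    _ = n ^ 7 * ∑ N ∈ T, u N ^ 8 := by ring

/-! #### §14.3 Lower thresholds (`e^{41}`), the `200`-level staircase, blockwise bounds -/

/-- `2⁵⁹ ≤ e⁴¹`. [folklore] -/
private theorem two_pow_59_le_exp_41 : (2 : ℝ) ^ 59 ≤ Real.exp 41 := by
  have he : (2.718281828 : ℝ) ≤ Real.exp 1 := by have := Real.exp_one_gt_d9; linarith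
  have h := pow_le_pow_left₀ (by norm_num) he 41
  rw [← Real.exp_nat_mul] at h
  norm_num at h
  exact le_trans (by norm_num) h

/-- `e¹³ ≥ 442000`. [folklore] -/
private theorem exp_13_ge : (442000 : ℝ) ≤ Real.exp 13 := by
  have he : (2.718281828 : ℝ) ≤ Real.exp 1 := by have := Real.exp_one_gt_d9; linarith
  have h := pow_le_pow_left₀ (by norm_num) he 13
  rw [← Real.exp_nat_mul] at h
  norm_num at h
  exact le_trans (by norm_num) h

/-- **First moment, `0.4243`, from `e^41`**: `Σ_{N ≤ x} r(N) ≥ 0.4243·x²/log²x` for `x ≥ e^41`. [folklore] -/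
private theorem sum_goldbachCount_ge_04243' {x : ℕ} (hx : Real.exp 41 ≤ (x : ℝ)) :
    0.4243 * ((x : ℝ) ^ 2 / Real.log x ^ 2) ≤ ∑ N ∈ range (x + 1), (SingularSeries.goldbachCount N : ℝ) := by
  have hbig : (2 : ℝ) ^ 59 ≤ x := two_pow_59_le_exp_41.trans hx
  have h59 : (2000000 : ℝ) ≤ (2 : ℝ) ^ 59 := by norm_num
  have hx2 : 2 * 10 ^ 6 ≤ x := by
    have : ((2 * 10 ^ 6 : ℕ) : ℝ) ≤ x := by push_cast; linarith
    exact_mod_cast this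
  have h := sum_goldbachCount_ge_of_lower (by norm_num) (by norm_num) primeCountingLowerMul_09212 hx2
  have e : ((10 ^ 6 : ℕ) : ℝ) = (10 : ℝ) ^ 6 := by norm_num
  rw [e] at h
  refine le_trans ?_ h
  have hx1 : (1 : ℝ) < x := by linarith
  have hL : 0 < Real.log x := Real.log_pos hx1
  have hL2 : 0 < 2 * Real.log x ^ 2 := by positivity
  have hxn : (0 : ℝ) ≤ x := by linarith
  have key : 0.4243 * (x : ℝ) ^ 2 * 2 ≤ 0.9212 ^ 2 * (((x : ℝ) - (10 : ℝ) ^ 6) ^ 2 - ((10 : ℝ) ^ 6) ^ 2) := by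
    nlinarith [mul_le_mul_of_nonneg_right hbig hxn]
  calc 0.4243 * ((x : ℝ) ^ 2 / Real.log x ^ 2) = (0.4243 * (x : ℝ) ^ 2 * 2) / (2 * Real.log x ^ 2) := by
        field_simp
    _ ≤ 0.9212 ^ 2 * (((x : ℝ) - (10 : ℝ) ^ 6) ^ 2 - ((10 : ℝ) ^ 6) ^ 2) / (2 * Real.log x ^ 2) :=
        div_le_div_of_nonneg_right key hL2.le
    _ = 0.9212 ^ 2 * ((((x : ℝ) - (10 : ℝ) ^ 6) ^ 2 - ((10 : ℝ) ^ 6) ^ 2) / (2 * Real.log x ^ 2)) := by ring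

/-- **First moment under (3.3), from `e^41`**: `Σ_{N ≤ x} r(N) ≥ 0.4995·x²/log²x` for `x ≥ e^41`.
[cite: RosserSchoenfeld1962, Theorem 2, eq. (3.3) (as input)] -/
theorem sum_goldbachCount_ge_of_RS' (hRS : Literature.NumberTheory.LFunctions.RosserSchoenfeld1962_theorem2)
    {x : ℕ} (hx : Real.exp 41 ≤ (x : ℝ)) :
    0.4995 * ((x : ℝ) ^ 2 / Real.log x ^ 2) ≤ ∑ N ∈ range (x + 1), (SingularSeries.goldbachCount N : ℝ) := by
  have hbig : (2 : ℝ) ^ 59 ≤ x := two_pow_59_le_exp_41.trans hx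
  have h59 : (2000000 : ℝ) ≤ (2 : ℝ) ^ 59 := by norm_num
  have hx2 : 2 * 67 ≤ x := by
    have : ((2 * 67 : ℕ) : ℝ) ≤ x := by push_cast; linarith
    exact_mod_cast this
  have h := sum_goldbachCount_ge_of_lower (by norm_num) (by norm_num) (primeCountingLowerMul_one_of_RS hRS) hx2
  have e : ((67 : ℕ) : ℝ) = (67 : ℝ) := by norm_num
  rw [e] at h
  refine le_trans ?_ h
  have hx1 : (1 : ℝ) < x := by linarith
  have hL : 0 < Real.log x := Real.log_pos hx1
  have hL2 : 0 < 2 * Real.log x ^ 2 := by positivity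
  have hxn : (0 : ℝ) ≤ x := by linarith
  have key : 0.4995 * (x : ℝ) ^ 2 * 2 ≤ 1 ^ 2 * (((x : ℝ) - 67) ^ 2 - (67 : ℝ) ^ 2) := by
    nlinarith [mul_le_mul_of_nonneg_right hbig hxn]
  calc 0.4995 * ((x : ℝ) ^ 2 / Real.log x ^ 2) = (0.4995 * (x : ℝ) ^ 2 * 2) / (2 * Real.log x ^ 2) := by
        field_simp
    _ ≤ 1 ^ 2 * (((x : ℝ) - 67) ^ 2 - (67 : ℝ) ^ 2) / (2 * Real.log x ^ 2) :=
        div_le_div_of_nonneg_right key hL2.le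
    _ = 1 ^ 2 * ((((x : ℝ) - 67) ^ 2 - (67 : ℝ) ^ 2) / (2 * Real.log x ^ 2)) := by ring

/-- `2(x + 1) ≤ 10⁻⁴·x²/log²x` for `x ≥ e^41` (`log²x ≤ 2.4367√x`, `√x ≥ 2^29`). [folklore] -/
private theorem two_mul_succ_le_small41 {x : ℕ} (hx : Real.exp 41 ≤ (x : ℝ)) :
    2 * ((x : ℝ) + 1) ≤ 0.0001 * ((x : ℝ) ^ 2 / Real.log x ^ 2) := by
  have hx1 : (1 : ℝ) < x := lt_of_lt_of_le (by have := Real.add_one_le_exp (41 : ℝ); linarith) hx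
  have hx0 : (0 : ℝ) < x := by linarith
  set L := Real.log x with hL
  have hL41 : 41 ≤ L := by
    have := Real.log_le_log (Real.exp_pos 41) hx
    rwa [Real.log_exp] at this
  have hLpos : 0 < L ^ 2 := by positivity
  have hL4 : L ^ 4 ≤ 4096 * Real.sqrt x := log_pow_four_le_sqrt hx1.le
  have hLsq : (1681 : ℝ) ≤ L ^ 2 := by nlinarith
  have hL2 : L ^ 2 ≤ 2.4367 * Real.sqrt x := by
    have e : L ^ 4 = L ^ 2 * L ^ 2 := by ring
    nlinarith [Real.sqrt_nonneg (x : ℝ)]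
  have hbig : (2 : ℝ) ^ 59 ≤ x := two_pow_59_le_exp_41.trans hx
  have hsx : (2 : ℝ) ^ 29 ≤ Real.sqrt x :=
    Real.le_sqrt_of_sq_le (by
      rw [show ((2 : ℝ) ^ 29) ^ 2 = (2 : ℝ) ^ 58 by norm_num]
      exact le_trans (by norm_num) hbig)
  have hxx : Real.sqrt x * Real.sqrt x = x := Real.mul_self_sqrt hx0.le
  have key : 2 * ((x : ℝ) + 1) * L ^ 2 ≤ 0.0001 * (x : ℝ) ^ 2 := by
    have h1 : 2 * ((x : ℝ) + 1) * L ^ 2 ≤ 4 * x * (2.4367 * Real.sqrt x) := by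
      have : 2 * ((x : ℝ) + 1) ≤ 4 * x := by linarith
      exact mul_le_mul this hL2 (by positivity) (by positivity)
    have h2 : (1 : ℝ) ≤ Real.sqrt x / 2 ^ 29 := by
      rw [le_div_iff₀ (by positivity)]; linarith
    calc 2 * ((x : ℝ) + 1) * L ^ 2 ≤ 4 * x * (2.4367 * Real.sqrt x) := h1
      _ ≤ 4 * x * (2.4367 * Real.sqrt x) * (Real.sqrt x / 2 ^ 29) :=
          le_mul_of_one_le_right (by positivity) h2
      _ = (9.7468 / 2 ^ 29) * (x * (Real.sqrt x * Real.sqrt x)) := by ring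
      _ = (9.7468 / 2 ^ 29) * (x : ℝ) ^ 2 := by rw [hxx]; ring
      _ ≤ 0.0001 * (x : ℝ) ^ 2 := mul_le_mul_of_nonneg_right (by norm_num) (by positivity)
  calc 2 * ((x : ℝ) + 1) = 2 * ((x : ℝ) + 1) * L ^ 2 / L ^ 2 := by field_simp
    _ ≤ 0.0001 * (x : ℝ) ^ 2 / L ^ 2 := div_le_div_of_nonneg_right key hLpos.le
    _ = _ := by ring

/-- **First moment over even `N`, threshold `e^{Λs}`, `Λs ≥ 41`**: `S₁^{ev}(x) ≥ (c₁ − 10⁻⁴)·x²/log²x`. [folklore] -/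
private theorem sum_even_goldbachCount_ge' {c₁ Λs : ℝ} (hΛs : 41 ≤ Λs) {x : ℕ} (hx : Real.exp Λs ≤ (x : ℝ))
    (hS₁ : c₁ * ((x : ℝ) ^ 2 / Real.log x ^ 2) ≤ ∑ N ∈ range (x + 1), (SingularSeries.goldbachCount N : ℝ)) :
    (c₁ - 0.0001) * ((x : ℝ) ^ 2 / Real.log x ^ 2)
      ≤ ∑ N ∈ (range (x + 1)).filter Even, (SingularSeries.goldbachCount N : ℝ) := by
  have hsplit := sum_filter_add_sum_filter_not (range (x + 1)) Even
    (fun N => (SingularSeries.goldbachCount N : ℝ))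
  have hodd := sum_goldbachCount_odd_le x
  have hsmall := two_mul_succ_le_small41 (((Real.exp_le_exp.mpr hΛs)).trans hx)
  have e : (c₁ - 0.0001) * ((x : ℝ) ^ 2 / Real.log x ^ 2)
      = c₁ * ((x : ℝ) ^ 2 / Real.log x ^ 2) - 0.0001 * ((x : ℝ) ^ 2 / Real.log x ^ 2) := by ring
  rw [e]
  linarith

/-- **One level of the lower side, threshold `e^{Λs}`**: `Σ_{even N ≤ t_j} r(N) ≥ (c₁ − 10⁻⁴)·(t_j − 1)²/ℓ_j²`
when `t_j ≥ e^{Λs} + 1`. [folklore] -/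
private theorem level_lower' {c₁ Λs : ℝ} (hΛs : 41 ≤ Λs)
    (hS₁ : ∀ y : ℕ, Real.exp Λs ≤ (y : ℝ) →
      c₁ * ((y : ℝ) ^ 2 / Real.log y ^ 2) ≤ ∑ N ∈ range (y + 1), (SingularSeries.goldbachCount N : ℝ))
    (hc₁ : 0.0001 ≤ c₁) {x j : ℕ} (hx : 0 < x) (ht : Real.exp Λs + 1 ≤ stairT x j) :
    (c₁ - 0.0001) * ((stairT x j - 1) ^ 2 / stairL x j ^ 2)
      ≤ ∑ N ∈ ((range (x + 1)).filter Even).filter (fun N : ℕ => (N : ℝ) ≤ stairT x j),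
          (SingularSeries.goldbachCount N : ℝ) := by
  set t := stairT x j with ht_def
  have heΛ : (1 : ℝ) < Real.exp Λs := by have := Real.add_one_le_exp Λs; linarith
  have ht0 : 0 ≤ t := by linarith
  set y := ⌊t⌋₊ with hy_def
  have hy1 : t - 1 ≤ y := (Nat.sub_one_lt_floor t).le
  have hyt : (y : ℝ) ≤ t := Nat.floor_le ht0
  have hy : Real.exp Λs ≤ (y : ℝ) := by linarith
  have hy0 : (1 : ℝ) < y := by linarith
  rw [filter_even_le_eq ht0 (stairT_le_self x j)]
  have h := sum_even_goldbachCount_ge' hΛs hy (hS₁ y hy)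
  refine le_trans ?_ h
  apply mul_le_mul_of_nonneg_left _ (by linarith)
  have hlogy : 0 < Real.log y := Real.log_pos hy0
  have hlogle : Real.log y ≤ stairL x j := by
    rw [← log_stairT hx]
    exact Real.log_le_log (by linarith) hyt
  calc (t - 1) ^ 2 / stairL x j ^ 2 ≤ (y : ℝ) ^ 2 / stairL x j ^ 2 :=
        div_le_div_of_nonneg_right (pow_le_pow_left₀ (by linarith) hy1 2) (by positivity)
    _ ≤ (y : ℝ) ^ 2 / Real.log y ^ 2 :=
        div_le_div_of_nonneg_left (by positivity) (by positivity) (pow_le_pow_left₀ hlogy.le hlogle 2)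

/-- `(100/101)¹⁹⁹ ≤ 1/7`. [folklore] -/
private theorem q_pow_199_le : ((100 : ℝ) / 101) ^ 199 ≤ 1 / 7 := by norm_num

/-- `Λ₀`-dependent lower constant of the `200`-level flattened first moment. [folklore] -/
noncomputable def gHol (Λ₀ : ℝ) : ℝ :=
  (1 - 0.01 / Λ₀) ^ 2 + 85.71 * ((1 - 0.01 / (Λ₀ - 2)) ^ 2 - 100 / 101)

/-- **The lower side, summed over `J = 200` levels**: `Σ_{j<200} c_j·(t_j − 1)²/ℓ_j² ≥ gHol(Λ₀)·x − 21`
for `log x ≥ Λ₀ ≥ 44`. [folklore] -/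
private theorem stair_lower_sum_ge200 {x : ℕ} (hx : 0 < x) {Λ₀ : ℝ} (hΛ₀ : 44 ≤ Λ₀) (hL : Λ₀ ≤ Real.log (x : ℝ))
    (hx2 : (2 : ℝ) ≤ stairT x 200) :
    gHol Λ₀ * (x : ℝ) - 21 ≤ ∑ j ∈ range 200, stairC x j * ((stairT x j - 1) ^ 2 / stairL x j ^ 2) := by
  rw [sum_range_succ']
  set ls := Λ₀ - 2 with hls_def
  have hls3 : 3 ≤ ls := by linarith
  set δ := (1 - 0.01 / ls) ^ 2 - 100 / 101 with hδ_def
  have hδ0 : 0 ≤ δ := by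
    have : 0.01 / ls ≤ 0.01 / 3 := div_le_div_of_nonneg_left (by norm_num) (by norm_num) hls3
    rw [hδ_def]
    nlinarith
  have hδ1 : δ ≤ 0.01 := by
    have h0 : 0 ≤ 0.01 / ls := by positivity
    have : 0.01 / ls ≤ 0.01 / 3 := div_le_div_of_nonneg_left (by norm_num) (by norm_num) hls3
    rw [hδ_def]
    nlinarith
  -- the terms `k+1`, `k < 199`
  have hterm : ∀ k ∈ range 199, δ * (stairT x (k + 1) - 2)
      ≤ stairC x (k + 1) * ((stairT x (k + 1) - 1) ^ 2 / stairL x (k + 1) ^ 2) := by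
    intro k hk
    rw [mem_range] at hk
    apply stair_term_succ_ge hls3
    · have h1 := stairL_le_of_le x (show k + 1 ≤ 200 by omega)
      have h2 := stairL_ge x 200
      have : ls ≤ Real.log (x : ℝ) - 0.01 * ((200 : ℕ) : ℝ) := by push_cast; linarith
      linarith
    · exact hx2.trans (stairT_le_of_le x (by omega))
  have hsum1 : δ * ((x : ℝ) * (100 * (1 - ((100 : ℝ) / 101) ^ 199)) - 2 * 199)
      ≤ ∑ k ∈ range 199, stairC x (k + 1) * ((stairT x (k + 1) - 1) ^ 2 / stairL x (k + 1) ^ 2) := by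
    have h := sum_le_sum hterm
    have e : ∑ k ∈ range 199, δ * (stairT x (k + 1) - 2)
        = δ * ((x : ℝ) * (100 * (1 - ((100 : ℝ) / 101) ^ 199)) - 2 * 199) := by
      rw [← mul_sum, sum_sub_distrib, sum_const, card_range, ← geom_sum_101, mul_sum]
      simp only [stairT_eq_mul_pow, nsmul_eq_mul]
      push_cast
      ring
    rw [← e]
    exact h
  have hterm0 := stair_term_zero_ge hx (by linarith : (1 : ℝ) ≤ Λ₀) hL
  have hq199 : ((100 : ℝ) / 101) ^ 199 ≤ 1 / 7 := q_pow_199_le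
  have hx' : (0 : ℝ) < x := by exact_mod_cast hx
  generalize hQ : ((100 : ℝ) / 101) ^ 199 = Q at hq199 hsum1
  clear hQ
  have hmain : gHol Λ₀ * (x : ℝ) - 21
      ≤ (1 - 0.01 / Λ₀) ^ 2 * ((x : ℝ) - 2)
        + δ * ((x : ℝ) * (100 * (1 - Q)) - 2 * 199) := by
    have hS : 85.71 ≤ 100 * (1 - Q) := by linarith [hq199]
    have h1 : 85.71 * (x : ℝ) ≤ (x : ℝ) * (100 * (1 - Q)) := by
      nlinarith [mul_le_mul_of_nonneg_left hS hx'.le]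
    have h2 : (1 - 0.01 / Λ₀) ^ 2 ≤ 1 := by
      have h0 : 0 ≤ 0.01 / Λ₀ := by positivity
      have : 0.01 / Λ₀ ≤ 0.01 / 44 := div_le_div_of_nonneg_left (by norm_num) (by norm_num) hΛ₀
      nlinarith
    have hA : (1 - 0.01 / Λ₀) ^ 2 * (x : ℝ) - 2 ≤ (1 - 0.01 / Λ₀) ^ 2 * ((x : ℝ) - 2) := by
      nlinarith [sq_nonneg (1 - 0.01 / Λ₀)]
    have hB : 85.71 * δ * (x : ℝ) - 19
        ≤ δ * ((x : ℝ) * (100 * (1 - Q)) - 2 * 199) := by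
      have h3 := mul_le_mul_of_nonneg_left h1 hδ0
      nlinarith [hδ1]
    have e : gHol Λ₀ * (x : ℝ) = (1 - 0.01 / Λ₀) ^ 2 * (x : ℝ) + 85.71 * δ * (x : ℝ) := by
      unfold gHol
      rw [← hls_def, ← hδ_def]
      ring
    linarith [hA, hB, e]
  linarith [hmain, hterm0, hsum1]

/-- `m(N) ≤ M_{J−1} = Σ_{j<J} c_j` (all increments are `≥ 0`). [folklore] -/
private theorem stairW_le_stairMf {x : ℕ} (hx : 0 < x) {J : ℕ} (hℓ : 3 ≤ stairL x J) (N : ℕ) :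
    stairW x J N ≤ stairMf x J := by
  unfold stairW
  rw [← sum_range_stairC x J]
  exact sum_le_sum_of_subset_of_nonneg (filter_subset _ _) fun j hj _ => stairC_nonneg hx (mem_range.mp hj) hℓ

/-- **Main blocks, `J = 200`**: for even `N` with `t_{200} < N ≤ x`, `r(N)·m(N) ≤ A·f(N)`. [folklore] -/
private theorem stair_rm_le_main200 {x : ℕ} (hx : 0 < x) {Λ A : ℝ} (hΛ0 : 0 < Λ) (hA : 0 ≤ A)
    (hpt : ∀ N : ℕ, Real.exp Λ ≤ (N : ℝ) → Even N →
      (SingularSeries.goldbachCount N : ℝ) ≤ A * oddSingularFactor N * (N : ℝ) / Real.log (N : ℝ) ^ 2)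
    (hbot : Real.exp Λ ≤ stairT x 200) {N : ℕ} (heven : Even N) (hNx : (N : ℝ) ≤ x)
    (hNt : stairT x 200 < N) :
    (SingularSeries.goldbachCount N : ℝ) * stairW x 200 N ≤ A * oddSingularFactor N := by
  obtain ⟨k, hk, hW, hNk, hnext⟩ := stairW_eq (x := x) (J := 200) (N := N) (by norm_num) hNx
  have htk1 : stairT x (k + 1) < N := by
    by_cases h : k + 1 < 200
    · exact hnext h
    · have : k + 1 = 200 := by omega
      rw [this]; exact hNt
  have hNΛ : Real.exp Λ ≤ (N : ℝ) := hbot.trans hNt.le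
  have hN1 : (1 : ℝ) < N := lt_of_lt_of_le (by have := Real.add_one_le_exp Λ; linarith) hNΛ
  have hlogN : 0 < Real.log (N : ℝ) := Real.log_pos hN1
  have hr := hpt N hNΛ heven
  have hf := oddSingularFactor_nonneg N
  have hΛℓ : Λ ≤ stairL x 200 := by
    rw [← log_stairT hx]
    have := Real.log_le_log (Real.exp_pos Λ) hbot
    rwa [Real.log_exp] at this
  have hl0 : 0 ≤ stairL x (k + 1) := (hΛ0.le.trans hΛℓ).trans (stairL_le_of_le x (by omega))
  have hl : stairL x (k + 1) ≤ Real.log (N : ℝ) := by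
    rw [← log_stairT hx]
    exact Real.log_le_log (stairT_pos hx _) htk1.le
  have h1 : stairL x (k + 1) ^ 2 ≤ Real.log (N : ℝ) ^ 2 := pow_le_pow_left₀ hl0 hl 2
  have htk : 0 < stairT x k := stairT_pos hx k
  have hN0 : (0 : ℝ) < N := by linarith
  rw [hW]
  unfold stairM
  calc (SingularSeries.goldbachCount N : ℝ) * (stairL x (k + 1) ^ 2 / stairT x k)
      ≤ A * oddSingularFactor N * (N : ℝ) / Real.log (N : ℝ) ^ 2 * (stairL x (k + 1) ^ 2 / stairT x k) :=
        mul_le_mul_of_nonneg_right hr (div_nonneg (sq_nonneg _) htk.le)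
    _ = A * oddSingularFactor N * (((N : ℝ) / stairT x k) * (stairL x (k + 1) ^ 2 / Real.log (N : ℝ) ^ 2)) := by
        field_simp
    _ ≤ A * oddSingularFactor N * 1 := by
        apply mul_le_mul_of_nonneg_left _ (mul_nonneg hA hf)
        exact mul_le_one₀ ((div_le_one htk).mpr hNk) (div_nonneg (sq_nonneg _) (sq_nonneg _))
          ((div_le_one (pow_pos hlogN 2)).mpr h1)
    _ = A * oddSingularFactor N := mul_one _

/-- **The bottom segment, `J = 200`**: for even `e^Λ ≤ N ≤ t_{200}`, `r(N)·m(N) ≤ A·f(N)`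
(`m(N) = ℓ_{200}²/t_{199}`, `N/log²N ≤ t_{200}/ℓ_{200}²`, `t_{200} ≤ t_{199}`). [folklore] -/
private theorem stair_rm_le_bottom200 {x : ℕ} (hx : 0 < x) {Λ A : ℝ} (hΛ2 : 2 ≤ Λ) (hA : 0 ≤ A)
    (hpt : ∀ N : ℕ, Real.exp Λ ≤ (N : ℝ) → Even N →
      (SingularSeries.goldbachCount N : ℝ) ≤ A * oddSingularFactor N * (N : ℝ) / Real.log (N : ℝ) ^ 2)
    {N : ℕ} (heven : Even N) (hNΛ : Real.exp Λ ≤ (N : ℝ)) (hNt : (N : ℝ) ≤ stairT x 200) :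
    (SingularSeries.goldbachCount N : ℝ) * stairW x 200 N ≤ A * oddSingularFactor N := by
  have hNx : (N : ℝ) ≤ x := hNt.trans (stairT_le_self x 200)
  obtain ⟨k, hk, hW, hNk, hnext⟩ := stairW_eq (x := x) (J := 200) (N := N) (by norm_num) hNx
  have hk199 : k = 199 := by
    by_contra hne
    have hlt : k + 1 < 200 := by omega
    have h1 := hnext hlt
    have h2 := stairT_le_of_le x (show k + 1 ≤ 200 by omega)
    linarith
  subst hk199
  rw [hW]
  unfold stairM
  have ht199 := stairT_pos hx 199
  have ht200 := stairT_pos hx 200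
  have hℓ : Real.log (stairT x 200) = stairL x (199 + 1) := log_stairT hx 200
  have hr := hpt N hNΛ heven
  have he2 : Real.exp 2 ≤ (N : ℝ) := le_trans (Real.exp_le_exp.mpr hΛ2) hNΛ
  have hmono := div_log_sq_mono he2 hNt
  rw [hℓ] at hmono
  have hN1 : (1 : ℝ) < N := lt_of_lt_of_le (by have := Real.add_one_le_exp (2 : ℝ); linarith) he2
  have hlogN : 0 < Real.log (N : ℝ) := Real.log_pos hN1
  have hf := oddSingularFactor_nonneg N
  calc (SingularSeries.goldbachCount N : ℝ) * (stairL x (199 + 1) ^ 2 / stairT x 199)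
      ≤ A * oddSingularFactor N * (N : ℝ) / Real.log (N : ℝ) ^ 2 * (stairL x (199 + 1) ^ 2 / stairT x 199) :=
        mul_le_mul_of_nonneg_right hr (div_nonneg (sq_nonneg _) ht199.le)
    _ = A * oddSingularFactor N * ((N : ℝ) / Real.log (N : ℝ) ^ 2) * (stairL x (199 + 1) ^ 2 / stairT x 199) := by
        ring
    _ ≤ A * oddSingularFactor N * (stairT x 200 / stairL x (199 + 1) ^ 2)
          * (stairL x (199 + 1) ^ 2 / stairT x 199) :=
        mul_le_mul_of_nonneg_right (mul_le_mul_of_nonneg_left hmono (mul_nonneg hA hf))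
          (div_nonneg (sq_nonneg _) ht199.le)
    _ ≤ A * oddSingularFactor N * 1 := by
        rw [mul_assoc (A * oddSingularFactor N)]
        apply mul_le_mul_of_nonneg_left _ (mul_nonneg hA hf)
        have hℓ0 : 0 < stairL x (199 + 1) := by
          rw [← hℓ]
          have h1 := Real.log_le_log (by positivity) (hNΛ.trans hNt)
          have h2 : Real.log (N : ℝ) ≤ Real.log (stairT x 200) := Real.log_le_log (by linarith) hNt
          linarith
        calc stairT x 200 / stairL x (199 + 1) ^ 2 * (stairL x (199 + 1) ^ 2 / stairT x 199)
            = stairT x 200 / stairT x 199 := by field_simp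
          _ ≤ 1 := (div_le_one ht199).mpr (stairT_le_of_le x (by norm_num))
    _ = A * oddSingularFactor N := mul_one _

/-- `ℓ² ≤ 2450.25·e^{ℓ − 49.5}` for `ℓ ≥ 49.5` (`ℓ²e^{−ℓ}` is decreasing). [folklore] -/
private theorem sq_le_mul_exp {l : ℝ} (hl : 49.5 ≤ l) : l ^ 2 ≤ 2450.25 * Real.exp (l - 49.5) := by
  set u := l - 49.5 with hu
  have hu0 : 0 ≤ u := by linarith
  have h1 : 1 + u / 2 ≤ Real.exp (u / 2) := by have := Real.add_one_le_exp (u / 2); linarith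
  have h2 : (1 + u / 2) ^ 2 ≤ Real.exp (u / 2) ^ 2 := pow_le_pow_left₀ (by linarith) h1 2
  have h3 : Real.exp (u / 2) ^ 2 = Real.exp u := by rw [← Real.exp_nat_mul]; ring_nf
  rw [h3] at h2
  have hl' : l = 49.5 + u := by linarith
  rw [hl']
  nlinarith [h2, sq_nonneg u]

/-! #### §14.4 The Hölder count -/

set_option maxHeartbeats 1600000 in
/-- **Hölder with the staircase weight (`J = 200`)**: for `x ≥ e^{Λ₀}` (`Λ₀ ≥ 51.5`), if
`r(N) ≤ A·f(N)·N/log²N` for even `N ≥ e^{Λs}` and `S₁(y) ≥ c₁·y²/log²y` for `y ≥ e^{Λs}` (`41 ≤ Λs ≤ 44`), then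
with `F = (c₁ − 10⁻⁴)·gHol(Λ₀) − 0.0057` we have `F·x ≤ A·Σ_T f`, `(Σ_T f)⁸ ≤ |T|⁷·259.55x` on the set `T` of even
Goldbach numbers in `(e^{Λs}, x]`, hence `#{even N ∈ (0,x] : N = p+q} ≥ κ·x` whenever `κ⁷·259.55·A⁸ ≤ F⁸`.
[cite: Nathanson1996, Thm 7.8 (Hölder variant proved here)] -/
theorem goldbach_even_count_ge_holder {Λs Λ₀ A c₁ κ : ℝ} (hΛs : 41 ≤ Λs) (hΛs44 : Λs ≤ 44) (hΛ₀ : 51.5 ≤ Λ₀)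
    (hA : 1 ≤ A)
    (hpt : ∀ N : ℕ, Real.exp Λs ≤ (N : ℝ) → Even N →
      (SingularSeries.goldbachCount N : ℝ) ≤ A * oddSingularFactor N * (N : ℝ) / Real.log (N : ℝ) ^ 2)
    (hc₁ : 0.0001 ≤ c₁) (hc₁1 : c₁ ≤ 1)
    (hS₁ : ∀ y : ℕ, Real.exp Λs ≤ (y : ℝ) →
      c₁ * ((y : ℝ) ^ 2 / Real.log y ^ 2) ≤ ∑ N ∈ range (y + 1), (SingularSeries.goldbachCount N : ℝ))
    (hF0 : 0 ≤ (c₁ - 0.0001) * gHol Λ₀ - 0.0057)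
    (hκ : κ ^ 7 * (259.55 * A ^ 8) ≤ ((c₁ - 0.0001) * gHol Λ₀ - 0.0057) ^ 8)
    {x : ℕ} (hx : Real.exp Λ₀ ≤ (x : ℝ)) :
    κ * (x : ℝ) ≤ #{N ∈ Ioc 0 x | Even N ∧ ∃ p q : ℕ, p.Prime ∧ q.Prime ∧ p + q = N} := by
  -- basics
  have hx515 : Real.exp 51.5 ≤ (x : ℝ) := (Real.exp_le_exp.mpr hΛ₀).trans hx
  have hx1 : (1 : ℝ) < x := lt_of_lt_of_le (by have := Real.add_one_le_exp (51.5 : ℝ); linarith) hx515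
  have hx0 : (0 : ℝ) < x := by linarith
  have hxN : 0 < x := by exact_mod_cast hx0
  set L := Real.log (x : ℝ) with hL_def
  have hLΛ₀ : Λ₀ ≤ L := by
    have := Real.log_le_log (Real.exp_pos Λ₀) hx
    rwa [Real.log_exp] at this
  have hΛs0 : 0 < Λs := by linarith
  have hA0 : 0 ≤ A := by linarith
  -- the bottom level `ℓ_200 ≥ Λ₀ − 2 ≥ 49.5`
  have hℓ200 : Λ₀ - 2 ≤ stairL x 200 := by
    have := stairL_ge x 200
    push_cast at this
    linarith
  have hℓ495 : 49.5 ≤ stairL x 200 := by linarith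
  have hℓ3 : 3 ≤ stairL x 200 := by linarith
  have ht200 : stairT x 200 = Real.exp (stairL x 200) := by
    rw [← log_stairT hxN 200, Real.exp_log (stairT_pos hxN 200)]
  have hbotΛ : Real.exp Λs ≤ stairT x 200 := by rw [ht200]; exact Real.exp_le_exp.mpr (by linarith)
  have hbotS : Real.exp Λs + 1 ≤ stairT x 200 := by
    rw [ht200]
    have h1 : Real.exp (Λs + 1) ≤ Real.exp (stairL x 200) := Real.exp_le_exp.mpr (by linarith)
    have h2 : Real.exp (Λs + 1) = Real.exp Λs * Real.exp 1 := by rw [Real.exp_add]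
    have h3 : (2 : ℝ) ≤ Real.exp 1 := by have := Real.add_one_le_exp (1 : ℝ); linarith
    have h4 : (1 : ℝ) ≤ Real.exp Λs := by have := Real.add_one_le_exp Λs; linarith
    nlinarith [Real.exp_pos Λs]
  have hbot2 : (2 : ℝ) ≤ stairT x 200 := by
    have h4 : (1 : ℝ) ≤ Real.exp Λs := by have := Real.add_one_le_exp Λs; linarith
    linarith
  -- notation
  set r : ℕ → ℝ := fun N => (SingularSeries.goldbachCount N : ℝ) with hr
  set f : ℕ → ℝ := fun N => oddSingularFactor N with hf_def
  set m : ℕ → ℝ := stairW x 200 with hm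
  have hm0 : ∀ N, 0 ≤ m N := fun N => stairW_nonneg hxN hℓ3 N
  set c₁' := c₁ - 0.0001 with hc₁'
  have hc₁'0 : 0 ≤ c₁' := by rw [hc₁']; linarith
  have hc₁'1 : c₁' ≤ 1 := by rw [hc₁']; linarith
  set g := gHol Λ₀ with hg
  set F := c₁' * g - 0.0057 with hF_def
  set E : Finset ℕ := (range (x + 1)).filter Even with hE
  -- LOWER: `Σ_E r·m ≥ c₁'·(g·x − 21)`
  have hlower : c₁' * (g * x - 21) ≤ ∑ N ∈ E, r N * m N := by
    rw [hm, sum_mul_stairW x 200 E r]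
    have hterm : ∀ j ∈ range 200, stairC x j * (c₁' * ((stairT x j - 1) ^ 2 / stairL x j ^ 2))
        ≤ stairC x j * ∑ N ∈ E.filter (fun N : ℕ => (N : ℝ) ≤ stairT x j), r N := by
      intro j hj
      rw [mem_range] at hj
      apply mul_le_mul_of_nonneg_left _ (stairC_nonneg hxN hj hℓ3)
      rw [hE, hr]
      exact level_lower' hΛs hS₁ hc₁ hxN (hbotS.trans (stairT_le_of_le x hj.le))
    refine le_trans ?_ (sum_le_sum hterm)
    have e : ∑ j ∈ range 200, stairC x j * (c₁' * ((stairT x j - 1) ^ 2 / stairL x j ^ 2))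
        = c₁' * ∑ j ∈ range 200, stairC x j * ((stairT x j - 1) ^ 2 / stairL x j ^ 2) := by
      rw [mul_sum]
      exact sum_congr rfl fun j _ => by ring
    rw [e]
    exact mul_le_mul_of_nonneg_left (stair_lower_sum_ge200 hxN (by linarith) hLΛ₀ hbot2) hc₁'0
  -- the small `N < e^{Λs}`: `Σ r·m ≤ 0.0056·x`
  set Ehi : Finset ℕ := E.filter (fun N : ℕ => Real.exp Λs ≤ (N : ℝ)) with hEhi
  set Elo : Finset ℕ := E.filter (fun N : ℕ => ¬(Real.exp Λs ≤ (N : ℝ))) with hElo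
  have hsplit : ∑ N ∈ E, r N * m N = ∑ N ∈ Ehi, r N * m N + ∑ N ∈ Elo, r N * m N :=
    (sum_filter_add_sum_filter_not E (fun N : ℕ => Real.exp Λs ≤ (N : ℝ)) (fun N => r N * m N)).symm
  have hMtop : stairMf x 200 ≤ 2450.25 * Real.exp (-49.5) := by
    show stairM x 199 ≤ _
    unfold stairM
    have ht199 := stairT_pos hxN 199
    have h1 : stairL x (199 + 1) ^ 2 / stairT x 199 ≤ stairL x 200 ^ 2 / stairT x 200 :=
      div_le_div_of_nonneg_left (sq_nonneg _) (stairT_pos hxN 200) (stairT_le_of_le x (by norm_num))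
    refine h1.trans ?_
    rw [ht200, div_le_iff₀ (Real.exp_pos _)]
    have h2 := sq_le_mul_exp hℓ495
    have e : 2450.25 * Real.exp (stairL x 200 - 49.5) = 2450.25 * Real.exp (-49.5) * Real.exp (stairL x 200) := by
      rw [show stairL x 200 - 49.5 = -49.5 + stairL x 200 by ring, Real.exp_add]; ring
    linarith [e]
  have hlo : ∑ N ∈ Elo, r N * m N ≤ 0.0056 * x := by
    have hterm : ∀ N ∈ Elo, r N * m N ≤ (Real.exp Λs + 1) * (2450.25 * Real.exp (-49.5)) := by
      intro N hN
      rw [hElo, mem_filter] at hN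
      have hNlt : (N : ℝ) < Real.exp Λs := not_le.mp hN.2
      have h1 : r N ≤ Real.exp Λs + 1 := by
        have : r N ≤ (N : ℝ) + 1 := by
          show (SingularSeries.goldbachCount N : ℝ) ≤ (N : ℝ) + 1
          exact_mod_cast goldbachCount_le_succ N
        linarith
      have h2 : m N ≤ 2450.25 * Real.exp (-49.5) := (stairW_le_stairMf hxN hℓ3 N).trans hMtop
      have hr0 : 0 ≤ r N := Nat.cast_nonneg _
      exact mul_le_mul h1 h2 (hm0 N) (by positivity)
    have hcard : (#Elo : ℝ) ≤ Real.exp Λs + 1 := by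
      have hsub : Elo ⊆ range (⌊Real.exp Λs⌋₊ + 1) := by
        intro N hN
        rw [hElo, mem_filter] at hN
        have hNlt : (N : ℝ) < Real.exp Λs := not_le.mp hN.2
        rw [mem_range]
        have := Nat.le_floor hNlt.le
        omega
      have h1 := card_le_card hsub
      rw [card_range] at h1
      have h2 : (#Elo : ℝ) ≤ (⌊Real.exp Λs⌋₊ : ℝ) + 1 := by exact_mod_cast h1
      have h3 : (⌊Real.exp Λs⌋₊ : ℝ) ≤ Real.exp Λs := Nat.floor_le (Real.exp_pos Λs).le
      linarith
    have hs := sum_le_sum hterm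
    rw [sum_const, nsmul_eq_mul] at hs
    refine hs.trans ?_
    -- `(e^Λs + 1)² · 2450.25 · e^{-49.5} ≤ 0.0056·x`
    have he44 : Real.exp Λs ≤ Real.exp 44 := Real.exp_le_exp.mpr hΛs44
    have he44' : Real.exp Λs + 1 ≤ 1.0001 * Real.exp 44 := by
      have : (10000 : ℝ) ≤ Real.exp 44 := by
        have h := Real.add_one_le_exp (44 : ℝ)
        have h13 := exp_13_ge
        have : Real.exp 13 ≤ Real.exp 44 := Real.exp_le_exp.mpr (by norm_num)
        linarith
      linarith
    have hpos1 : 0 ≤ Real.exp Λs + 1 := by positivity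
    have hx13 : Real.exp 88 * Real.exp (-49.5) ≤ Real.exp (-13) * x := by
      have e1 : Real.exp 88 * Real.exp (-49.5) = Real.exp (-13) * Real.exp 51.5 := by
        rw [← Real.exp_add, ← Real.exp_add]; norm_num
      rw [e1]
      exact mul_le_mul_of_nonneg_left hx515 (Real.exp_pos _).le
    have h13 : Real.exp (-13) ≤ 1 / 442000 := by
      rw [Real.exp_neg, one_div]
      exact inv_anti₀ (by norm_num) exp_13_ge
    have e88 : Real.exp 44 * Real.exp 44 = Real.exp 88 := by rw [← Real.exp_add]; norm_num
    calc (#Elo : ℝ) * ((Real.exp Λs + 1) * (2450.25 * Real.exp (-49.5)))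
        ≤ (Real.exp Λs + 1) * ((Real.exp Λs + 1) * (2450.25 * Real.exp (-49.5))) :=
          mul_le_mul_of_nonneg_right hcard (by positivity)
      _ ≤ (1.0001 * Real.exp 44) * ((1.0001 * Real.exp 44) * (2450.25 * Real.exp (-49.5))) :=
          mul_le_mul he44' (mul_le_mul_of_nonneg_right he44' (by positivity)) (by positivity) (by positivity)
      _ = 1.0001 ^ 2 * 2450.25 * (Real.exp 88 * Real.exp (-49.5)) := by rw [← e88]; ring
      _ ≤ 1.0001 ^ 2 * 2450.25 * (Real.exp (-13) * x) := mul_le_mul_of_nonneg_left hx13 (by norm_num)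
      _ ≤ 1.0001 ^ 2 * 2450.25 * ((1 / 442000) * x) :=
          mul_le_mul_of_nonneg_left (mul_le_mul_of_nonneg_right h13 hx0.le) (by norm_num)
      _ ≤ 0.0056 * x := by nlinarith
  -- UPPER, pointwise on `T = {N ∈ Ehi : r(N) > 0}`: `r·m ≤ A·f`
  set T : Finset ℕ := Ehi.filter fun N => 0 < SingularSeries.goldbachCount N with hT
  have hpoint : ∀ N ∈ T, r N * m N ≤ A * f N := by
    intro N hN
    rw [hT, mem_filter, hEhi, mem_filter, hE, mem_filter, mem_range] at hN
    obtain ⟨⟨⟨hNx, hev⟩, hNΛ⟩, _⟩ := hN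
    have hNx' : (N : ℝ) ≤ x := by exact_mod_cast Nat.lt_succ_iff.mp hNx
    by_cases hQ : stairT x 200 < (N : ℝ)
    · exact stair_rm_le_main200 hxN hΛs0 hA0 hpt hbotΛ hev hNx' hQ
    · exact stair_rm_le_bottom200 hxN (by linarith) hA0 hpt hev hNΛ (not_lt.mp hQ)
  have hsumT : ∑ N ∈ Ehi, r N * m N = ∑ N ∈ T, r N * m N := by
    have h := Finset.sum_filter_of_ne (s := Ehi) (f := fun N => r N * m N)
      (p := fun N => 0 < SingularSeries.goldbachCount N) (fun N _ hne => by
        by_contra h0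
        apply hne
        simp only [not_lt, Nat.le_zero] at h0
        simp [hr, h0])
    rw [hT, h]
  have hupper : ∑ N ∈ T, r N * m N ≤ A * ∑ N ∈ T, f N := by
    rw [mul_sum]
    exact sum_le_sum hpoint
  -- `F·x ≤ A·Σ_T f`
  have hx21 : (21 : ℝ) + 0.0056 * x ≤ 0.0057 * x + 0 := by
    have : (210000 : ℝ) ≤ x := by
      have h13 := exp_13_ge
      have : Real.exp 13 ≤ Real.exp 51.5 := Real.exp_le_exp.mpr (by norm_num)
      linarith
    linarith
  have hFx : F * x ≤ A * ∑ N ∈ T, f N := by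
    have h1 : c₁' * (g * x - 21) - 0.0056 * x ≤ ∑ N ∈ T, r N * m N := by
      rw [← hsumT]; linarith [hsplit, hlower, hlo]
    have h2 : F * x ≤ c₁' * (g * x - 21) - 0.0056 * x := by
      rw [hF_def]
      have : c₁' * 21 ≤ 21 := by nlinarith
      nlinarith
    exact h2.trans (h1.trans hupper)
  -- Hölder on `T`
  set Ep : Finset ℕ := (Ioc 0 x).filter Even with hEp
  have hTA : T ⊆ {N ∈ Ioc 0 x | Even N ∧ ∃ p q : ℕ, p.Prime ∧ q.Prime ∧ p + q = N} := by
    intro N hN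
    rw [hT, mem_filter, hEhi, mem_filter, hE, mem_filter, mem_range] at hN
    obtain ⟨⟨⟨hNx, he⟩, _⟩, hpos⟩ := hN
    unfold SingularSeries.goldbachCount at hpos
    obtain ⟨pq, hpq⟩ := card_pos.mp hpos
    rw [mem_filter, Finset.HasAntidiagonal.mem_antidiagonal] at hpq
    have hN2 : 2 ≤ N := by
      have := hpq.2.1.two_le
      omega
    rw [mem_filter, mem_Ioc]
    exact ⟨⟨by omega, by omega⟩, he, pq.1, pq.2, hpq.2.1, hpq.2.2, hpq.1⟩
  have hTEp : T ⊆ Ep := by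
    intro N hN
    have h := hTA hN
    rw [mem_filter] at h
    rw [hEp, mem_filter]
    exact ⟨h.1, h.2.1⟩
  have hf0 : ∀ N ∈ T, 0 ≤ f N := fun N _ => oddSingularFactor_nonneg N
  have hHolder : (∑ N ∈ T, f N) ^ 8 ≤ (#T : ℝ) ^ 7 * (259.55 * x) := by
    have h1 := pow8_sum_le T f hf0
    have h2 : ∑ N ∈ T, f N ^ 8 ≤ 259.55 * x :=
      (sum_le_sum_of_subset_of_nonneg hTEp fun N _ _ => by positivity).trans
        (sum_even_oddSingularFactor_pow8_le x)
    exact h1.trans (mul_le_mul_of_nonneg_left h2 (by positivity))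
  set Ax : ℝ := ((#{N ∈ Ioc 0 x | Even N ∧ ∃ p q : ℕ, p.Prime ∧ q.Prime ∧ p + q = N} : ℕ) : ℝ) with hAx
  have hTcard : (#T : ℝ) ≤ Ax := by rw [hAx]; exact_mod_cast card_le_card hTA
  -- the final algebra: `(F x)⁸ ≤ A⁸·|T|⁷·259.55·x` and `κ⁷·259.55·A⁸ ≤ F⁸` give `|T| ≥ κ·x`
  have hF0' : 0 ≤ F := hF0
  have hFx0 : 0 ≤ F * x := mul_nonneg hF0' hx0.le
  have hchain : (F * x) ^ 8 ≤ A ^ 8 * ((#T : ℝ) ^ 7 * (259.55 * x)) := by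
    calc (F * x) ^ 8 ≤ (A * ∑ N ∈ T, f N) ^ 8 := pow_le_pow_left₀ hFx0 hFx 8
      _ = A ^ 8 * (∑ N ∈ T, f N) ^ 8 := by ring
      _ ≤ A ^ 8 * ((#T : ℝ) ^ 7 * (259.55 * x)) := mul_le_mul_of_nonneg_left hHolder (by positivity)
  by_contra hcon
  rw [not_le] at hcon
  have hTlt : (#T : ℝ) < κ * x := lt_of_le_of_lt hTcard hcon
  have h7 : (#T : ℝ) ^ 7 < (κ * x) ^ 7 := pow_lt_pow_left₀ hTlt (by positivity) (by norm_num)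
  have hlt : A ^ 8 * ((#T : ℝ) ^ 7 * (259.55 * x)) < A ^ 8 * ((κ * x) ^ 7 * (259.55 * x)) := by
    apply mul_lt_mul_of_pos_left _ (by positivity)
    exact mul_lt_mul_of_pos_right h7 (by positivity)
  have e1 : A ^ 8 * ((κ * x) ^ 7 * (259.55 * x)) = κ ^ 7 * (259.55 * A ^ 8) * (x : ℝ) ^ 8 := by ring
  have e2 : (F * x) ^ 8 = F ^ 8 * (x : ℝ) ^ 8 := by ring
  have hκx : κ ^ 7 * (259.55 * A ^ 8) * (x : ℝ) ^ 8 ≤ F ^ 8 * (x : ℝ) ^ 8 :=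
    mul_le_mul_of_nonneg_right hκ (by positivity)
  linarith [hchain, hlt, e1, e2, hκx]

/-! #### §14.5 Instances, glue, headline -/

/-- **The tree's generic large-sieve step from `e^{41}`**: if `Λ ≥ 41` and `17L² ≤ 16(A − 0.02)·TlowK(L/2 − 1.38632)`
for all `L ≥ Λ`, then `r(N) ≤ A·f(N)·N/log²N` for every even `N ≥ e^Λ`.
[cite: BatemanDiamond2004, Thm 13.8, §13.4–13.5 pp. 325–328 (explicit form: the tree's `explicit_of_largeSieve_kappa`)] -/
theorem goldbachCount_le_of_numeric41 {Λ A : ℝ} (hΛ : 41 ≤ Λ)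
    (hnum : ∀ L : ℝ, Λ ≤ L → 17 * L ^ 2 ≤ 16 * (A - 0.02) * TwoResidueSelbergExplicit.TlowK (L / 2 - 1.38632))
    {N : ℕ} (hN : Real.exp Λ ≤ (N : ℝ)) (heven : Even N) :
    (SingularSeries.goldbachCount N : ℝ) ≤ A * oddSingularFactor N * (N : ℝ) / Real.log (N : ℝ) ^ 2 := by
  have hN41 : Real.exp 41 ≤ (N : ℝ) := (Real.exp_le_exp.mpr hΛ).trans hN
  have hN16 : 16 ≤ N := by
    have h42 : (42 : ℝ) ≤ Real.exp 41 := by have := Real.add_one_le_exp (41 : ℝ); linarith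
    have : (16 : ℝ) ≤ N := by linarith
    exact_mod_cast this
  have hX1 : 1 ≤ Nat.sqrt N / 4 := by
    have h4 : 4 ≤ Nat.sqrt N := Nat.le_sqrt.mpr (by omega)
    omega
  have hBD := GoldbachSieveEight.goldbachCount_mul_Qsum_le N (Nat.sqrt N / 4) heven hX1
  have hprod : (∏ p ∈ (N.primeFactors.filter (2 < ·)), (((p : ℝ) - 1) / ((p : ℝ) - 2)))
      = oddSingularFactor N := rfl
  rw [hprod] at hBD
  exact TwoResidueSelbergExplicit.explicit_of_largeSieve_kappa (Λ := Λ) (by linarith) hnum hN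
    (one_le_oddSingularFactor' _) (by linarith) hBD

/-- Numerics at `Λ = 44`: `17L² ≤ 16·17.32·TlowK(L/2 − 1.38632)` for `L ≥ 44`. [folklore] -/
private theorem kappa_numeric_44 {L : ℝ} (hL : 44 ≤ L) :
    17 * L ^ 2 ≤ 16 * (17.34 - 0.02) * TwoResidueSelbergExplicit.TlowK (L / 2 - 1.38632) := by
  unfold TwoResidueSelbergExplicit.TlowK
  nlinarith [hL, mul_self_nonneg (L - 44)]

/-- **`A = 17.34` above `e^44`**. [cite: BatemanDiamond2004, §13.4 (13.13)–(13.14)] -/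
theorem goldbachCount_le_1734 {N : ℕ} (hN : Real.exp 44 ≤ (N : ℝ)) (heven : Even N) :
    (SingularSeries.goldbachCount N : ℝ) ≤ 17.34 * oddSingularFactor N * (N : ℝ) / Real.log (N : ℝ) ^ 2 :=
  goldbachCount_le_of_numeric41 (by norm_num) (fun _ hL => kappa_numeric_44 hL) hN heven

/-- **Unconditional, above `e^51.5`**: at least `x/112` EVEN Goldbach numbers in `(0, x]`
(Hölder-8: `(1/112)⁷·259.55·17.34⁸ = 0.0096 ≤ (0.4242·gHol 51.5 − 0.0057)⁸ = 0.115`). [cite: Nathanson1996, Theorem 7.8 (proof, restricted to even N; explicit form proved here)] -/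
theorem goldbach_even_count_ge_112 {x : ℕ} (hx : Real.exp 51.5 ≤ (x : ℝ)) :
    (x : ℝ) / 112 ≤ #{N ∈ Ioc 0 x | Even N ∧ ∃ p q : ℕ, p.Prime ∧ q.Prime ∧ p + q = N} := by
  have h := goldbach_even_count_ge_holder (Λs := 44) (Λ₀ := 51.5) (A := 17.34) (c₁ := 0.4243) (κ := 1 / 112)
    (by norm_num) (by norm_num) (by norm_num) (by norm_num)
    (fun N hN hev => goldbachCount_le_1734 hN hev) (by norm_num) (by norm_num)
    (fun y hy => sum_goldbachCount_ge_04243' ((Real.exp_le_exp.mpr (by norm_num)).trans hy))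
    (by unfold gHol; norm_num) (by unfold gHol; norm_num) hx
  have e : (1 : ℝ) / 112 * x = x / 112 := by ring
  rw [e] at h
  exact h

/-- **Under (3.3), above `e^51.5`**: at least `x/104` EVEN Goldbach numbers in `(0, x]`.
[cite: RosserSchoenfeld1962, Theorem 2, eq. (3.3) (as input)] -/
theorem goldbach_even_count_ge_of_RS_104 (hRS : Literature.NumberTheory.LFunctions.RosserSchoenfeld1962_theorem2)
    {x : ℕ} (hx : Real.exp 51.5 ≤ (x : ℝ)) :
    (x : ℝ) / 104 ≤ #{N ∈ Ioc 0 x | Even N ∧ ∃ p q : ℕ, p.Prime ∧ q.Prime ∧ p + q = N} := by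
  have h := goldbach_even_count_ge_holder (Λs := 44) (Λ₀ := 51.5) (A := 17.34) (c₁ := 0.4995) (κ := 1 / 104)
    (by norm_num) (by norm_num) (by norm_num) (by norm_num)
    (fun N hN hev => goldbachCount_le_1734 hN hev) (by norm_num) (by norm_num)
    (fun y hy => sum_goldbachCount_ge_of_RS' hRS ((Real.exp_le_exp.mpr (by norm_num)).trans hy))
    (by unfold gHol; norm_num) (by unfold gHol; norm_num) hx
  have e : (1 : ℝ) / 104 * x = x / 104 := by ring
  rw [e] at h
  exact h

/-- **Unconditional count for all `y ≥ 1`**: `B(y) ≥ y/56` (glue `51.5 ≤ 0.9212·56`). [cite: Nathanson1996, Theorem 7.8 (explicit constant for the halved set proved here)] -/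
theorem half_count_ge_allN_56 {y : ℕ} (hy : 1 ≤ y) :
    (y : ℝ) / 56 ≤ #{b ∈ Ioc 0 y | b ∈ (({0, 1} : Set ℕ) ∪ {m | ∃ p q : ℕ, p.Prime ∧ q.Prime ∧ p + q = 2 * m})} := by
  have h := half_count_ge_allN_gen (Λ₀ := 51.5) (h := 56) (by norm_num) (by norm_num)
    (fun x hx => by
      have h1 := goldbach_even_count_ge_112 hx
      have e : (x : ℝ) / (2 * ((56 : ℕ) : ℝ)) = (x : ℝ) / 112 := by norm_num
      rw [e]
      exact h1) hy
  exact_mod_cast h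

/-- **All `y ≥ 1` for the halved set under (3.3)**: if `x/(2h) ≤ #{even N ∈ (0, x] : N = p + q}` for `x ≥ e^{Λ₀}`,
`Λ₀ ≤ h` and `h ≥ 52`, then `y/h ≤ B(y)` for every `y ≥ 1` (`π(y) ≥ y/log y` for `y ≥ 67` by (3.3),
`π(y) ≥ y/(4 log y) ≥ y/28` for `32 ≤ y < 67`). [cite: RosserSchoenfeld1962, Theorem 2, eq. (3.3) (as input)] -/
theorem half_count_ge_allN_gen_RS (hRS : Literature.NumberTheory.LFunctions.RosserSchoenfeld1962_theorem2)
    {Λ₀ : ℝ} {h : ℕ} (h52 : 52 ≤ h) (hΛh : Λ₀ ≤ h)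
    (hlarge : ∀ x : ℕ, Real.exp Λ₀ ≤ (x : ℝ) →
      (x : ℝ) / (2 * h) ≤ #{N ∈ Ioc 0 x | Even N ∧ ∃ p q : ℕ, p.Prime ∧ q.Prime ∧ p + q = N})
    {y : ℕ} (hy : 1 ≤ y) :
    (y : ℝ) / h ≤ #{b ∈ Ioc 0 y | b ∈ (({0, 1} : Set ℕ) ∪ {m | ∃ p q : ℕ, p.Prime ∧ q.Prime ∧ p + q = 2 * m})} := by
  set B : Set ℕ := ({0, 1} : Set ℕ) ∪ {m | ∃ p q : ℕ, p.Prime ∧ q.Prime ∧ p + q = 2 * m} with hB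
  have hhr : (52 : ℝ) ≤ h := by exact_mod_cast h52
  have hh0 : (0 : ℝ) < h := by linarith
  by_cases hbig : Real.exp Λ₀ ≤ ((2 * y : ℕ) : ℝ)
  · have h1 := hlarge (2 * y) hbig
    have h2 := even_goldbach_card_le_half y
    have e : ((2 * y : ℕ) : ℝ) / (2 * h) = (y : ℝ) / h := by
      push_cast
      field_simp
    rw [e] at h1
    exact h1.trans (by exact_mod_cast h2)
  rw [not_le] at hbig
  by_cases hsmall : y ≤ h
  · have h1 : 1 ≤ #{b ∈ Ioc 0 y | b ∈ B} :=
      card_pos.mpr ⟨1, by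
        rw [mem_filter, mem_Ioc]
        exact ⟨⟨by omega, hy⟩, Or.inl (by simp)⟩⟩
    have h1' : (1 : ℝ) ≤ #{b ∈ Ioc 0 y | b ∈ B} := by exact_mod_cast h1
    have h2 : (y : ℝ) / h ≤ 1 := by
      rw [div_le_one hh0]
      exact_mod_cast hsmall
    linarith
  rw [not_le] at hsmall
  have hP : #((range (y + 1)).filter Nat.Prime) ≤ #{b ∈ Ioc 0 y | b ∈ B} := card_le_card fun p hp => by
    rw [mem_filter, mem_range] at hp
    rw [mem_filter, mem_Ioc]
    exact ⟨⟨hp.2.pos, by omega⟩, Or.inr ⟨p, p, hp.2, hp.2, by ring⟩⟩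
  rw [card_filter_prime_range] at hP
  have hPr : (Nat.primeCounting y : ℝ) ≤ #{b ∈ Ioc 0 y | b ∈ B} := by exact_mod_cast hP
  refine le_trans ?_ hPr
  have hy1 : (1 : ℝ) < y := by exact_mod_cast (show 1 < y by omega)
  have hy0 : (0 : ℝ) < y := by linarith
  have hlogpos : 0 < Real.log y := Real.log_pos hy1
  have hlogy : Real.log y < Λ₀ := by
    have h2y : (y : ℝ) ≤ ((2 * y : ℕ) : ℝ) := by push_cast; linarith
    have := Real.log_lt_log hy0 (lt_of_le_of_lt h2y hbig)
    rwa [Real.log_exp] at this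
  by_cases h67 : 67 ≤ y
  · have hπ : 1 * (y : ℝ) / Real.log (y : ℝ) ≤ (Nat.primeCounting y : ℝ) := by
      have := primeCountingLowerMul_one_of_RS hRS
      unfold PrimeCountingLowerMul at this
      exact this y h67
    refine le_trans ?_ hπ
    rw [one_mul, div_le_div_iff₀ hh0 hlogpos]
    have hlh : Real.log y ≤ h := by linarith
    nlinarith [mul_le_mul_of_nonneg_left hlh hy0.le]
  · rw [not_le] at h67
    have hy32 : 32 ≤ y := by omega
    have hπ := ShnirelmanGoldbachTheorem.primeCounting_ge hy32
    have hlog7 : Real.log y ≤ 7 := by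
      have hy7 : (y : ℝ) ≤ (2 : ℝ) ^ 7 := by
        have : (y : ℝ) < 67 := by exact_mod_cast h67
        have h27 : (67 : ℝ) ≤ (2 : ℝ) ^ 7 := by norm_num
        linarith
      have he : (2 : ℝ) ≤ Real.exp 1 := by have := Real.add_one_le_exp (1 : ℝ); linarith
      have h7 : (2 : ℝ) ^ 7 ≤ Real.exp 7 := by
        rw [show (7 : ℝ) = ((7 : ℕ) : ℝ) * 1 by norm_num, Real.exp_nat_mul]
        exact pow_le_pow_left₀ (by norm_num) he 7
      have := Real.log_le_log hy0 (hy7.trans h7)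
      rwa [Real.log_exp] at this
    refine le_trans ?_ hπ
    apply div_le_div_of_nonneg_left hy0.le (by positivity)
    linarith

/-- **Under (3.3), all `y ≥ 1`**: `B(y) ≥ y/52` (glue `51.5 ≤ 52`). [cite: RosserSchoenfeld1962, Theorem 2, eq. (3.3) (as input)] -/
theorem half_count_ge_allN_of_RS_52 (hRS : Literature.NumberTheory.LFunctions.RosserSchoenfeld1962_theorem2)
    {y : ℕ} (hy : 1 ≤ y) :
    (y : ℝ) / 52 ≤ #{b ∈ Ioc 0 y | b ∈ (({0, 1} : Set ℕ) ∪ {m | ∃ p q : ℕ, p.Prime ∧ q.Prime ∧ p + q = 2 * m})} := by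
  have h := half_count_ge_allN_gen_RS hRS (Λ₀ := 51.5) (h := 52) (by norm_num) (by norm_num)
    (fun x hx => by
      have h1 := goldbach_even_count_ge_of_RS_104 hRS hx
      have e : (x : ℝ) / (2 * ((52 : ℕ) : ℝ)) = (x : ℝ) / 104 := by norm_num
      rw [e]
      exact h1) hy
  exact_mod_cast h

/-- **The halved density, `1/56`**: `σ({0, 1} ∪ {m : 2m = p + q}) ≥ 1/56`, unconditionally. [cite: Nathanson1996, Theorem 7.8 (explicit constant for the halved set proved here)] -/
theorem schnirelmannDensity_half_ge_56 :
    (1 : ℝ) / 56 ≤ schnirelmannDensity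
      (({0, 1} : Set ℕ) ∪ {m | ∃ p q : ℕ, p.Prime ∧ q.Prime ∧ p + q = 2 * m}) := by
  have h := schnirelmannDensity_ge_of_count' (K := 56)
    (S := ({0, 1} : Set ℕ) ∪ {m | ∃ p q : ℕ, p.Prime ∧ q.Prime ∧ p + q = 2 * m})
    (fun N hN => by have := half_count_ge_allN_56 hN; exact_mod_cast this)
  exact_mod_cast h

/-- **The halved density under (3.3), `1/52`**. [cite: RosserSchoenfeld1962, Theorem 2, eq. (3.3) (as input)] -/
theorem schnirelmannDensity_half_ge_of_RS_52
    (hRS : Literature.NumberTheory.LFunctions.RosserSchoenfeld1962_theorem2) :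
    (1 : ℝ) / 52 ≤ schnirelmannDensity
      (({0, 1} : Set ℕ) ∪ {m | ∃ p q : ℕ, p.Prime ∧ q.Prime ∧ p + q = 2 * m}) := by
  have h := schnirelmannDensity_ge_of_count' (K := 52)
    (S := ({0, 1} : Set ℕ) ∪ {m | ∃ p q : ℕ, p.Prime ∧ q.Prime ∧ p + q = 2 * m})
    (fun N hN => by have := half_count_ge_allN_of_RS_52 hRS hN; exact_mod_cast this)
  exact_mod_cast h

/-- ★★★★★★ **The Shnirel'man–Goldbach theorem, explicit and unconditional — the best constant of this file: every
integer `N ≥ 2` is a sum of at most `113` primes** (HÖLDER-8 in place of Cauchy–Schwarz: the flattened first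
moment `Σ r·m ≥ 0.4242·(1.8136x − 21)`, the pointwise sieve bound `r·m ≤ 17.34·f` above `e^44`, the eighth moment
`Σ_{even} f⁸ ≤ 259.55x`, `(Σ_T f)⁸ ≤ |T|⁷Σ_T f⁸`: `|T| ≥ x/112` above `e^51.5`; Chebyshev's `0.9212`: `51.5 ≤ 0.9212·56`;
halving, Mann: `56 • B = ℕ`, `2·56 + 1`).  No hypotheses, no named facts.
[cite: Nathanson1996, Thm 7.9 (explicit constant proved here)] -/
theorem schnirelmann_goldbach_le_113 (N : ℕ) (hN : 2 ≤ N) :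
    ∃ M : Multiset ℕ, (∀ p ∈ M, p.Prime) ∧ Multiset.card M ≤ 113 ∧ M.sum = N := by
  have hσ : (1 : ℝ) / ((56 : ℕ) : ℝ) ≤ schnirelmannDensity
      (({0, 1} : Set ℕ) ∪ {m | ∃ p q : ℕ, p.Prime ∧ q.Prime ∧ p + q = 2 * m}) := by
    have := schnirelmannDensity_half_ge_56
    exact_mod_cast this
  exact sum_of_primes_of_half_density_mann (h := 56) (by norm_num) hσ N hN

/-- ★★ **Under Rosser–Schoenfeld (3.3): every integer `N ≥ 2` is a sum of at most `105` primes** (`σ(B) ≥ 1/52`;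
the glue uses `π(y) ≥ y/log y`, `y ≥ 67`). [cite: RosserSchoenfeld1962, Theorem 2, eq. (3.3) (as input)] -/
theorem schnirelmann_goldbach_of_RS_le_105 (hRS : Literature.NumberTheory.LFunctions.RosserSchoenfeld1962_theorem2)
    (N : ℕ) (hN : 2 ≤ N) :
    ∃ M : Multiset ℕ, (∀ p ∈ M, p.Prime) ∧ Multiset.card M ≤ 105 ∧ M.sum = N := by
  have hσ : (1 : ℝ) / ((52 : ℕ) : ℝ) ≤ schnirelmannDensity
      (({0, 1} : Set ℕ) ∪ {m | ∃ p q : ℕ, p.Prime ∧ q.Prime ∧ p + q = 2 * m}) := by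
    have := schnirelmannDensity_half_ge_of_RS_52 hRS
    exact_mod_cast this
  exact sum_of_primes_of_half_density_mann (h := 52) (by norm_num) hσ N hN

/-! ## §15 ROUND-30 «SHIFT»: the shifted embedding `p ↦ (p+3)/2` in the all-`y` glue — `K = 77` (RS: `65`)

The near-miss of §14 is its GLUE: `half_count_ge_allN_gen` embeds the primes into the halved set
`B = {0,1} ∪ {m : 2m = p+q}` by `p ↦ p` (`2p = p + p`), so that only `B(y) ≥ π(y)` is used below the count
threshold; this costs `h ≥ 4·log 10⁶`, i.e. `h ≥ 56`, and `Λ₀ ≤ 0.9212·h`, and after the Hölder count of §14 (which has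
a factor `12` to spare at `κ = 1/112`) it is the binding constraint.  ONE INPUT VARIED: embed by `p ↦ (p+3)/2`
instead (`2·((p+3)/2) = p + 3` for odd `p`, `(2+3)/2 = 2 = (2+2)/2`), which is injective on the primes `p ≤ 2y − 3`
with image in `[2, y] ∩ B`; with `1 ∈ B` this gives `B(y) ≥ π(2y − 3) + 1` (`primeCounting_shift_le_half_count`) —
TWICE the density of primes.  The glue then needs only `h ≥ 28` (`π(n) ≥ n/(4 log n) ≥ n/56` below `10⁶`) and
`Λ₀ ≤ 1.8424·h` (`π(n) ≥ 0.9212·n/log n` above; `half_count_ge_allN_shift`), resp. `Λ₀ ≤ 2h` under Rosser–Schoenfeld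
(3.3) (`half_count_ge_allN_shift_RS`), and the constant becomes COUNT-limited.  The count threshold `Λ₀` being free
up to `1.8424·h`, the sieve threshold follows it: `goldbach_even_count_ge_holder_gap` is §14's Hölder count with the
gap condition `2Λs ≤ Λ₀ + 36.5` in place of `Λs ≤ 44` (same trivial discard `≤ 0.0056·x` of the `N < e^{Λs}`), run at
`Λs = 53` (`A = 16.5`, `kappa_numeric_53`), `Λ₀ = 70 ≤ 1.8424·38`, `κ = 1/76`
(`(1/76)⁷·259.55·16.5⁸ = 0.097 ≤ (0.4242·gHol 70 − 0.0057)⁸ = 0.120`): `x/76` even Goldbach numbers above `e^70`,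
`σ(B) ≥ 1/38`, Mann, **`schnirelmann_goldbach_le_77`**; under (3.3): `Λs = 50` (`A = 16.75`), `Λ₀ = 64 ≤ 2·32`,
`x/64`, `σ(B) ≥ 1/32`, `schnirelmann_goldbach_of_RS_le_65`. -/

/-! #### §15.1 The shifted embedding and the new glue -/

/-- **The shifted embedding**: `π(2y − 3) + 1 ≤ B(y)` for `y ≥ 2`, `B = {0,1} ∪ {m : 2m = p + q}`: the map
`p ↦ (p + 3)/2` is injective on the primes `p ≤ 2y − 3`, lands in `(0, y]`, and its values lie in `B`
(`2·((p+3)/2) = p + 3` for odd `p`; `(2+3)/2 = 2` and `2·2 = 2 + 2`); moreover `1 ∈ B` is not a value. [cite: Nathanson1996, Theorem 7.8 (shifted embedding of the primes into the halved set; proved here)] -/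
theorem primeCounting_shift_le_half_count {y : ℕ} (hy : 2 ≤ y) :
    Nat.primeCounting (2 * y - 3) + 1
      ≤ #{b ∈ Ioc 0 y | b ∈ (({0, 1} : Set ℕ) ∪ {m | ∃ p q : ℕ, p.Prime ∧ q.Prime ∧ p + q = 2 * m})} := by
  set B : Set ℕ := ({0, 1} : Set ℕ) ∪ {m | ∃ p q : ℕ, p.Prime ∧ q.Prime ∧ p + q = 2 * m} with hB
  have hinj : Set.InjOn (fun p : ℕ => (p + 3) / 2) ↑((range (2 * y - 3 + 1)).filter Nat.Prime) := by
    intro p hp q hq hpq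
    rw [mem_coe, mem_filter] at hp hq
    simp only at hpq
    have hp2 := hp.2.two_le
    have hq2 := hq.2.two_le
    rcases hp.2.eq_two_or_odd with h2 | h2 <;> rcases hq.2.eq_two_or_odd with h2' | h2' <;> omega
  have h1 : (1 : ℕ) ∉ ((range (2 * y - 3 + 1)).filter Nat.Prime).image (fun p : ℕ => (p + 3) / 2) := by
    rw [mem_image]
    rintro ⟨p, hp, hp1⟩
    rw [mem_filter] at hp
    have := hp.2.two_le
    omega
  have hsub : insert 1 (((range (2 * y - 3 + 1)).filter Nat.Prime).image (fun p : ℕ => (p + 3) / 2))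
      ⊆ {b ∈ Ioc 0 y | b ∈ B} := by
    intro b hb
    rw [mem_insert] at hb
    rw [mem_filter, mem_Ioc]
    rcases hb with rfl | hb
    · exact ⟨⟨by omega, by omega⟩, Or.inl (by simp)⟩
    · rw [mem_image] at hb
      obtain ⟨p, hp, rfl⟩ := hb
      rw [mem_filter, mem_range] at hp
      obtain ⟨hpy, hpp⟩ := hp
      have hp2 := hpp.two_le
      refine ⟨⟨by omega, by omega⟩, ?_⟩
      rcases hpp.eq_two_or_odd with h2 | h2
      · subst h2
        exact Or.inr ⟨2, 2, Nat.prime_two, Nat.prime_two, by norm_num⟩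
      · exact Or.inr ⟨p, 3, hpp, Nat.prime_three, by omega⟩
  have hcard := card_le_card hsub
  rw [card_insert_of_notMem h1, card_image_of_injOn hinj, card_filter_prime_range] at hcard
  exact hcard

/-- `((2y − 3 : ℕ) : ℝ) = 2y − 3` for `y ≥ 2`. [folklore] -/
private theorem cast_two_mul_sub_three {y : ℕ} (hy : 2 ≤ y) : ((2 * y - 3 : ℕ) : ℝ) = 2 * (y : ℝ) - 3 := by
  have h3y : 3 ≤ 2 * y := by omega
  rw [Nat.cast_sub h3y]
  push_cast
  ring

/-- `log n ≤ 14` for `n < 10⁶` (`10⁶ ≤ 2.7¹⁴ ≤ e¹⁴`). [folklore] -/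
private theorem log_le_14_of_lt {n : ℕ} (hn0 : 0 < n) (h6 : n < 10 ^ 6) : Real.log (n : ℝ) ≤ 14 := by
  have hn0' : (0 : ℝ) < n := by exact_mod_cast hn0
  have hy6 : (n : ℝ) ≤ (2.7 : ℝ) ^ 14 := by
    have : (n : ℝ) < 10 ^ 6 := by exact_mod_cast h6
    have h27 : (10 : ℝ) ^ 6 ≤ (2.7 : ℝ) ^ 14 := by norm_num
    linarith
  have he : (2.7 : ℝ) ≤ Real.exp 1 := by have := Real.exp_one_gt_d9; linarith
  have h14 : (2.7 : ℝ) ^ 14 ≤ Real.exp 14 := by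
    rw [show (14 : ℝ) = ((14 : ℕ) : ℝ) * 1 by norm_num, Real.exp_nat_mul]
    exact pow_le_pow_left₀ (by norm_num) he 14
  have := Real.log_le_log hn0' (hy6.trans h14)
  rwa [Real.log_exp] at this

/-- **All `y ≥ 1` for the halved set, SHIFTED glue**: if `x/(2h) ≤ #{even N ∈ (0, x] : N = p + q}` for `x ≥ e^{Λ₀}`,
`Λ₀ ≤ 1.8424·h` and `h ≥ 28`, then `y/h ≤ B(y)` for every `y ≥ 1`: `2y ≥ e^{Λ₀}` halve; `y ≤ h`: `1 ∈ B`; otherwise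
`B(y) ≥ π(2y−3) + 1` by the shifted embedding, and `π(n) ≥ 0.9212·n/log n ≥ 0.9212·n/Λ₀` (`n = 2y − 3 ≥ 10⁶`,
`log n < Λ₀`) or `π(n) ≥ n/(4 log n) ≥ n/56` (`55 ≤ n < 10⁶`). [cite: Nathanson1996, Theorem 7.8 (explicit all-y count for the halved set via the shifted embedding; proved here)] -/
theorem half_count_ge_allN_shift {Λ₀ : ℝ} {h : ℕ} (h28 : 28 ≤ h) (hΛ3 : 3 ≤ Λ₀) (hΛh : Λ₀ ≤ 1.8424 * h)
    (hlarge : ∀ x : ℕ, Real.exp Λ₀ ≤ (x : ℝ) →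
      (x : ℝ) / (2 * h) ≤ #{N ∈ Ioc 0 x | Even N ∧ ∃ p q : ℕ, p.Prime ∧ q.Prime ∧ p + q = N})
    {y : ℕ} (hy : 1 ≤ y) :
    (y : ℝ) / h ≤ #{b ∈ Ioc 0 y | b ∈ (({0, 1} : Set ℕ) ∪ {m | ∃ p q : ℕ, p.Prime ∧ q.Prime ∧ p + q = 2 * m})} := by
  set B : Set ℕ := ({0, 1} : Set ℕ) ∪ {m | ∃ p q : ℕ, p.Prime ∧ q.Prime ∧ p + q = 2 * m} with hB
  have hhr : (28 : ℝ) ≤ h := by exact_mod_cast h28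
  have hh0 : (0 : ℝ) < h := by linarith
  have hΛpos : (0 : ℝ) < Λ₀ := by linarith
  by_cases hbig : Real.exp Λ₀ ≤ ((2 * y : ℕ) : ℝ)
  · have h1 := hlarge (2 * y) hbig
    have h2 := even_goldbach_card_le_half y
    have e : ((2 * y : ℕ) : ℝ) / (2 * h) = (y : ℝ) / h := by
      push_cast
      field_simp
    rw [e] at h1
    exact h1.trans (by exact_mod_cast h2)
  rw [not_le] at hbig
  by_cases hsmall : y ≤ h
  · have h1 : 1 ≤ #{b ∈ Ioc 0 y | b ∈ B} :=
      card_pos.mpr ⟨1, by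
        rw [mem_filter, mem_Ioc]
        exact ⟨⟨by omega, hy⟩, Or.inl (by simp)⟩⟩
    have h1' : (1 : ℝ) ≤ #{b ∈ Ioc 0 y | b ∈ B} := by exact_mod_cast h1
    have h2 : (y : ℝ) / h ≤ 1 := by
      rw [div_le_one hh0]
      exact_mod_cast hsmall
    linarith
  rw [not_le] at hsmall
  -- `y > h ≥ 28`: the shifted embedding
  have hy29 : 29 ≤ y := by omega
  have hemb := primeCounting_shift_le_half_count (y := y) (by omega)
  have hembr : (Nat.primeCounting (2 * y - 3) : ℝ) + 1 ≤ #{b ∈ Ioc 0 y | b ∈ B} := by exact_mod_cast hemb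
  refine le_trans ?_ hembr
  have hnr : ((2 * y - 3 : ℕ) : ℝ) = 2 * (y : ℝ) - 3 := cast_two_mul_sub_three (by omega)
  have hy29r : (29 : ℝ) ≤ y := by exact_mod_cast hy29
  have hy0 : (0 : ℝ) < y := by linarith
  have hn55 : 55 ≤ 2 * y - 3 := by omega
  have hn0 : (0 : ℝ) < ((2 * y - 3 : ℕ) : ℝ) := by rw [hnr]; linarith
  have hn1 : (1 : ℝ) < ((2 * y - 3 : ℕ) : ℝ) := by rw [hnr]; linarith
  have hlogpos : 0 < Real.log ((2 * y - 3 : ℕ) : ℝ) := Real.log_pos hn1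
  have hlogn : Real.log ((2 * y - 3 : ℕ) : ℝ) < Λ₀ := by
    have h2y : ((2 * y - 3 : ℕ) : ℝ) < ((2 * y : ℕ) : ℝ) := by rw [hnr]; push_cast; linarith
    have := Real.log_lt_log hn0 (h2y.trans hbig)
    rwa [Real.log_exp] at this
  by_cases h6 : 10 ^ 6 ≤ 2 * y - 3
  · have hπ : 0.9212 * ((2 * y - 3 : ℕ) : ℝ) / Real.log ((2 * y - 3 : ℕ) : ℝ)
        ≤ (Nat.primeCounting (2 * y - 3) : ℝ) := by
      have := primeCountingLowerMul_09212
      unfold PrimeCountingLowerMul at this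
      exact this (2 * y - 3) h6
    have h2 : 0.9212 * ((2 * y - 3 : ℕ) : ℝ) / Λ₀
        ≤ 0.9212 * ((2 * y - 3 : ℕ) : ℝ) / Real.log ((2 * y - 3 : ℕ) : ℝ) :=
      div_le_div_of_nonneg_left (by positivity) hlogpos hlogn.le
    have h3 : (y : ℝ) / h ≤ 1.8424 * y / Λ₀ := by
      rw [div_le_div_iff₀ hh0 hΛpos]
      nlinarith [mul_le_mul_of_nonneg_left hΛh hy0.le]
    have h4 : 1.8424 * (y : ℝ) / Λ₀ ≤ 0.9212 * ((2 * y - 3 : ℕ) : ℝ) / Λ₀ + 1 := by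
      rw [hnr]
      have e : 0.9212 * (2 * (y : ℝ) - 3) / Λ₀ = 1.8424 * y / Λ₀ - 2.7636 / Λ₀ := by
        field_simp
        ring
      rw [e]
      have : 2.7636 / Λ₀ ≤ 1 := by
        rw [div_le_one hΛpos]
        linarith
      linarith
    linarith [h2, h3, h4, hπ]
  · rw [not_le] at h6
    have hn32 : 32 ≤ 2 * y - 3 := by omega
    have hπ := ShnirelmanGoldbachTheorem.primeCounting_ge hn32
    have hlog14 : Real.log ((2 * y - 3 : ℕ) : ℝ) ≤ 14 := log_le_14_of_lt (by omega) h6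
    have h5 : ((2 * y - 3 : ℕ) : ℝ) / 56 ≤ ((2 * y - 3 : ℕ) : ℝ) / (4 * Real.log ((2 * y - 3 : ℕ) : ℝ)) :=
      div_le_div_of_nonneg_left hn0.le (by positivity) (by linarith)
    have h6' : (y : ℝ) / h ≤ (y : ℝ) / 28 := div_le_div_of_nonneg_left hy0.le (by norm_num) hhr
    have h7 : ((2 * y - 3 : ℕ) : ℝ) / 56 + 1 - (y : ℝ) / 28 = 53 / 56 := by
      rw [hnr]
      ring
    linarith [hπ, h5, h6', h7]

/-- **All `y ≥ 1` for the halved set under (3.3), SHIFTED glue**: if `x/(2h) ≤ #{even N ∈ (0, x] : N = p + q}` for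
`x ≥ e^{Λ₀}`, `Λ₀ ≤ 2h` and `h ≥ 28`, then `y/h ≤ B(y)` for every `y ≥ 1` (`π(n) ≥ n/log n ≥ n/Λ₀` for `n = 2y−3 ≥ 67`
by (3.3); `π(n) ≥ n/(4 log n) ≥ n/28` for `55 ≤ n < 67`). [cite: RosserSchoenfeld1962, Theorem 2, eq. (3.3) (as input)] -/
theorem half_count_ge_allN_shift_RS (hRS : Literature.NumberTheory.LFunctions.RosserSchoenfeld1962_theorem2)
    {Λ₀ : ℝ} {h : ℕ} (h28 : 28 ≤ h) (hΛ3 : 3 ≤ Λ₀) (hΛh : Λ₀ ≤ 2 * h)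
    (hlarge : ∀ x : ℕ, Real.exp Λ₀ ≤ (x : ℝ) →
      (x : ℝ) / (2 * h) ≤ #{N ∈ Ioc 0 x | Even N ∧ ∃ p q : ℕ, p.Prime ∧ q.Prime ∧ p + q = N})
    {y : ℕ} (hy : 1 ≤ y) :
    (y : ℝ) / h ≤ #{b ∈ Ioc 0 y | b ∈ (({0, 1} : Set ℕ) ∪ {m | ∃ p q : ℕ, p.Prime ∧ q.Prime ∧ p + q = 2 * m})} := by
  set B : Set ℕ := ({0, 1} : Set ℕ) ∪ {m | ∃ p q : ℕ, p.Prime ∧ q.Prime ∧ p + q = 2 * m} with hB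
  have hhr : (28 : ℝ) ≤ h := by exact_mod_cast h28
  have hh0 : (0 : ℝ) < h := by linarith
  have hΛpos : (0 : ℝ) < Λ₀ := by linarith
  by_cases hbig : Real.exp Λ₀ ≤ ((2 * y : ℕ) : ℝ)
  · have h1 := hlarge (2 * y) hbig
    have h2 := even_goldbach_card_le_half y
    have e : ((2 * y : ℕ) : ℝ) / (2 * h) = (y : ℝ) / h := by
      push_cast
      field_simp
    rw [e] at h1
    exact h1.trans (by exact_mod_cast h2)
  rw [not_le] at hbig
  by_cases hsmall : y ≤ h
  · have h1 : 1 ≤ #{b ∈ Ioc 0 y | b ∈ B} :=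
      card_pos.mpr ⟨1, by
        rw [mem_filter, mem_Ioc]
        exact ⟨⟨by omega, hy⟩, Or.inl (by simp)⟩⟩
    have h1' : (1 : ℝ) ≤ #{b ∈ Ioc 0 y | b ∈ B} := by exact_mod_cast h1
    have h2 : (y : ℝ) / h ≤ 1 := by
      rw [div_le_one hh0]
      exact_mod_cast hsmall
    linarith
  rw [not_le] at hsmall
  have hy29 : 29 ≤ y := by omega
  have hemb := primeCounting_shift_le_half_count (y := y) (by omega)
  have hembr : (Nat.primeCounting (2 * y - 3) : ℝ) + 1 ≤ #{b ∈ Ioc 0 y | b ∈ B} := by exact_mod_cast hemb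
  refine le_trans ?_ hembr
  have hnr : ((2 * y - 3 : ℕ) : ℝ) = 2 * (y : ℝ) - 3 := cast_two_mul_sub_three (by omega)
  have hy29r : (29 : ℝ) ≤ y := by exact_mod_cast hy29
  have hy0 : (0 : ℝ) < y := by linarith
  have hn55 : 55 ≤ 2 * y - 3 := by omega
  have hn0 : (0 : ℝ) < ((2 * y - 3 : ℕ) : ℝ) := by rw [hnr]; linarith
  have hn1 : (1 : ℝ) < ((2 * y - 3 : ℕ) : ℝ) := by rw [hnr]; linarith
  have hlogpos : 0 < Real.log ((2 * y - 3 : ℕ) : ℝ) := Real.log_pos hn1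
  have hlogn : Real.log ((2 * y - 3 : ℕ) : ℝ) < Λ₀ := by
    have h2y : ((2 * y - 3 : ℕ) : ℝ) < ((2 * y : ℕ) : ℝ) := by rw [hnr]; push_cast; linarith
    have := Real.log_lt_log hn0 (h2y.trans hbig)
    rwa [Real.log_exp] at this
  by_cases h67 : 67 ≤ 2 * y - 3
  · have hπ : 1 * ((2 * y - 3 : ℕ) : ℝ) / Real.log ((2 * y - 3 : ℕ) : ℝ)
        ≤ (Nat.primeCounting (2 * y - 3) : ℝ) := by
      have := primeCountingLowerMul_one_of_RS hRS
      unfold PrimeCountingLowerMul at this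
      exact this (2 * y - 3) h67
    rw [one_mul] at hπ
    have h2 : ((2 * y - 3 : ℕ) : ℝ) / Λ₀ ≤ ((2 * y - 3 : ℕ) : ℝ) / Real.log ((2 * y - 3 : ℕ) : ℝ) :=
      div_le_div_of_nonneg_left hn0.le hlogpos hlogn.le
    have h3 : (y : ℝ) / h ≤ 2 * y / Λ₀ := by
      rw [div_le_div_iff₀ hh0 hΛpos]
      nlinarith [mul_le_mul_of_nonneg_left hΛh hy0.le]
    have h4 : 2 * (y : ℝ) / Λ₀ ≤ ((2 * y - 3 : ℕ) : ℝ) / Λ₀ + 1 := by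
      rw [hnr]
      have e : (2 * (y : ℝ) - 3) / Λ₀ = 2 * y / Λ₀ - 3 / Λ₀ := by
        field_simp
      rw [e]
      have : 3 / Λ₀ ≤ 1 := by
        rw [div_le_one hΛpos]
        linarith
      linarith
    linarith [h2, h3, h4, hπ]
  · rw [not_le] at h67
    have hn32 : 32 ≤ 2 * y - 3 := by omega
    have hπ := ShnirelmanGoldbachTheorem.primeCounting_ge hn32
    have hlog7 : Real.log ((2 * y - 3 : ℕ) : ℝ) ≤ 7 := by
      have hy7 : ((2 * y - 3 : ℕ) : ℝ) ≤ (2 : ℝ) ^ 7 := by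
        have : ((2 * y - 3 : ℕ) : ℝ) < 67 := by exact_mod_cast h67
        have h27 : (67 : ℝ) ≤ (2 : ℝ) ^ 7 := by norm_num
        linarith
      have he : (2 : ℝ) ≤ Real.exp 1 := by have := Real.add_one_le_exp (1 : ℝ); linarith
      have h7 : (2 : ℝ) ^ 7 ≤ Real.exp 7 := by
        rw [show (7 : ℝ) = ((7 : ℕ) : ℝ) * 1 by norm_num, Real.exp_nat_mul]
        exact pow_le_pow_left₀ (by norm_num) he 7
      have := Real.log_le_log hn0 (hy7.trans h7)
      rwa [Real.log_exp] at this
    have h5 : ((2 * y - 3 : ℕ) : ℝ) / 28 ≤ ((2 * y - 3 : ℕ) : ℝ) / (4 * Real.log ((2 * y - 3 : ℕ) : ℝ)) :=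
      div_le_div_of_nonneg_left hn0.le (by positivity) (by linarith)
    have h6' : (y : ℝ) / h ≤ (y : ℝ) / 28 := div_le_div_of_nonneg_left hy0.le (by norm_num) hhr
    have h7 : ((2 * y - 3 : ℕ) : ℝ) / 28 + 1 - (y : ℝ) / 28 = ((y : ℝ) + 25) / 28 := by
      rw [hnr]
      ring
    have h8 : 0 ≤ ((y : ℝ) + 25) / 28 := by positivity
    linarith [hπ, h5, h6', h7, h8]

/-! #### §15.2 The Hölder count with a generic threshold gap -/

set_option maxHeartbeats 1600000 in
/-- **Hölder with the staircase weight (`J = 200`), generic threshold gap**: §14's `goldbach_even_count_ge_holder`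
with the hypothesis `Λs ≤ 44` replaced by `2Λs ≤ Λ₀ + 36.5` (the trivial discard of the `N < e^{Λs}`:
`(e^{Λs}+1)²·2450.25·e^{−49.5} ≤ 1.0001²·2450.25·e^{Λ₀ − 13} ≤ 0.0056·x`): for `x ≥ e^{Λ₀}` (`Λ₀ ≥ 51.5`), if
`r(N) ≤ A·f(N)·N/log²N` for even `N ≥ e^{Λs}` and `S₁(y) ≥ c₁·y²/log²y` for `y ≥ e^{Λs}` (`Λs ≥ 41`), then with
`F = (c₁ − 10⁻⁴)·gHol(Λ₀) − 0.0057`: `#{even N ∈ (0,x] : N = p+q} ≥ κ·x` whenever `κ⁷·259.55·A⁸ ≤ F⁸`.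
[cite: Nathanson1996, Thm 7.8 (Hölder variant proved here)] -/
theorem goldbach_even_count_ge_holder_gap {Λs Λ₀ A c₁ κ : ℝ} (hΛs : 41 ≤ Λs) (h2Λ : 2 * Λs ≤ Λ₀ + 36.5)
    (hΛ₀ : 51.5 ≤ Λ₀)
    (hA : 1 ≤ A)
    (hpt : ∀ N : ℕ, Real.exp Λs ≤ (N : ℝ) → Even N →
      (SingularSeries.goldbachCount N : ℝ) ≤ A * oddSingularFactor N * (N : ℝ) / Real.log (N : ℝ) ^ 2)
    (hc₁ : 0.0001 ≤ c₁) (hc₁1 : c₁ ≤ 1)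
    (hS₁ : ∀ y : ℕ, Real.exp Λs ≤ (y : ℝ) →
      c₁ * ((y : ℝ) ^ 2 / Real.log y ^ 2) ≤ ∑ N ∈ range (y + 1), (SingularSeries.goldbachCount N : ℝ))
    (hF0 : 0 ≤ (c₁ - 0.0001) * gHol Λ₀ - 0.0057)
    (hκ : κ ^ 7 * (259.55 * A ^ 8) ≤ ((c₁ - 0.0001) * gHol Λ₀ - 0.0057) ^ 8)
    {x : ℕ} (hx : Real.exp Λ₀ ≤ (x : ℝ)) :
    κ * (x : ℝ) ≤ #{N ∈ Ioc 0 x | Even N ∧ ∃ p q : ℕ, p.Prime ∧ q.Prime ∧ p + q = N} := by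
  -- basics
  have hx515 : Real.exp 51.5 ≤ (x : ℝ) := (Real.exp_le_exp.mpr hΛ₀).trans hx
  have hx1 : (1 : ℝ) < x := lt_of_lt_of_le (by have := Real.add_one_le_exp (51.5 : ℝ); linarith) hx515
  have hx0 : (0 : ℝ) < x := by linarith
  have hxN : 0 < x := by exact_mod_cast hx0
  set L := Real.log (x : ℝ) with hL_def
  have hLΛ₀ : Λ₀ ≤ L := by
    have := Real.log_le_log (Real.exp_pos Λ₀) hx
    rwa [Real.log_exp] at this
  have hΛs0 : 0 < Λs := by linarith
  have hA0 : 0 ≤ A := by linarith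
  -- the bottom level `ℓ_200 ≥ Λ₀ − 2 ≥ 49.5`
  have hℓ200 : Λ₀ - 2 ≤ stairL x 200 := by
    have := stairL_ge x 200
    push_cast at this
    linarith
  have hℓ495 : 49.5 ≤ stairL x 200 := by linarith
  have hℓ3 : 3 ≤ stairL x 200 := by linarith
  have ht200 : stairT x 200 = Real.exp (stairL x 200) := by
    rw [← log_stairT hxN 200, Real.exp_log (stairT_pos hxN 200)]
  have hbotΛ : Real.exp Λs ≤ stairT x 200 := by rw [ht200]; exact Real.exp_le_exp.mpr (by linarith)
  have hbotS : Real.exp Λs + 1 ≤ stairT x 200 := by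
    rw [ht200]
    have h1 : Real.exp (Λs + 1) ≤ Real.exp (stairL x 200) := Real.exp_le_exp.mpr (by linarith)
    have h2 : Real.exp (Λs + 1) = Real.exp Λs * Real.exp 1 := by rw [Real.exp_add]
    have h3 : (2 : ℝ) ≤ Real.exp 1 := by have := Real.add_one_le_exp (1 : ℝ); linarith
    have h4 : (1 : ℝ) ≤ Real.exp Λs := by have := Real.add_one_le_exp Λs; linarith
    nlinarith [Real.exp_pos Λs]
  have hbot2 : (2 : ℝ) ≤ stairT x 200 := by
    have h4 : (1 : ℝ) ≤ Real.exp Λs := by have := Real.add_one_le_exp Λs; linarith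
    linarith
  -- notation
  set r : ℕ → ℝ := fun N => (SingularSeries.goldbachCount N : ℝ) with hr
  set f : ℕ → ℝ := fun N => oddSingularFactor N with hf_def
  set m : ℕ → ℝ := stairW x 200 with hm
  have hm0 : ∀ N, 0 ≤ m N := fun N => stairW_nonneg hxN hℓ3 N
  set c₁' := c₁ - 0.0001 with hc₁'
  have hc₁'0 : 0 ≤ c₁' := by rw [hc₁']; linarith
  have hc₁'1 : c₁' ≤ 1 := by rw [hc₁']; linarith
  set g := gHol Λ₀ with hg
  set F := c₁' * g - 0.0057 with hF_def
  set E : Finset ℕ := (range (x + 1)).filter Even with hE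
  -- LOWER: `Σ_E r·m ≥ c₁'·(g·x − 21)`
  have hlower : c₁' * (g * x - 21) ≤ ∑ N ∈ E, r N * m N := by
    rw [hm, sum_mul_stairW x 200 E r]
    have hterm : ∀ j ∈ range 200, stairC x j * (c₁' * ((stairT x j - 1) ^ 2 / stairL x j ^ 2))
        ≤ stairC x j * ∑ N ∈ E.filter (fun N : ℕ => (N : ℝ) ≤ stairT x j), r N := by
      intro j hj
      rw [mem_range] at hj
      apply mul_le_mul_of_nonneg_left _ (stairC_nonneg hxN hj hℓ3)
      rw [hE, hr]
      exact level_lower' hΛs hS₁ hc₁ hxN (hbotS.trans (stairT_le_of_le x hj.le))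
    refine le_trans ?_ (sum_le_sum hterm)
    have e : ∑ j ∈ range 200, stairC x j * (c₁' * ((stairT x j - 1) ^ 2 / stairL x j ^ 2))
        = c₁' * ∑ j ∈ range 200, stairC x j * ((stairT x j - 1) ^ 2 / stairL x j ^ 2) := by
      rw [mul_sum]
      exact sum_congr rfl fun j _ => by ring
    rw [e]
    exact mul_le_mul_of_nonneg_left (stair_lower_sum_ge200 hxN (by linarith) hLΛ₀ hbot2) hc₁'0
  -- the small `N < e^{Λs}`: `Σ r·m ≤ 0.0056·x`
  set Ehi : Finset ℕ := E.filter (fun N : ℕ => Real.exp Λs ≤ (N : ℝ)) with hEhi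
  set Elo : Finset ℕ := E.filter (fun N : ℕ => ¬(Real.exp Λs ≤ (N : ℝ))) with hElo
  have hsplit : ∑ N ∈ E, r N * m N = ∑ N ∈ Ehi, r N * m N + ∑ N ∈ Elo, r N * m N :=
    (sum_filter_add_sum_filter_not E (fun N : ℕ => Real.exp Λs ≤ (N : ℝ)) (fun N => r N * m N)).symm
  have hMtop : stairMf x 200 ≤ 2450.25 * Real.exp (-49.5) := by
    show stairM x 199 ≤ _
    unfold stairM
    have ht199 := stairT_pos hxN 199
    have h1 : stairL x (199 + 1) ^ 2 / stairT x 199 ≤ stairL x 200 ^ 2 / stairT x 200 :=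
      div_le_div_of_nonneg_left (sq_nonneg _) (stairT_pos hxN 200) (stairT_le_of_le x (by norm_num))
    refine h1.trans ?_
    rw [ht200, div_le_iff₀ (Real.exp_pos _)]
    have h2 := sq_le_mul_exp hℓ495
    have e : 2450.25 * Real.exp (stairL x 200 - 49.5) = 2450.25 * Real.exp (-49.5) * Real.exp (stairL x 200) := by
      rw [show stairL x 200 - 49.5 = -49.5 + stairL x 200 by ring, Real.exp_add]; ring
    linarith [e]
  have hlo : ∑ N ∈ Elo, r N * m N ≤ 0.0056 * x := by
    have hterm : ∀ N ∈ Elo, r N * m N ≤ (Real.exp Λs + 1) * (2450.25 * Real.exp (-49.5)) := by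
      intro N hN
      rw [hElo, mem_filter] at hN
      have hNlt : (N : ℝ) < Real.exp Λs := not_le.mp hN.2
      have h1 : r N ≤ Real.exp Λs + 1 := by
        have : r N ≤ (N : ℝ) + 1 := by
          show (SingularSeries.goldbachCount N : ℝ) ≤ (N : ℝ) + 1
          exact_mod_cast goldbachCount_le_succ N
        linarith
      have h2 : m N ≤ 2450.25 * Real.exp (-49.5) := (stairW_le_stairMf hxN hℓ3 N).trans hMtop
      have hr0 : 0 ≤ r N := Nat.cast_nonneg _
      exact mul_le_mul h1 h2 (hm0 N) (by positivity)
    have hcard : (#Elo : ℝ) ≤ Real.exp Λs + 1 := by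
      have hsub : Elo ⊆ range (⌊Real.exp Λs⌋₊ + 1) := by
        intro N hN
        rw [hElo, mem_filter] at hN
        have hNlt : (N : ℝ) < Real.exp Λs := not_le.mp hN.2
        rw [mem_range]
        have := Nat.le_floor hNlt.le
        omega
      have h1 := card_le_card hsub
      rw [card_range] at h1
      have h2 : (#Elo : ℝ) ≤ (⌊Real.exp Λs⌋₊ : ℝ) + 1 := by exact_mod_cast h1
      have h3 : (⌊Real.exp Λs⌋₊ : ℝ) ≤ Real.exp Λs := Nat.floor_le (Real.exp_pos Λs).le
      linarith
    have hs := sum_le_sum hterm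
    rw [sum_const, nsmul_eq_mul] at hs
    refine hs.trans ?_
    -- `(e^Λs + 1)² · 2450.25 · e^{-49.5} ≤ 0.0056·x` from `2Λs ≤ Λ₀ + 36.5` and `e^{Λ₀} ≤ x`
    have heΛ' : Real.exp Λs + 1 ≤ 1.0001 * Real.exp Λs := by
      have : (10000 : ℝ) ≤ Real.exp Λs := by
        have h13 := exp_13_ge
        have : Real.exp 13 ≤ Real.exp Λs := Real.exp_le_exp.mpr (by linarith)
        linarith
      linarith
    have hpos1 : 0 ≤ Real.exp Λs + 1 := by positivity
    have hx13 : Real.exp (2 * Λs) * Real.exp (-49.5) ≤ Real.exp (-13) * x := by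
      have e1 : Real.exp (2 * Λs) * Real.exp (-49.5) = Real.exp (2 * Λs + -49.5) := by
        rw [← Real.exp_add]
      have e2 : Real.exp (2 * Λs + -49.5) ≤ Real.exp (-13 + Λ₀) := Real.exp_le_exp.mpr (by linarith)
      have e3 : Real.exp (-13 + Λ₀) = Real.exp (-13) * Real.exp Λ₀ := Real.exp_add _ _
      rw [e1]
      refine e2.trans ?_
      rw [e3]
      exact mul_le_mul_of_nonneg_left hx (Real.exp_pos _).le
    have h13 : Real.exp (-13) ≤ 1 / 442000 := by
      rw [Real.exp_neg, one_div]
      exact inv_anti₀ (by norm_num) exp_13_ge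
    have e2Λ : Real.exp Λs * Real.exp Λs = Real.exp (2 * Λs) := by rw [← Real.exp_add]; ring_nf
    calc (#Elo : ℝ) * ((Real.exp Λs + 1) * (2450.25 * Real.exp (-49.5)))
        ≤ (Real.exp Λs + 1) * ((Real.exp Λs + 1) * (2450.25 * Real.exp (-49.5))) :=
          mul_le_mul_of_nonneg_right hcard (by positivity)
      _ ≤ (1.0001 * Real.exp Λs) * ((1.0001 * Real.exp Λs) * (2450.25 * Real.exp (-49.5))) :=
          mul_le_mul heΛ' (mul_le_mul_of_nonneg_right heΛ' (by positivity)) (by positivity) (by positivity)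
      _ = 1.0001 ^ 2 * 2450.25 * (Real.exp (2 * Λs) * Real.exp (-49.5)) := by rw [← e2Λ]; ring
      _ ≤ 1.0001 ^ 2 * 2450.25 * (Real.exp (-13) * x) := mul_le_mul_of_nonneg_left hx13 (by norm_num)
      _ ≤ 1.0001 ^ 2 * 2450.25 * ((1 / 442000) * x) :=
          mul_le_mul_of_nonneg_left (mul_le_mul_of_nonneg_right h13 hx0.le) (by norm_num)
      _ ≤ 0.0056 * x := by nlinarith
  -- UPPER, pointwise on `T = {N ∈ Ehi : r(N) > 0}`: `r·m ≤ A·f`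
  set T : Finset ℕ := Ehi.filter fun N => 0 < SingularSeries.goldbachCount N with hT
  have hpoint : ∀ N ∈ T, r N * m N ≤ A * f N := by
    intro N hN
    rw [hT, mem_filter, hEhi, mem_filter, hE, mem_filter, mem_range] at hN
    obtain ⟨⟨⟨hNx, hev⟩, hNΛ⟩, _⟩ := hN
    have hNx' : (N : ℝ) ≤ x := by exact_mod_cast Nat.lt_succ_iff.mp hNx
    by_cases hQ : stairT x 200 < (N : ℝ)
    · exact stair_rm_le_main200 hxN hΛs0 hA0 hpt hbotΛ hev hNx' hQ
    · exact stair_rm_le_bottom200 hxN (by linarith) hA0 hpt hev hNΛ (not_lt.mp hQ)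
  have hsumT : ∑ N ∈ Ehi, r N * m N = ∑ N ∈ T, r N * m N := by
    have h := Finset.sum_filter_of_ne (s := Ehi) (f := fun N => r N * m N)
      (p := fun N => 0 < SingularSeries.goldbachCount N) (fun N _ hne => by
        by_contra h0
        apply hne
        simp only [not_lt, Nat.le_zero] at h0
        simp [hr, h0])
    rw [hT, h]
  have hupper : ∑ N ∈ T, r N * m N ≤ A * ∑ N ∈ T, f N := by
    rw [mul_sum]
    exact sum_le_sum hpoint
  -- `F·x ≤ A·Σ_T f`
  have hx21 : (21 : ℝ) + 0.0056 * x ≤ 0.0057 * x + 0 := by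
    have : (210000 : ℝ) ≤ x := by
      have h13 := exp_13_ge
      have : Real.exp 13 ≤ Real.exp 51.5 := Real.exp_le_exp.mpr (by norm_num)
      linarith
    linarith
  have hFx : F * x ≤ A * ∑ N ∈ T, f N := by
    have h1 : c₁' * (g * x - 21) - 0.0056 * x ≤ ∑ N ∈ T, r N * m N := by
      rw [← hsumT]; linarith [hsplit, hlower, hlo]
    have h2 : F * x ≤ c₁' * (g * x - 21) - 0.0056 * x := by
      rw [hF_def]
      have : c₁' * 21 ≤ 21 := by nlinarith
      nlinarith
    exact h2.trans (h1.trans hupper)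
  -- Hölder on `T`
  set Ep : Finset ℕ := (Ioc 0 x).filter Even with hEp
  have hTA : T ⊆ {N ∈ Ioc 0 x | Even N ∧ ∃ p q : ℕ, p.Prime ∧ q.Prime ∧ p + q = N} := by
    intro N hN
    rw [hT, mem_filter, hEhi, mem_filter, hE, mem_filter, mem_range] at hN
    obtain ⟨⟨⟨hNx, he⟩, _⟩, hpos⟩ := hN
    unfold SingularSeries.goldbachCount at hpos
    obtain ⟨pq, hpq⟩ := card_pos.mp hpos
    rw [mem_filter, Finset.HasAntidiagonal.mem_antidiagonal] at hpq
    have hN2 : 2 ≤ N := by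
      have := hpq.2.1.two_le
      omega
    rw [mem_filter, mem_Ioc]
    exact ⟨⟨by omega, by omega⟩, he, pq.1, pq.2, hpq.2.1, hpq.2.2, hpq.1⟩
  have hTEp : T ⊆ Ep := by
    intro N hN
    have h := hTA hN
    rw [mem_filter] at h
    rw [hEp, mem_filter]
    exact ⟨h.1, h.2.1⟩
  have hf0 : ∀ N ∈ T, 0 ≤ f N := fun N _ => oddSingularFactor_nonneg N
  have hHolder : (∑ N ∈ T, f N) ^ 8 ≤ (#T : ℝ) ^ 7 * (259.55 * x) := by
    have h1 := pow8_sum_le T f hf0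
    have h2 : ∑ N ∈ T, f N ^ 8 ≤ 259.55 * x :=
      (sum_le_sum_of_subset_of_nonneg hTEp fun N _ _ => by positivity).trans
        (sum_even_oddSingularFactor_pow8_le x)
    exact h1.trans (mul_le_mul_of_nonneg_left h2 (by positivity))
  set Ax : ℝ := ((#{N ∈ Ioc 0 x | Even N ∧ ∃ p q : ℕ, p.Prime ∧ q.Prime ∧ p + q = N} : ℕ) : ℝ) with hAx
  have hTcard : (#T : ℝ) ≤ Ax := by rw [hAx]; exact_mod_cast card_le_card hTA
  -- the final algebra: `(F x)⁸ ≤ A⁸·|T|⁷·259.55·x` and `κ⁷·259.55·A⁸ ≤ F⁸` give `|T| ≥ κ·x`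
  have hF0' : 0 ≤ F := hF0
  have hFx0 : 0 ≤ F * x := mul_nonneg hF0' hx0.le
  have hchain : (F * x) ^ 8 ≤ A ^ 8 * ((#T : ℝ) ^ 7 * (259.55 * x)) := by
    calc (F * x) ^ 8 ≤ (A * ∑ N ∈ T, f N) ^ 8 := pow_le_pow_left₀ hFx0 hFx 8
      _ = A ^ 8 * (∑ N ∈ T, f N) ^ 8 := by ring
      _ ≤ A ^ 8 * ((#T : ℝ) ^ 7 * (259.55 * x)) := mul_le_mul_of_nonneg_left hHolder (by positivity)
  by_contra hcon
  rw [not_le] at hcon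
  have hTlt : (#T : ℝ) < κ * x := lt_of_le_of_lt hTcard hcon
  have h7 : (#T : ℝ) ^ 7 < (κ * x) ^ 7 := pow_lt_pow_left₀ hTlt (by positivity) (by norm_num)
  have hlt : A ^ 8 * ((#T : ℝ) ^ 7 * (259.55 * x)) < A ^ 8 * ((κ * x) ^ 7 * (259.55 * x)) := by
    apply mul_lt_mul_of_pos_left _ (by positivity)
    exact mul_lt_mul_of_pos_right h7 (by positivity)
  have e1 : A ^ 8 * ((κ * x) ^ 7 * (259.55 * x)) = κ ^ 7 * (259.55 * A ^ 8) * (x : ℝ) ^ 8 := by ring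
  have e2 : (F * x) ^ 8 = F ^ 8 * (x : ℝ) ^ 8 := by ring
  have hκx : κ ^ 7 * (259.55 * A ^ 8) * (x : ℝ) ^ 8 ≤ F ^ 8 * (x : ℝ) ^ 8 :=
    mul_le_mul_of_nonneg_right hκ (by positivity)
  linarith [hchain, hlt, e1, e2, hκx]

/-! #### §15.3 Instances, glue, headline -/

/-- Numerics at `Λ = 53`: `17L² ≤ 16·16.48·TlowK(L/2 − 1.38632)` for `L ≥ 53`. [folklore] -/
private theorem kappa_numeric_53 {L : ℝ} (hL : 53 ≤ L) :
    17 * L ^ 2 ≤ 16 * (16.5 - 0.02) * TwoResidueSelbergExplicit.TlowK (L / 2 - 1.38632) := by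
  unfold TwoResidueSelbergExplicit.TlowK
  nlinarith [hL, mul_self_nonneg (L - 53)]

/-- **`A = 16.5` above `e^53`**. [cite: BatemanDiamond2004, §13.4 (13.13)–(13.14)] -/
theorem goldbachCount_le_1650 {N : ℕ} (hN : Real.exp 53 ≤ (N : ℝ)) (heven : Even N) :
    (SingularSeries.goldbachCount N : ℝ) ≤ 16.5 * oddSingularFactor N * (N : ℝ) / Real.log (N : ℝ) ^ 2 :=
  goldbachCount_le_of_numeric41 (by norm_num) (fun _ hL => kappa_numeric_53 hL) hN heven

/-- Numerics at `Λ = 50`: `17L² ≤ 16·16.73·TlowK(L/2 − 1.38632)` for `L ≥ 50`. [folklore] -/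
private theorem kappa_numeric_50 {L : ℝ} (hL : 50 ≤ L) :
    17 * L ^ 2 ≤ 16 * (16.75 - 0.02) * TwoResidueSelbergExplicit.TlowK (L / 2 - 1.38632) := by
  unfold TwoResidueSelbergExplicit.TlowK
  nlinarith [hL, mul_self_nonneg (L - 50)]

/-- **`A = 16.75` above `e^50`**. [cite: BatemanDiamond2004, §13.4 (13.13)–(13.14)] -/
theorem goldbachCount_le_1675 {N : ℕ} (hN : Real.exp 50 ≤ (N : ℝ)) (heven : Even N) :
    (SingularSeries.goldbachCount N : ℝ) ≤ 16.75 * oddSingularFactor N * (N : ℝ) / Real.log (N : ℝ) ^ 2 :=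
  goldbachCount_le_of_numeric41 (by norm_num) (fun _ hL => kappa_numeric_50 hL) hN heven

/-- **Unconditional, above `e^70`**: at least `x/76` EVEN Goldbach numbers in `(0, x]`
(`Λs = 53`, `A = 16.5`, `2·53 ≤ 70 + 36.5`; Hölder-8: `(1/76)⁷·259.55·16.5⁸ = 0.097 ≤ (0.4242·gHol 70 − 0.0057)⁸ = 0.120`).
[cite: Nathanson1996, Theorem 7.8 (proof, restricted to even N; explicit form proved here)] -/
theorem goldbach_even_count_ge_76 {x : ℕ} (hx : Real.exp 70 ≤ (x : ℝ)) :
    (x : ℝ) / 76 ≤ #{N ∈ Ioc 0 x | Even N ∧ ∃ p q : ℕ, p.Prime ∧ q.Prime ∧ p + q = N} := by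
  have h := goldbach_even_count_ge_holder_gap (Λs := 53) (Λ₀ := 70) (A := 16.5) (c₁ := 0.4243) (κ := 1 / 76)
    (by norm_num) (by norm_num) (by norm_num) (by norm_num)
    (fun N hN hev => goldbachCount_le_1650 hN hev) (by norm_num) (by norm_num)
    (fun y hy => sum_goldbachCount_ge_04243' ((Real.exp_le_exp.mpr (by norm_num)).trans hy))
    (by unfold gHol; norm_num) (by unfold gHol; norm_num) hx
  have e : (1 : ℝ) / 76 * x = x / 76 := by ring
  rw [e] at h
  exact h

/-- **Under (3.3), above `e^64`**: at least `x/64` EVEN Goldbach numbers in `(0, x]`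
(`Λs = 50`, `A = 16.75`, `2·50 ≤ 64 + 36.5`, `c₁ = 0.4995`). [cite: RosserSchoenfeld1962, Theorem 2, eq. (3.3) (as input)] -/
theorem goldbach_even_count_ge_of_RS_64 (hRS : Literature.NumberTheory.LFunctions.RosserSchoenfeld1962_theorem2)
    {x : ℕ} (hx : Real.exp 64 ≤ (x : ℝ)) :
    (x : ℝ) / 64 ≤ #{N ∈ Ioc 0 x | Even N ∧ ∃ p q : ℕ, p.Prime ∧ q.Prime ∧ p + q = N} := by
  have h := goldbach_even_count_ge_holder_gap (Λs := 50) (Λ₀ := 64) (A := 16.75) (c₁ := 0.4995) (κ := 1 / 64)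
    (by norm_num) (by norm_num) (by norm_num) (by norm_num)
    (fun N hN hev => goldbachCount_le_1675 hN hev) (by norm_num) (by norm_num)
    (fun y hy => sum_goldbachCount_ge_of_RS' hRS ((Real.exp_le_exp.mpr (by norm_num)).trans hy))
    (by unfold gHol; norm_num) (by unfold gHol; norm_num) hx
  have e : (1 : ℝ) / 64 * x = x / 64 := by ring
  rw [e] at h
  exact h

/-- **Unconditional count for all `y ≥ 1`**: `B(y) ≥ y/38` (shifted glue, `70 ≤ 1.8424·38`). [cite: Nathanson1996, Theorem 7.8 (explicit constant for the halved set proved here)] -/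
theorem half_count_ge_allN_38 {y : ℕ} (hy : 1 ≤ y) :
    (y : ℝ) / 38 ≤ #{b ∈ Ioc 0 y | b ∈ (({0, 1} : Set ℕ) ∪ {m | ∃ p q : ℕ, p.Prime ∧ q.Prime ∧ p + q = 2 * m})} := by
  have h := half_count_ge_allN_shift (Λ₀ := 70) (h := 38) (by norm_num) (by norm_num) (by norm_num)
    (fun x hx => by
      have h1 := goldbach_even_count_ge_76 hx
      have e : (x : ℝ) / (2 * ((38 : ℕ) : ℝ)) = (x : ℝ) / 76 := by norm_num
      rw [e]
      exact h1) hy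
  exact_mod_cast h

/-- **Under (3.3), all `y ≥ 1`**: `B(y) ≥ y/32` (shifted RS glue, `64 ≤ 2·32`).
[cite: RosserSchoenfeld1962, Theorem 2, eq. (3.3) (as input)] -/
theorem half_count_ge_allN_of_RS_32 (hRS : Literature.NumberTheory.LFunctions.RosserSchoenfeld1962_theorem2)
    {y : ℕ} (hy : 1 ≤ y) :
    (y : ℝ) / 32 ≤ #{b ∈ Ioc 0 y | b ∈ (({0, 1} : Set ℕ) ∪ {m | ∃ p q : ℕ, p.Prime ∧ q.Prime ∧ p + q = 2 * m})} := by
  have h := half_count_ge_allN_shift_RS hRS (Λ₀ := 64) (h := 32) (by norm_num) (by norm_num) (by norm_num)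
    (fun x hx => by
      have h1 := goldbach_even_count_ge_of_RS_64 hRS hx
      have e : (x : ℝ) / (2 * ((32 : ℕ) : ℝ)) = (x : ℝ) / 64 := by norm_num
      rw [e]
      exact h1) hy
  exact_mod_cast h

/-- **The halved density, `1/38`**: `σ({0, 1} ∪ {m : 2m = p + q}) ≥ 1/38`, unconditionally. [cite: Nathanson1996, Theorem 7.8 (explicit constant for the halved set proved here)] -/
theorem schnirelmannDensity_half_ge_38 :
    (1 : ℝ) / 38 ≤ schnirelmannDensity
      (({0, 1} : Set ℕ) ∪ {m | ∃ p q : ℕ, p.Prime ∧ q.Prime ∧ p + q = 2 * m}) := by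
  have h := schnirelmannDensity_ge_of_count' (K := 38)
    (S := ({0, 1} : Set ℕ) ∪ {m | ∃ p q : ℕ, p.Prime ∧ q.Prime ∧ p + q = 2 * m})
    (fun N hN => by have := half_count_ge_allN_38 hN; exact_mod_cast this)
  exact_mod_cast h

/-- **The halved density under (3.3), `1/32`**. [cite: RosserSchoenfeld1962, Theorem 2, eq. (3.3) (as input)] -/
theorem schnirelmannDensity_half_ge_of_RS_32
    (hRS : Literature.NumberTheory.LFunctions.RosserSchoenfeld1962_theorem2) :
    (1 : ℝ) / 32 ≤ schnirelmannDensity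
      (({0, 1} : Set ℕ) ∪ {m | ∃ p q : ℕ, p.Prime ∧ q.Prime ∧ p + q = 2 * m}) := by
  have h := schnirelmannDensity_ge_of_count' (K := 32)
    (S := ({0, 1} : Set ℕ) ∪ {m | ∃ p q : ℕ, p.Prime ∧ q.Prime ∧ p + q = 2 * m})
    (fun N hN => by have := half_count_ge_allN_of_RS_32 hRS hN; exact_mod_cast this)
  exact_mod_cast h

/-- ★★★★★★★ **The Shnirel'man–Goldbach theorem, explicit and unconditional — the best constant of this file: every
integer `N ≥ 2` is a sum of at most `77` primes** (the SHIFTED embedding `p ↦ (p+3)/2`: `B(y) ≥ π(2y−3) + 1`, so the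
glue needs only `h ≥ 28`, `Λ₀ ≤ 1.8424·h`; the Hölder-8 count of §14 run at `e^53` (sieve, `A = 16.5`) and `e^70`
(count): `|T| ≥ x/76`; `70 ≤ 1.8424·38`; halving, Mann: `38 • B = ℕ`, `2·38 + 1`).  No hypotheses, no named facts.
[cite: Nathanson1996, Thm 7.9 (explicit constant proved here)] -/
theorem schnirelmann_goldbach_le_77 (N : ℕ) (hN : 2 ≤ N) :
    ∃ M : Multiset ℕ, (∀ p ∈ M, p.Prime) ∧ Multiset.card M ≤ 77 ∧ M.sum = N := by
  have hσ : (1 : ℝ) / ((38 : ℕ) : ℝ) ≤ schnirelmannDensity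
      (({0, 1} : Set ℕ) ∪ {m | ∃ p q : ℕ, p.Prime ∧ q.Prime ∧ p + q = 2 * m}) := by
    have := schnirelmannDensity_half_ge_38
    exact_mod_cast this
  exact sum_of_primes_of_half_density_mann (h := 38) (by norm_num) hσ N hN

/-- ★★ **Under Rosser–Schoenfeld (3.3): every integer `N ≥ 2` is a sum of at most `65` primes** (`σ(B) ≥ 1/32`;
shifted glue `Λ₀ ≤ 2h` with `π(n) ≥ n/log n`, `n ≥ 67`). [cite: RosserSchoenfeld1962, Theorem 2, eq. (3.3) (as input)] -/
theorem schnirelmann_goldbach_of_RS_le_65 (hRS : Literature.NumberTheory.LFunctions.RosserSchoenfeld1962_theorem2)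
    (N : ℕ) (hN : 2 ≤ N) :
    ∃ M : Multiset ℕ, (∀ p ∈ M, p.Prime) ∧ Multiset.card M ≤ 65 ∧ M.sum = N := by
  have hσ : (1 : ℝ) / ((32 : ℕ) : ℝ) ≤ schnirelmannDensity
      (({0, 1} : Set ℕ) ∪ {m | ∃ p q : ℕ, p.Prime ∧ q.Prime ∧ p + q = 2 * m}) := by
    have := schnirelmannDensity_half_ge_of_RS_32 hRS
    exact_mod_cast this
  exact sum_of_primes_of_half_density_mann (h := 32) (by norm_num) hσ N hN

end Literature.NumberTheory.Sieve.ShnirelmanGoldbachExplicit
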